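import Literature.Probability.Percolation.FivePointBoundaryValues
import Literature.Probability.Percolation.TriDiscSeparation
import Literature.Probability.Percolation.TriSiteHalfCounting
import Literature.Probability.Percolation.TriDiscreteDomainProofs
import Literature.Probability.Percolation.TriMarkedDomainRotate
import HarnessLib

/-!
# The six-change dictionary for the five-point boundary classes (Khristoforov–Smirnov's Lemma 2 at `N = 3`), arc `A₀` and, by rotation, every arc

Topic `Literature/Probability/Percolation`; lane pcv-sawmu (CriticalPhenomena), five-point lineage (after `FivePointBoundaryValues`:
(B∂) class support / (N∂) transport at boundary edges) and three-disorder lineage (`KhSThreeDisorderCrossing`: the same method at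
`k = 3`).

Khristoforov–Smirnov, *Percolation and O(1) loop model*, arXiv:2111.15612v1, **Lemma 2** (pp. 2–3, for `2n` boundary disorders and the
alternating boundary colouring): the map `σ ↦ ξ(σ)` (bicoloured half-edges) is a bijection from colourings onto the loop configurations
with the given disorders, and the link pattern of `ξ(σ)` is read off the connectivities of `σ`. The five-point files use the case
`n = 2` (four colour changes, one reference corner); the boundary values of the five-point observables at a boundary `H_G`-edge
`e = {x, x'}` of the arc `A_i` live in the SIX-disorder space `W_Ω(y₀, …, y₄, z)` (`Bdry.loopSpace6b`, both halves `s ∈ {x, x'}`) and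
— by (B∂) `Bdry.classSupport_b` — in the five classes `(i,A)`, `(i,B)`, `(i+1,A)`, `(i+1,B)`, `(i+3,A)` = the five non-crossing perfect
matchings of the hexagon `(z, y_{i+1}, y_{i+2}, y_{i+3}, y_{i+4}, y_i)`. This file types the case `n = 3` of Lemma 2 for these classes on
the arc `A₀` of a five-marked Bollobás–Riordan domain `D : TriMarkedDomain 5`:

* the SIX-change frame `frs m` (colour changes at the five corners and at the split position `m` inside `A₀`; blue = `true` on the
  darts of `A₀` before the split, on `A₁` and on `A₃`; yellow on `A₀` from the split, on `A₂` and `A₄`), the loop configuration `phiS m T`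
  of a colouring `T ⊆ G` and its parity profile `odd_xiDeg_phiS_iff` (odd faces = the five corners XOR the split face);
* the map `PhiS` (`σ ↦ ξ(σ)`, split position `p + 1` or `p` according to the colour of the hexagon `H_g` of `z = (g, o)`; odd endpoint
  `sOfS σ ∈ {x, x'}`): `PhiS_mem` (image in `Bdry.loopSpace6b D g o (sOfS σ)`), `PhiS_injOn`, ★ `PhiS_image_eq` (bijection onto both halves);
* ★ the SIDE-CHAIN LEMMA `sconn_of_reachable`: if two odd faces (corners, or the split face) are linked in `ξ(σ)`, then the blue
  (resp. yellow) frame blocks at the two ends are joined through blue (resp. yellow) sites of `G`, possibly via the third block of that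
  colour — the cells on one side of an interface form a chain; proved by propagating a bond invariant along the component
  (the `k = 3` file's method, with «joined to `∂_{y₀z}`» replaced by «joined to a block already reached»);
* ★★ the dictionary `ev_of_inClassb` (class ⟹ connectivity event), the exclusivity of the five events `ev_excl` (`IsTriDisc.not_interleaved`),
  and ★★★ the counting identities `card_class_eq_card_ev` / `card_pattern_eq_card_ev` and the probabilities `patternProb_eq_prob_evS`:
  on `A₀`, with `P₀ = ∂_{y₀ z}` (`arcP0`), `P₁ = ∂_{z y₁}` (`arcP1`, both containing the hexagon of `z`) and `A₁, …, A₄` the arcs,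
  `H_{1,A}(e) = P[at least two of {P₀ ↔ A₁, A₁ ↔ A₃, A₃ ↔ P₀} open]`, `H_{1,B}(e) = P[P₀ ↔ A₁ open ∧ A₂ ↔ A₄ closed]`,
  `H_{0,A}(e) = P[at least two of {P₁ ↔ A₂, A₂ ↔ A₄, A₄ ↔ P₁} closed]`, `H_{0,B}(e) = P[P₁ ↔ A₄ closed ∧ A₁ ↔ A₃ open]`,
  `H_{3,A}(e) = P[P₀ ↔ A₃ open ∧ P₁ ↔ A₂ closed]` (`patternProb_one_A/_one_B/_zero_A/_zero_B/_three_A`; all `↔` = site paths of `G`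
  between the arcs' hexagons, critical site percolation), and the PARTITION `existsUnique_ev` (every colouring satisfies exactly one event);
* EVERY ARC (section `Rot`): the five-point layer under `TriMarkedDomain.rotate` (`rotate_patternProb : H_{r,M}(D.rotate) = H_{r+1,M}(D)`, …),
  the rotation-invariant sub-arcs `arcToA D a g o = ∂_{y_a z}`, `arcFromA D a g o = ∂_{z y_{a+1}}`, and for `(g, o) ∈ D.stretch a` the same
  five identities with all indices shifted by `a` (`patternProb_succ_A/_succ_B/_self_A/_self_B/_add_three_A`); with (B∂) these are ALL
  boundary values of the five-point observables; section `BoundaryData`: the boundary values of the sparse observables `F_j` on `A_a` as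
  crossing probabilities times cube roots of unity (`sparseObs_arc_*_eq_prob`) — the discrete Riemann–Hilbert data made explicit.

Status in print: the colouring ↔ loop-configuration correspondence for `k` boundary disorders is
[cite: KhristoforovSmirnov2021, §1.3 (arXiv v1 p. 3)] (spinor colourings; for boundary disorders two copies of Ω: «if each u_j lies on the
boundary then Ω̃_{u₁,…,u_k} has the same structure of faces and mid-edges as the disjoint union of two copies of Ω … ξ = ρ(ξ̃(σ)) is a loop
configuration with disorders at u₁, …, u_k, the vice-versa is also true»), the crossing clause for `k = 4` is
[cite: KhristoforovSmirnov2021, §1.2 Lemma 2 (pp. 2–3)]; this file kernel-checks the `k = 6` boundary case on `A₀` with the explicit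
five-class crossing dictionary (the `k = 6` boundary instance of the printed correspondence, with the link-pattern ↔ arc-crossing table
made explicit; print: `k = 4`, Lemma 2) — CONSOLIDATION AT KERNEL RIGOUR (dictionary table: lane's, XS; every other arc by relabelling of the marks [cite: BollobasRiordan2006,
Ch. 7 §7.2.3 p. 197]) (lit-2 g16/g17, 2026-08-23). The
five-point observables `H_{r,M}` themselves are the lane's (not in print).
Scope: every arc `A_a` — `A₀` directly (sections through `Counting`), `A_a` by the cyclic relabelling of the marks (`TriMarkedDomain.rotate`;
section `Rot`, `Six.patternProb_succ_A` … `patternProb_add_three_A`, [cite: BollobasRiordan2006, Ch. 7 §7.2.3 p. 197 («or by relabelling»)]);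
Bollobás–Riordan marks; nothing of the scaling limit.

## References
* M. Khristoforov, S. Smirnov, *Percolation and O(1) loop model*, arXiv:2111.15612 (2021): §1.1 (p. 2, «X ↔ Y»), §1.2 Lemma 2
  (pp. 2–3), §1.3 (p. 3, the correspondence for k disorders), §2 eq. (4) (p. 5) — arXiv v1 pages.
* B. Bollobás, O. Riordan, *Percolation*, CUP (2006), Ch. 7 §7.2.2 (printed pp. 191–195; Lemma 5 «but not both» p. 193; marked domains
  and the cyclic order of the marks pp. 191–193).
-/

open Finset

namespace Literature.Probability.Percolation.FivePoint

namespace Six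

open Literature.Probability.Percolation Literature.Probability.LatticeModels
open Literature.Probability.Percolation.FivePoint.N5
open Literature.Probability.Percolation.FivePoint.Bdry
open TriMarkedDomain

section Frame

variable (D : TriMarkedDomain 5)

/-- the boundary dart at position `n` of the boundary cycle. [cite: KhristoforovSmirnov2021, §1.2 Lemma 2 (p. 3)] -/
noncomputable def bdart (n : ℕ) : Site 2 × Site 2 := triBdryIter D.verts D.base n

/-- **the six-change frame with split position `m`** (`0 ≤ m ≤ pos 1`): the outer colour beyond the boundary dart at position `n` is
BLUE (`true`) on the darts of `A₀` at positions `< m`, on `A₁` and on `A₃`; YELLOW (`false`) on the darts of `A₀` at positions `≥ m`, on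
`A₂` and on `A₄` — the alternating colouring with six changes: at the five corners and at `z` (between the positions `m - 1` and `m`).
[cite: KhristoforovSmirnov2021, §1.2 Lemma 2 (p. 3)] -/
noncomputable def frs (m n : ℕ) : Bool :=
  if posIdx D n = 0 then decide (n % #(triBdryDarts D.verts) < m) else decide ((posIdx D n).val % 2 = 1)

/-- the colour of the cell `x` seen across the bond from `y` under the colouring `T` of `G` and the frame `frs m`.
[cite: KhristoforovSmirnov2021, §1.2 Lemma 2 (p. 3)] -/
noncomputable def cscol (m : ℕ) (T : Finset (Site 2)) (y x : Site 2) : Bool := by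
  classical
  exact if x ∈ D.verts then decide (x ∈ T) else frs D m (D.dpos (y, x))

/-- the bond `{a, b}` is bicoloured under `T` and the frame `frs m`. [cite: KhristoforovSmirnov2021, §1.2 Lemma 2 (p. 3)] -/
def BicS (m : ℕ) (T : Finset (Site 2)) (a b : Site 2) : Prop := cscol D m T b a ≠ cscol D m T a b

/-- `BicS` is symmetric. [cite: KhristoforovSmirnov2021, §1.2 Lemma 2 (p. 3)] -/
theorem bicS_comm (m : ℕ) (T : Finset (Site 2)) (a b : Site 2) : BicS D m T a b ↔ BicS D m T b a := by
  unfold BicS; exact ne_comm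

open Classical in
/-- **`ξ(σ)` under the six-change frame**: the bicoloured `H_G`-bonds. [cite: KhristoforovSmirnov2021, §1.2 Lemma 2 (p. 3)] -/
noncomputable def phiS (m : ℕ) (T : Finset (Site 2)) : Finset (Sym2 (Site 2)) :=
  (hBonds D).filter fun e => Sym2.lift ⟨fun a b => BicS D m T a b, fun a b => propext (bicS_comm D m T a b)⟩ e

/-- **the sixth disorder `s_m`**: the face spanned by the boundary darts at positions `m - 1` and `m`. [cite: KhristoforovSmirnov2021, §1.2 (pp. 2–3)] -/
noncomputable def sFaceS (m : ℕ) : HexVertex :=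
  leftFace (bdart D (m + (#(triBdryDarts D.verts) - 1))).1 (bdart D (m + (#(triBdryDarts D.verts) - 1))).2

variable {D}

/-! ### the boundary cycle: positions -/

/-- `bdart n` is a boundary dart. [cite: KhristoforovSmirnov2021, §1.2 Lemma 2 (p. 3)] -/
theorem bdart_mem (n : ℕ) : bdart D n ∈ triBdryDarts D.verts := triBdryIter_mem D.base_mem n

/-- the successor of `bdart n` is `bdart (n + 1)`. [cite: KhristoforovSmirnov2021, §1.2 Lemma 2 (p. 3)] -/
theorem succ_bdart (n : ℕ) : triBdrySucc D.verts (bdart D n) = bdart D (n + 1) := by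
  unfold bdart; rw [triBdryIter_succ]

/-- position of `bdart n`. [cite: KhristoforovSmirnov2021, §1.2 Lemma 2 (p. 3)] -/
theorem dpos_bdart (n : ℕ) : D.dpos (bdart D n) = n % #(triBdryDarts D.verts) := D.dpos_iter n

/-- `bdart` is periodic. [cite: KhristoforovSmirnov2021, §1.2 Lemma 2 (p. 3)] -/
theorem bdart_mod (n : ℕ) : bdart D (n % #(triBdryDarts D.verts)) = bdart D n := D.isTriDisc.iter_mod n

/-- a boundary dart is `bdart` of its position. [cite: KhristoforovSmirnov2021, §1.2 Lemma 2 (p. 3)] -/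
theorem bdart_dpos {d : Site 2 × Site 2} (hd : d ∈ triBdryDarts D.verts) : bdart D (D.dpos d) = d := D.iter_dpos hd

/-- the successor of the dart at position `m + L - 1` is the dart at position `m`. [cite: KhristoforovSmirnov2021, §1.2 Lemma 2 (p. 3)] -/
theorem succ_bdart_pred (m : ℕ) : triBdrySucc D.verts (bdart D (m + (#(triBdryDarts D.verts) - 1))) = bdart D m := by
  rw [succ_bdart]
  have hL := D.isTriDisc.card_pos
  rw [show m + (#(triBdryDarts D.verts) - 1) + 1 = m + #(triBdryDarts D.verts) by omega]
  exact D.isTriDisc.iter_add_card m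

/-- the boundary successor is injective on boundary darts. [cite: KhristoforovSmirnov2021, §1.2 Lemma 2 (p. 3)] -/
private theorem succ_injective {d d' : Site 2 × Site 2} (hd : d ∈ triBdryDarts D.verts) (hd' : d' ∈ triBdryDarts D.verts)
    (h : triBdrySucc D.verts d = triBdrySucc D.verts d') : d = d' := by
  have h1 := D.dpos_succ hd
  have h2 := D.dpos_succ hd'
  rw [h] at h1
  rw [h1] at h2
  have hL := D.isTriDisc.card_pos
  have hlt := D.dpos_lt hd
  have hlt' := D.dpos_lt hd'
  have : D.dpos d = D.dpos d' := by
    by_cases ha : D.dpos d + 1 < #(triBdryDarts D.verts) <;> by_cases hb : D.dpos d' + 1 < #(triBdryDarts D.verts)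
    · rw [Nat.mod_eq_of_lt ha, Nat.mod_eq_of_lt hb] at h2; omega
    · rw [Nat.mod_eq_of_lt ha, show D.dpos d' + 1 = #(triBdryDarts D.verts) by omega, Nat.mod_self] at h2; omega
    · rw [Nat.mod_eq_of_lt hb, show D.dpos d + 1 = #(triBdryDarts D.verts) by omega, Nat.mod_self] at h2; omega
    · omega
  rw [← bdart_dpos hd, ← bdart_dpos hd', this]

/-- if `succ d = bdart m` then `d = bdart (m + L - 1)`. [cite: KhristoforovSmirnov2021, §1.2 Lemma 2 (p. 3)] -/
theorem eq_bdart_pred_of_succ_eq {d : Site 2 × Site 2} (hd : d ∈ triBdryDarts D.verts) {m : ℕ}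
    (h : triBdrySucc D.verts d = bdart D m) : d = bdart D (m + (#(triBdryDarts D.verts) - 1)) :=
  succ_injective hd (bdart_mem _) (h.trans (succ_bdart_pred m).symm)

/-- the boundary successor moves every dart. [cite: KhristoforovSmirnov2021, §1.2 Lemma 2 (p. 3)] -/
private theorem succ_ne_self {d : Site 2 × Site 2} (hd : d ∈ triBdryDarts D.verts) : triBdrySucc D.verts d ≠ d := by
  obtain ⟨hu, hv, hadj⟩ := mem_triBdryDarts.1 hd
  have h1 := triGraph_adj_triLeftApex_left hadj
  have h2 := triGraph_adj_triLeftApex_right hadj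
  unfold triBdrySucc
  split_ifs with hw
  · intro e; exact h1.ne (congrArg Prod.fst e).symm
  · intro e; exact h2.ne (congrArg Prod.snd e)

/-! ### the frame: where the colour changes -/

/-- the frame only depends on the position modulo the length. [cite: KhristoforovSmirnov2021, §1.2 Lemma 2 (p. 3)] -/
theorem frs_mod (m n : ℕ) : frs D m (n % #(triBdryDarts D.verts)) = frs D m n := by
  unfold frs; rw [posIdx_mod, Nat.mod_mod]

/-- position index `0`: blue iff the position is `< m`. [cite: KhristoforovSmirnov2021, §1.2 Lemma 2 (p. 3)] -/
theorem frs_of_posIdx_zero {m n : ℕ} (h : posIdx D n = 0) : frs D m n = decide (n % #(triBdryDarts D.verts) < m) := by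
  unfold frs; rw [if_pos h]

/-- position index `≠ 0`: blue iff the index is odd (`A₁`, `A₃`). [cite: KhristoforovSmirnov2021, §1.2 Lemma 2 (p. 3)] -/
theorem frs_of_posIdx_ne_zero {m n : ℕ} (h : posIdx D n ≠ 0) : frs D m n = decide ((posIdx D n).val % 2 = 1) := by
  unfold frs; rw [if_neg h]

/-- positions of index `0` are `< pos 1`. [cite: KhristoforovSmirnov2021, §1.2 Lemma 2 (p. 3)] -/
theorem mod_lt_pos_one_of_posIdx_zero {n : ℕ} (h : posIdx D n = 0) : n % #(triBdryDarts D.verts) < D.pos 1 := by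
  have := (pos_posIdx_le D n).2
  rw [h, nextPos_of_lt D 0 (by decide)] at this
  exact this

/-- positions `< pos 1` have index `0`. [cite: KhristoforovSmirnov2021, §1.2 Lemma 2 (p. 3)] -/
theorem posIdx_zero_of_lt {n : ℕ} (h : n % #(triBdryDarts D.verts) < D.pos 1) : posIdx D n = 0 :=
  posIdx_unique D (i := 0) (by rw [(pos_facts D).1]; exact Nat.zero_le _) (by rw [nextPos_of_lt D 0 (by decide)]; exact h)

/-- positions of index `≠ 0` are `≥ pos 1`. [cite: KhristoforovSmirnov2021, §1.2 Lemma 2 (p. 3)] -/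
theorem pos_one_le_of_posIdx_ne_zero {n : ℕ} (h : posIdx D n ≠ 0) : D.pos 1 ≤ n % #(triBdryDarts D.verts) := by
  by_contra hlt
  exact h (posIdx_zero_of_lt (by omega))

/-- positions of index `i` lie in `[pos i, nextPos i)`. [cite: KhristoforovSmirnov2021, §1.2 Lemma 2 (p. 3)] -/
theorem mod_mem_of_posIdx_eq {n : ℕ} {i : Fin 5} (h : posIdx D n = i) :
    D.pos i ≤ n % #(triBdryDarts D.verts) ∧ n % #(triBdryDarts D.verts) < D.nextPos i := by
  have := pos_posIdx_le D n
  rw [h] at this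
  exact this

/-- the last position has index `4`. [cite: KhristoforovSmirnov2021, §1.2 Lemma 2 (p. 3)] -/
theorem posIdx_last : posIdx D (#(triBdryDarts D.verts) - 1) = 4 := by
  obtain ⟨h00, h01, h12, h23, h34, h4L⟩ := pos_facts D
  have hL := D.isTriDisc.card_pos
  exact posIdx_unique D (by rw [Nat.mod_eq_of_lt (by omega)]; omega) (by rw [nextPos_four, Nat.mod_eq_of_lt (by omega)]; omega)

/-- **no change away from the marks and `m`**: consecutive positions whose second is neither a mark nor `m` carry the same position
index, the same frame colour and the same side of the split. [cite: KhristoforovSmirnov2021, §1.2 Lemma 2 (p. 3)] -/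
theorem frame_succ_of_not_change {m n : ℕ} (hmark : ∀ i : Fin 5, (n + 1) % #(triBdryDarts D.verts) ≠ D.pos i)
    (hz : (n + 1) % #(triBdryDarts D.verts) ≠ m) :
    posIdx D (n + 1) = posIdx D n ∧ frs D m (n + 1) = frs D m n ∧
      (n % #(triBdryDarts D.verts) < m ↔ (n + 1) % #(triBdryDarts D.verts) < m) := by
  have hL := D.isTriDisc.card_pos
  have hs := posIdx_succ_eq D hmark
  have h0 : (n + 1) % #(triBdryDarts D.verts) ≠ 0 := by rw [← (pos_facts D).1]; exact hmark 0
  have hsucc := succ_mod_eq (n := n) hL h0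
  have hiff : (n % #(triBdryDarts D.verts) < m ↔ (n + 1) % #(triBdryDarts D.verts) < m) := by
    rw [hsucc]; omega
  refine ⟨hs, ?_, hiff⟩
  unfold frs
  rw [hs]
  split_ifs with h1
  · rw [Bool.decide_congr hiff.symm]
  · rfl

/-- **at a mark**: the colour changes at the marks `2`, `3`, `4`, at the mark `0` unless `m = 0`, and at the mark `1` unless `m = pos 1`.
[cite: KhristoforovSmirnov2021, §1.2 Lemma 2 (p. 3)] -/
theorem frs_succ_ne_iff_of_mark {m n : ℕ} (hm : m ≤ D.pos 1) {i : Fin 5} (hi : (n + 1) % #(triBdryDarts D.verts) = D.pos i) :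
    frs D m (n + 1) ≠ frs D m n ↔ D.pos i ≠ m := by
  obtain ⟨h00, h01, h12, h23, h34, h4L⟩ := pos_facts D
  have hL := D.isTriDisc.card_pos
  obtain ⟨hs1, hs0⟩ := posIdx_of_succ_mod_eq_pos D hi
  fin_cases i
  · -- mark 0: from index 4 (yellow) to position 0 (blue iff 0 < m)
    simp only [Fin.zero_eta, Fin.isValue] at hi hs1 hs0 ⊢
    have e4 : posIdx D n = 4 := by rw [hs0]; decide
    rw [frs_of_posIdx_ne_zero (n := n) (by rw [e4]; decide), e4, frs_of_posIdx_zero hs1, hi, h00]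
    by_cases h0m : 0 < m
    · simp [h0m]; omega
    · simp [h0m]; omega
  · -- mark 1: from index 0 at position pos 1 - 1 to index 1 (blue)
    simp only [Fin.mk_one, Fin.isValue] at hi hs1 hs0 ⊢
    have e0 : posIdx D n = 0 := by rw [hs0]; decide
    rw [frs_of_posIdx_ne_zero (n := n + 1) (by rw [hs1]; decide), hs1, frs_of_posIdx_zero e0]
    have hn : n % #(triBdryDarts D.verts) = D.pos 1 - 1 := by
      have := succ_mod_eq (n := n) hL (by rw [hi]; omega)
      omega
    rw [hn]
    by_cases hc : D.pos 1 - 1 < m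
    · simp [hc]; omega
    · simp [hc]; omega
  · simp only [Fin.reduceFinMk, Fin.isValue] at hi hs1 hs0 ⊢
    have e1 : posIdx D n = 1 := by rw [hs0]; decide
    have hne : frs D m (n + 1) ≠ frs D m n := by
      rw [frs_of_posIdx_ne_zero (n := n + 1) (by rw [hs1]; decide), hs1, frs_of_posIdx_ne_zero (n := n) (by rw [e1]; decide), e1]
      decide
    exact ⟨fun _ => by omega, fun _ => hne⟩
  · simp only [Fin.reduceFinMk, Fin.isValue] at hi hs1 hs0 ⊢
    have e2 : posIdx D n = 2 := by rw [hs0]; decide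
    have hne : frs D m (n + 1) ≠ frs D m n := by
      rw [frs_of_posIdx_ne_zero (n := n + 1) (by rw [hs1]; decide), hs1, frs_of_posIdx_ne_zero (n := n) (by rw [e2]; decide), e2]
      decide
    exact ⟨fun _ => by omega, fun _ => hne⟩
  · simp only [Fin.reduceFinMk, Fin.isValue] at hi hs1 hs0 ⊢
    have e3 : posIdx D n = 3 := by rw [hs0]; decide
    have hne : frs D m (n + 1) ≠ frs D m n := by
      rw [frs_of_posIdx_ne_zero (n := n + 1) (by rw [hs1]; decide), hs1, frs_of_posIdx_ne_zero (n := n) (by rw [e3]; decide), e3]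
      decide
    exact ⟨fun _ => by omega, fun _ => hne⟩

/-- **at the split position `m`** (not a mark): the colour changes. [cite: KhristoforovSmirnov2021, §1.2 Lemma 2 (p. 3)] -/
theorem frs_succ_ne_of_split {m n : ℕ} (hm : m ≤ D.pos 1) (hmark : ∀ i : Fin 5, (n + 1) % #(triBdryDarts D.verts) ≠ D.pos i)
    (hz : (n + 1) % #(triBdryDarts D.verts) = m) : frs D m (n + 1) ≠ frs D m n := by
  have hL := D.isTriDisc.card_pos
  obtain ⟨h00, h01, h12, h23, h34, h4L⟩ := pos_facts D
  have hs := posIdx_succ_eq D hmark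
  have h0 : (n + 1) % #(triBdryDarts D.verts) ≠ 0 := by rw [← h00]; exact hmark 0
  have hsucc := succ_mod_eq (n := n) hL h0
  have hm1 : m ≠ D.pos 1 := fun e => hmark 1 (hz.trans e)
  have hlt : (n + 1) % #(triBdryDarts D.verts) < D.pos 1 := by rw [hz]; omega
  have e0' : posIdx D (n + 1) = 0 := posIdx_zero_of_lt hlt
  have e0 : posIdx D n = 0 := hs ▸ e0'
  rw [frs_of_posIdx_zero e0', frs_of_posIdx_zero e0, hz]
  have hn : n % #(triBdryDarts D.verts) = m - 1 := by omega
  rw [hn]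
  have h2 : m - 1 < m := by omega
  simp [h2]

end Frame

section Config

variable {D : TriMarkedDomain 5}

/-- Auxiliary. [folklore] -/
private theorem fin3_cases_s (v j : Fin 3) : j = v ∨ j = v + 1 ∨ j = v + 2 := by revert v j; decide

/-- Auxiliary. [folklore] -/
private theorem fin3_add_one_add_two_s (j : Fin 3) : j + 1 + 2 = j := by rw [add_assoc]; exact add_eq_left.2 (by decide)

/-- Auxiliary. [folklore] -/
private theorem fin3_add_one_add_one_s (j : Fin 3) : j + 1 + 1 = j + 2 := by rw [add_assoc]; rfl

/-- Auxiliary. [folklore] -/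
private theorem fin3_add_two_add_one_s (j : Fin 3) : j + 2 + 1 = j := by rw [add_assoc]; exact add_eq_left.2 (by decide)

/-- Auxiliary. [folklore] -/
private theorem fin3_add_two_add_two_s (j : Fin 3) : j + 2 + 2 = j + 1 := by rw [add_assoc]; rfl

/-- Auxiliary. [folklore] -/
private theorem fin3_ne_add_one_s (j : Fin 3) : j ≠ j + 1 := by revert j; decide

/-- Auxiliary. [folklore] -/
private theorem fin3_ne_add_two_s (j : Fin 3) : j ≠ j + 2 := by revert j; decide

/-- Auxiliary. [folklore] -/
private theorem fin3_add_two_ne_add_one_s (j : Fin 3) : j + 2 ≠ j + 1 := by revert j; decide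

/-- Auxiliary. [folklore] -/
private theorem fin6_add_two_ne_s (k : Fin 6) : k + 1 + 1 ≠ k := by revert k; decide

/-! ### the loop configuration of a colouring: membership -/

/-- `BicS` across a bond of `G`. [cite: KhristoforovSmirnov2021, §1.2 Lemma 2 (p. 3)] -/
theorem bicS_iff_of_mem_mem (m : ℕ) (T : Finset (Site 2)) {u v : Site 2} (hu : u ∈ D.verts) (hv : v ∈ D.verts) :
    BicS D m T u v ↔ (u ∈ T ↔ v ∉ T) := by
  unfold BicS cscol
  rw [if_pos hu, if_pos hv]
  by_cases h1 : u ∈ T <;> by_cases h2 : v ∈ T <;> simp [h1, h2]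

/-- `BicS` across a boundary dart: the inner state differs from the frame colour. [cite: KhristoforovSmirnov2021, §1.2 Lemma 2 (p. 3)] -/
theorem bicS_iff_of_mem_not_mem (m : ℕ) (T : Finset (Site 2)) {u w : Site 2} (hu : u ∈ D.verts) (hw : w ∉ D.verts) :
    BicS D m T u w ↔ (u ∈ T ↔ frs D m (D.dpos (u, w)) = false) := by
  unfold BicS cscol
  rw [if_pos hu, if_neg hw]
  by_cases h1 : u ∈ T <;> cases frs D m (D.dpos (u, w)) <;> simp [h1]

open Classical in
/-- membership of a bond in `phiS`. [cite: KhristoforovSmirnov2021, §1.2 Lemma 2 (p. 3)] -/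
theorem mk_mem_phiS_iff (m : ℕ) (T : Finset (Site 2)) {u v : Site 2} (hadj : triGraph.Adj u v) (hG : u ∈ D.verts ∨ v ∈ D.verts) :
    s(u, v) ∈ phiS D m T ↔ BicS D m T u v := by
  unfold phiS
  rw [Finset.mem_filter, Sym2.lift_mk]
  exact ⟨fun h => h.2, fun h => ⟨mem_hBonds D hadj hG, h⟩⟩

/-- `phiS ⊆ hBonds`. [cite: KhristoforovSmirnov2021, §1.2 Lemma 2 (p. 3)] -/
theorem phiS_subset (m : ℕ) (T : Finset (Site 2)) : phiS D m T ⊆ hBonds D := by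
  classical
  unfold phiS; exact Finset.filter_subset _ _

/-- an inner bond in `phiS`. [cite: KhristoforovSmirnov2021, §1.2 Lemma 2 (p. 3)] -/
theorem mk_mem_phiS_iff_of_mem_mem (m : ℕ) (T : Finset (Site 2)) {u v : Site 2} (hadj : triGraph.Adj u v) (hu : u ∈ D.verts)
    (hv : v ∈ D.verts) : s(u, v) ∈ phiS D m T ↔ (u ∈ T ↔ v ∉ T) := by
  rw [mk_mem_phiS_iff m T hadj (Or.inl hu), bicS_iff_of_mem_mem m T hu hv]

/-- a boundary bond in `phiS`. [cite: KhristoforovSmirnov2021, §1.2 Lemma 2 (p. 3)] -/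
theorem mk_mem_phiS_iff_of_mem_not_mem (m : ℕ) (T : Finset (Site 2)) {u w : Site 2} (hadj : triGraph.Adj u w) (hu : u ∈ D.verts)
    (hw : w ∉ D.verts) : s(u, w) ∈ phiS D m T ↔ (u ∈ T ↔ frs D m (D.dpos (u, w)) = false) := by
  rw [mk_mem_phiS_iff m T hadj (Or.inl hu), bicS_iff_of_mem_not_mem m T hu hw]

/-- the endpoints of a bond of `phiS`: one of them is in `G`, and a given outer endpoint forces the other one in. [cite: KhristoforovSmirnov2021, §1.2 Lemma 2 (p. 3)] -/
theorem mem_of_mk_mem_phiS {m : ℕ} {T : Finset (Site 2)} {u w : Site 2} (h : s(u, w) ∈ phiS D m T) (hw : w ∉ D.verts) :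
    u ∈ D.verts := by
  obtain ⟨a, b, hab, ha, -⟩ := exists_rep_of_mem_hBonds D (phiS_subset m T h)
  rcases Sym2.eq_iff.1 hab with ⟨e1, -⟩ | ⟨-, e2⟩
  · exact e1 ▸ ha
  · exact absurd (e2 ▸ ha) hw

/-- adjacency of the endpoints of a bond of `phiS`. [cite: KhristoforovSmirnov2021, §1.2 Lemma 2 (p. 3)] -/
theorem adj_of_mk_mem_phiS {m : ℕ} {T : Finset (Site 2)} {u w : Site 2} (h : s(u, w) ∈ phiS D m T) : triGraph.Adj u w := by
  obtain ⟨a, b, hab, -, hadj⟩ := exists_rep_of_mem_hBonds D (phiS_subset m T h)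
  rcases Sym2.eq_iff.1 hab with ⟨e1, e2⟩ | ⟨e1, e2⟩
  · rw [e1, e2]; exact hadj
  · rw [e1, e2]; exact hadj.symm

/-! ### faces and their boundary darts -/

/-- the left face determines the boundary dart. [cite: KhristoforovSmirnov2021, §1.2 Lemma 2 (p. 3)] -/
private theorem eq_of_leftFace_eq {d d' : Site 2 × Site 2} (hd : d ∈ triBdryDarts D.verts) (hd' : d' ∈ triBdryDarts D.verts)
    (h : leftFace d.1 d.2 = leftFace d'.1 d'.2) : d = d' := by
  obtain ⟨hu, hv, hadj⟩ := mem_triBdryDarts.1 hd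
  obtain ⟨hu', hv', hadj'⟩ := mem_triBdryDarts.1 hd'
  obtain ⟨j, hj, hj1⟩ := exists_eq_faceVertex_of_adj hadj
  obtain ⟨j', hj', hj1'⟩ := exists_eq_faceVertex_of_adj hadj'
  rw [← h] at hj' hj1'
  rcases fin3_cases_s j j' with e | e | e
  · rw [e] at hj' hj1'
    exact Prod.ext (hj.trans hj'.symm) (hj1.trans hj1'.symm)
  · exfalso; apply hv
    rw [hj1, ← e, ← hj']; exact hu'
  · exfalso; apply hv'
    rw [hj1', e, fin3_add_two_add_one_s, ← hj]; exact hu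

/-- a touching face with an outer vertex has an anticlockwise dart from `G` to the outside. [cite: KhristoforovSmirnov2021, §1.2 Lemma 2 (p. 3)] -/
private theorem exists_inner_outer {F : HexVertex} (hF : F ∈ triFacesTouching D.verts) {w : Fin 3} (hw : faceVertex F w ∉ D.verts) :
    ∃ j : Fin 3, faceVertex F j ∈ D.verts ∧ faceVertex F (j + 1) ∉ D.verts := by
  obtain ⟨x, hxG, hx⟩ := mem_triFacesTouching.1 hF
  obtain ⟨a, rfl⟩ := mem_hexFaceVertices_iff_faceVertex.1 hx
  by_cases h1 : faceVertex F (a + 1) ∈ D.verts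
  · by_cases h2 : faceVertex F (a + 2) ∈ D.verts
    · exfalso
      rcases fin3_cases_s a w with e | e | e
      · exact hw (e ▸ hxG)
      · exact hw (e ▸ h1)
      · exact hw (e ▸ h2)
    · exact ⟨a + 1, h1, by rw [fin3_add_one_add_one_s]; exact h2⟩
  · exact ⟨a, hxG, h1⟩

/-- the anticlockwise dart `(x_j, x_{j+1})` of `F` from `G` to the outside: a boundary dart with left face `F`, whose successor is
`(x_{j+2}, x_{j+1})` or `(x_j, x_{j+2})`. [cite: KhristoforovSmirnov2021, §1.2 Lemma 2 (p. 3)] -/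
private theorem faceDart_facts {F : HexVertex} {j : Fin 3} (hj : faceVertex F j ∈ D.verts) (hj1 : faceVertex F (j + 1) ∉ D.verts) :
    (faceVertex F j, faceVertex F (j + 1)) ∈ triBdryDarts D.verts ∧
      leftFace (faceVertex F j) (faceVertex F (j + 1)) = F ∧
      triBdrySucc D.verts (faceVertex F j, faceVertex F (j + 1)) =
        (if faceVertex F (j + 2) ∈ D.verts then (faceVertex F (j + 2), faceVertex F (j + 1)) else (faceVertex F j, faceVertex F (j + 2))) :=
  ⟨faceDart_mem₅ hj hj1, leftFace_faceVertex F j, succ_faceDart₅ D.verts⟩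

/-- **the split face**: for a boundary dart `d` with left face `F`, `F = s_m` iff the successor of `d` sits at position `m`.
[cite: KhristoforovSmirnov2021, §1.2 (pp. 2–3)] -/
theorem leftFace_eq_sFaceS_iff {m : ℕ} (hm : m < #(triBdryDarts D.verts)) {d : Site 2 × Site 2} (hd : d ∈ triBdryDarts D.verts) :
    leftFace d.1 d.2 = sFaceS D m ↔ (D.dpos d + 1) % #(triBdryDarts D.verts) = m := by
  constructor
  · intro h
    have e := eq_of_leftFace_eq hd (bdart_mem _) h
    have := D.dpos_succ hd
    rw [e, succ_bdart_pred, dpos_bdart, Nat.mod_eq_of_lt hm] at this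
    rw [e]; exact this.symm
  · intro h
    have hs : triBdrySucc D.verts d = bdart D m := by
      rw [← bdart_dpos (triBdrySucc_mem hd), D.dpos_succ hd, h]
    have e := eq_bdart_pred_of_succ_eq hd hs
    unfold sFaceS; rw [← e]

/-- the split face has the outer vertex `(bdart (m + L - 1)).2`. [cite: KhristoforovSmirnov2021, §1.2 Lemma 2 (p. 3)] -/
theorem sFaceS_outer (m : ℕ) : (bdart D (m + (#(triBdryDarts D.verts) - 1))).2 ∈ hexFaceVertices (sFaceS D m) ∧
    (bdart D (m + (#(triBdryDarts D.verts) - 1))).2 ∉ D.verts := by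
  obtain ⟨hu, hv, hadj⟩ := mem_triBdryDarts.1 (bdart_mem (D := D) (m + (#(triBdryDarts D.verts) - 1)))
  refine ⟨?_, hv⟩
  unfold sFaceS; rw [hexFaceVertices_leftFace hadj]; simp

/-- **a corner face is the left face of the preceding dart of its mark**: for a boundary dart `d = (x_j, x_{j+1})` of `F`, the
successor of `d` is a marked dart iff `F` is a corner face. [cite: KhristoforovSmirnov2021, §1.2 (pp. 2–3)] -/
theorem succ_eq_pos_iff_corner {F : HexVertex} {j : Fin 3} (hj : faceVertex F j ∈ D.verts) (hj1 : faceVertex F (j + 1) ∉ D.verts) :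
    (∃ i : Fin 5, (D.dpos (faceVertex F j, faceVertex F (j + 1)) + 1) % #(triBdryDarts D.verts) = D.pos i) ↔
      ∃ i : Fin 5, IsCornerFace D i F := by
  obtain ⟨hd, hlf, hsucc⟩ := faceDart_facts (D := D) hj hj1
  constructor
  · rintro ⟨i, hi⟩
    refine ⟨i, ?_⟩
    have h1 : (faceVertex F j, faceVertex F (j + 1)) = predDart D i := by
      have := iter_eq_predDart D hi
      rwa [D.iter_dpos hd] at this
    have h2 : triBdrySucc D.verts (faceVertex F j, faceVertex F (j + 1)) = D.markDart i := by
      have := iter_succ_eq_markDart D hi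
      rwa [triBdryIter_succ, D.iter_dpos hd] at this
    rw [hsucc] at h2
    have em : D.markSite i = faceVertex F j := by
      have := congrArg Prod.fst h1; rw [predDart_fst] at this; exact this.symm
    have hout : faceVertex F (j + 2) ∉ D.verts := by
      intro hin
      rw [if_pos hin] at h2
      have : D.markSite i = faceVertex F (j + 2) := (congrArg Prod.fst h2).symm
      exact fin3_ne_add_two_s j (faceVertex_injective F (em.symm.trans this))
    rw [if_neg hout] at h2
    unfold IsCornerFace
    rw [hexFaceVertices_eq_triple F j, em, ← congrArg Prod.snd h2, ← congrArg Prod.snd h1, Finset.pair_comm]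
  · rintro ⟨i, hc⟩
    obtain ⟨v, hv, hv1, hv2, hor⟩ := isCornerFace_typeII D hc
    have hjv : j = v := by
      rcases fin3_cases_s v j with e | e | e
      · exact e
      · exact absurd (e ▸ hj) hv1
      · exact absurd (e ▸ hj) hv2
    subst hjv
    refine ⟨i, ?_⟩
    rcases hor with ⟨e1, -⟩ | ⟨e1, e2⟩
    · have hp : (faceVertex F j, faceVertex F (j + 1)) = predDart D i := Prod.ext (by rw [predDart_fst]; exact hv) e1
      rw [hp]; exact dpos_predDart_succ D i
    · exfalso
      have hp : predDart D i = (faceVertex F j, faceVertex F (j + 2)) := (Prod.ext (by rw [predDart_fst]; exact hv) e2).symm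
      have hmk : D.markDart i = (faceVertex F j, faceVertex F (j + 1)) := (Prod.ext hv e1).symm
      have key := succ_predDart D i
      rw [hp, hmk] at key
      obtain ⟨k, hk⟩ := (triGraph_adj_iff_triDir _ _).1 (TriMarkedDomain.adj_faceVertex_succ F j)
      have hk2 : faceVertex F (j + 2) = faceVertex F j + triDir (k + 1) := by
        rw [← triLeftApex_faceVertex F j, hk, triLeftApex_add_triDir]
      unfold triBdrySucc at key
      rw [hk2, triLeftApex_add_triDir] at key
      split_ifs at key with hin
      · have h2 := congrArg Prod.snd key
        simp only at h2
        rw [← hk2] at h2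
        exact fin3_add_two_ne_add_one_s j (faceVertex_injective F h2)
      · have h2 := congrArg Prod.snd key
        simp only at h2
        rw [hk] at h2
        exact fin6_add_two_ne_s k (triDir_injective (add_left_cancel h2))

/-! ### parity of `phiS`: the odd faces are the corners XOR the split face -/

/-- Auxiliary: parity of a filter on `Fin 3` as an XOR. [folklore] -/
private theorem odd_card_filter_fin3_iff_s (b : Fin 3 → Bool) (j : Fin 3) :
    Odd #((Finset.univ : Finset (Fin 3)).filter fun i => b i = true) ↔ ((b j ^^ b (j + 1)) ^^ b (j + 2)) = true := by
  revert b j; decide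

open Classical in
/-- `xiDeg` as an XOR of the three side indicators, listed from `j`. [folklore] -/
private theorem odd_xiDeg_iff_xor_s (ξ : Finset (Sym2 (Site 2))) (F : HexVertex) (j : Fin 3) :
    Odd (xiDeg ξ F) ↔ Xor (Xor (side F j ∈ ξ) (side F (j + 1) ∈ ξ)) (side F (j + 2) ∈ ξ) := by
  rw [l1_xiDeg_eq]
  have key : ((Finset.univ : Finset (Fin 3)).filter fun i => side F i ∈ ξ) =
      (Finset.univ : Finset (Fin 3)).filter fun i => decide (side F i ∈ ξ) = true :=
    Finset.filter_congr fun i _ => by rw [decide_eq_true_iff]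
  rw [key, odd_card_filter_fin3_iff_s _ j]
  by_cases h0 : side F j ∈ ξ <;> by_cases h1 : side F (j + 1) ∈ ξ <;> by_cases h2 : side F (j + 2) ∈ ξ <;>
    simp [h0, h1, h2, Xor]

/-- the three sides listed from `j`. [folklore] -/
private theorem sides_from_s (F : HexVertex) (j : Fin 3) :
    side F (j + 2) = s(faceVertex F j, faceVertex F (j + 1)) ∧ side F (j + 1) = s(faceVertex F (j + 2), faceVertex F j) ∧
      side F j = s(faceVertex F (j + 1), faceVertex F (j + 2)) := by
  unfold side
  rw [fin3_add_two_add_one_s, fin3_add_two_add_two_s, fin3_add_one_add_one_s, fin3_add_one_add_two_s]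
  exact ⟨rfl, rfl, rfl⟩

/-- **parity at a face with an outer vertex**: odd iff the frame changes colour between the two boundary darts of the face.
[cite: KhristoforovSmirnov2021, §1.2 Lemma 2 (p. 3)] -/
theorem odd_xiDeg_phiS_iff_frs (m : ℕ) (T : Finset (Site 2)) {F : HexVertex} {j : Fin 3} (hj : faceVertex F j ∈ D.verts)
    (hj1 : faceVertex F (j + 1) ∉ D.verts) :
    Odd (xiDeg (phiS D m T) F) ↔
      frs D m (D.dpos (faceVertex F j, faceVertex F (j + 1)) + 1) ≠ frs D m (D.dpos (faceVertex F j, faceVertex F (j + 1))) := by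
  obtain ⟨hd, hlf, hsucc⟩ := faceDart_facts (D := D) hj hj1
  have hfrs : frs D m (D.dpos (faceVertex F j, faceVertex F (j + 1)) + 1) =
      frs D m (D.dpos (triBdrySucc D.verts (faceVertex F j, faceVertex F (j + 1)))) := by
    rw [D.dpos_succ hd, frs_mod]
  rw [hfrs, odd_xiDeg_iff_xor_s _ F j]
  obtain ⟨s2, s1, s0⟩ := sides_from_s F j
  rw [s2, s1, s0]
  have a01 : triGraph.Adj (faceVertex F j) (faceVertex F (j + 1)) := TriMarkedDomain.adj_faceVertex_succ F j
  have a12 : triGraph.Adj (faceVertex F (j + 1)) (faceVertex F (j + 2)) := by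
    have := TriMarkedDomain.adj_faceVertex_succ F (j + 1); rwa [fin3_add_one_add_one_s] at this
  have a20 : triGraph.Adj (faceVertex F (j + 2)) (faceVertex F j) := by
    have := TriMarkedDomain.adj_faceVertex_succ F (j + 2); rwa [fin3_add_two_add_one_s] at this
  rw [mk_mem_phiS_iff_of_mem_not_mem m T a01 hj hj1]
  by_cases h2 : faceVertex F (j + 2) ∈ D.verts
  · rw [if_pos h2] at hsucc
    have hA : s(faceVertex F (j + 2), faceVertex F j) ∈ phiS D m T ↔ (faceVertex F (j + 2) ∈ T ↔ faceVertex F j ∉ T) :=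
      mk_mem_phiS_iff_of_mem_mem m T a20 h2 hj
    have hB : s(faceVertex F (j + 1), faceVertex F (j + 2)) ∈ phiS D m T ↔
        (faceVertex F (j + 2) ∈ T ↔ frs D m (D.dpos (faceVertex F (j + 2), faceVertex F (j + 1))) = false) := by
      rw [Sym2.eq_swap]; exact mk_mem_phiS_iff_of_mem_not_mem m T a12.symm h2 hj1
    rw [hsucc, hA, hB]
    by_cases t0 : faceVertex F j ∈ T <;> by_cases t2 : faceVertex F (j + 2) ∈ T <;>
      cases frs D m (D.dpos (faceVertex F j, faceVertex F (j + 1))) <;>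
      cases frs D m (D.dpos (faceVertex F (j + 2), faceVertex F (j + 1))) <;> simp [t0, t2, Xor]
  · rw [if_neg h2] at hsucc
    have hno : s(faceVertex F (j + 1), faceVertex F (j + 2)) ∉ phiS D m T := by
      intro h
      obtain ⟨a, b, hab, ha, -⟩ := exists_rep_of_mem_hBonds D (phiS_subset m T h)
      rcases Sym2.eq_iff.1 hab with ⟨e1, -⟩ | ⟨-, e2⟩
      · exact hj1 (e1 ▸ ha)
      · exact h2 (e2 ▸ ha)
    have hA : s(faceVertex F (j + 2), faceVertex F j) ∈ phiS D m T ↔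
        (faceVertex F j ∈ T ↔ frs D m (D.dpos (faceVertex F j, faceVertex F (j + 2))) = false) := by
      rw [Sym2.eq_swap]; exact mk_mem_phiS_iff_of_mem_not_mem m T a20.symm hj h2
    rw [hsucc, hA]
    by_cases t0 : faceVertex F j ∈ T <;>
      cases frs D m (D.dpos (faceVertex F j, faceVertex F (j + 1))) <;>
      cases frs D m (D.dpos (faceVertex F j, faceVertex F (j + 2))) <;> simp [t0, hno, Xor]

/-- **parity at a face inside `G`**: even. [cite: KhristoforovSmirnov2021, §1.2 Lemma 2 (p. 3)] -/
theorem not_odd_xiDeg_phiS_of_inner (m : ℕ) (T : Finset (Site 2)) {F : HexVertex} (hF : ∀ w, faceVertex F w ∈ D.verts) :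
    ¬ Odd (xiDeg (phiS D m T) F) := by
  have key := odd_xiDeg_iff_xor_s (phiS D m T) F 0
  obtain ⟨s2, s1, s0⟩ := sides_from_s F 0
  have e1 : (0 : Fin 3) + 1 = 1 := rfl
  have e2 : (0 : Fin 3) + 2 = 2 := rfl
  rw [e1, e2] at key s2 s1 s0
  rw [key, s2, s1, s0]
  have a01 : triGraph.Adj (faceVertex F 0) (faceVertex F 1) := TriMarkedDomain.adj_faceVertex_succ F 0
  have a12 : triGraph.Adj (faceVertex F 1) (faceVertex F 2) := TriMarkedDomain.adj_faceVertex_succ F 1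
  have a20 : triGraph.Adj (faceVertex F 2) (faceVertex F 0) := TriMarkedDomain.adj_faceVertex_succ F 2
  rw [mk_mem_phiS_iff_of_mem_mem m T a01 (hF _) (hF _), mk_mem_phiS_iff_of_mem_mem m T a12 (hF _) (hF _),
    mk_mem_phiS_iff_of_mem_mem m T a20 (hF _) (hF _)]
  by_cases t0 : faceVertex F 0 ∈ T <;> by_cases t1 : faceVertex F 1 ∈ T <;> by_cases t2 : faceVertex F 2 ∈ T <;>
    simp [t0, t1, t2, Xor]

/-- ★ **(P) THE DISORDERS OF `ξ(σ)` ARE THE FIVE CORNERS AND THE SPLIT FACE** (as a XOR: when the split position is a mark, `m = 0`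
or `m = pos 1`, the split face IS that corner and it is even). [cite: KhristoforovSmirnov2021, §1.2 Lemma 2 (p. 3)] -/
theorem odd_xiDeg_phiS_iff {m : ℕ} (hm : m ≤ D.pos 1) (T : Finset (Site 2)) {F : HexVertex} (hF : F ∈ triFacesTouching D.verts) :
    Odd (xiDeg (phiS D m T) F) ↔ Xor (∃ i : Fin 5, IsCornerFace D i F) (F = sFaceS D m) := by
  obtain ⟨h00, h01, h12, h23, h34, h4L⟩ := pos_facts D
  have hmL : m < #(triBdryDarts D.verts) := by omega
  by_cases hout : ∃ w, faceVertex F w ∉ D.verts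
  · obtain ⟨w, hw⟩ := hout
    obtain ⟨j, hj, hj1⟩ := exists_inner_outer hF hw
    obtain ⟨hd, hlf, -⟩ := faceDart_facts (D := D) hj hj1
    set n := D.dpos (faceVertex F j, faceVertex F (j + 1)) with hn
    have hsf : F = sFaceS D m ↔ (n + 1) % #(triBdryDarts D.verts) = m := by
      constructor
      · intro e; exact (leftFace_eq_sFaceS_iff hmL hd).1 (hlf.trans e)
      · intro h; exact hlf.symm.trans ((leftFace_eq_sFaceS_iff hmL hd).2 h)
    rw [odd_xiDeg_phiS_iff_frs m T hj hj1, ← succ_eq_pos_iff_corner hj hj1, hsf]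
    by_cases hmark : ∃ i : Fin 5, (n + 1) % #(triBdryDarts D.verts) = D.pos i
    · obtain ⟨i, hi⟩ := hmark
      rw [frs_succ_ne_iff_of_mark hm hi]
      constructor
      · intro hne; exact Or.inl ⟨⟨i, hi⟩, fun e => hne (hi.symm.trans e)⟩
      · rintro (⟨-, hne⟩ | ⟨e, hno⟩)
        · exact fun e => hne (hi ▸ e)
        · exact absurd ⟨i, hi⟩ hno
    · push Not at hmark
      by_cases hz : (n + 1) % #(triBdryDarts D.verts) = m
      · have hne := frs_succ_ne_of_split hm hmark hz
        exact ⟨fun _ => Or.inr ⟨hz, fun ⟨i, hi⟩ => hmark i hi⟩, fun _ => hne⟩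
      · obtain ⟨-, heq, -⟩ := frame_succ_of_not_change (m := m) hmark hz
        constructor
        · intro h; exact absurd heq h
        · rintro (⟨⟨i, hi⟩, -⟩ | ⟨e, -⟩)
          · exact absurd hi (hmark i)
          · exact absurd e hz
  · push Not at hout
    constructor
    · intro h; exact absurd h (not_odd_xiDeg_phiS_of_inner m T hout)
    · rintro (⟨⟨i, hc⟩, -⟩ | ⟨e, -⟩)
      · obtain ⟨v, -, hv1, -, -⟩ := isCornerFace_typeII D hc
        exact absurd (hout (v + 1)) hv1
      · obtain ⟨hmem, hnot⟩ := sFaceS_outer (D := D) m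
        rw [← e] at hmem
        obtain ⟨w, hw⟩ := mem_hexFaceVertices_iff_faceVertex.1 hmem
        exact absurd (hw ▸ hout w) hnot

end Config

section ZMap

variable {D : TriMarkedDomain 5}

/-! ### the colouring ↦ loop-configuration map at a boundary mid-edge `z` of `A₀` -/

open Classical in
/-- **the split position of a colouring**: for the mid-edge `z` dual to the boundary dart `(g, o)` at position `p`, the frame changes
between the positions `p` and `p + 1` if `g` is blue, between `p - 1` and `p` if `g` is yellow. [cite: KhristoforovSmirnov2021, §1.2 Lemma 2 (p. 3)] -/
noncomputable def mOfS (D : TriMarkedDomain 5) (g o : Site 2) (T : Finset (Site 2)) : ℕ :=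
  if g ∈ T then D.dpos (g, o) + 1 else D.dpos (g, o)

/-- **`Φ(σ)`**: the loop configuration `ξ(σ) ∈ W_Ω(y₀,…,y₄,z)` of a colouring `σ = T` of `G` under the six-change frame, for the
boundary mid-edge `z` dual to `(g, o)`. [cite: KhristoforovSmirnov2021, §1.2 Lemma 2 (p. 3)] -/
noncomputable def PhiS (D : TriMarkedDomain 5) (g o : Site 2) (T : Finset (Site 2)) : Finset (Sym2 (Site 2)) :=
  phiS D (mOfS D g o T) T

/-- the odd endpoint of `Φ(σ)` at `z` (which half of the subdivided edge carries the half-edge of `ξ(σ)`). [cite: KhristoforovSmirnov2021, §1.2 Lemma 2 (p. 3)] -/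
noncomputable def sOfS (D : TriMarkedDomain 5) (g o : Site 2) (T : Finset (Site 2)) : HexVertex := sFaceS D (mOfS D g o T)

/-- a dart of the stretch `A₀`: boundary dart, position index `0`, position `< pos 1`. [cite: KhristoforovSmirnov2021, §1.2 Lemma 2 (p. 3)] -/
theorem stretch_zero_facts {g o : Site 2} (hd0 : (g, o) ∈ D.stretch 0) :
    (g, o) ∈ triBdryDarts D.verts ∧ g ∈ D.verts ∧ o ∉ D.verts ∧ triGraph.Adj g o ∧ posIdx D (D.dpos (g, o)) = 0 ∧
      D.dpos (g, o) < D.pos 1 := by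
  obtain ⟨hd, hst⟩ := posIdx_dpos_of_mem_stretch D hd0
  obtain ⟨hg, ho, hgo⟩ := mem_triBdryDarts.1 hd
  have := mod_lt_pos_one_of_posIdx_zero hst
  rw [Nat.mod_eq_of_lt (D.dpos_lt hd)] at this
  exact ⟨hd, hg, ho, hgo, hst, this⟩

section Z

variable {g o : Site 2} (hd0 : (g, o) ∈ D.stretch 0)
include hd0

/-- the split position is `≤ pos 1`. [cite: KhristoforovSmirnov2021, §1.2 Lemma 2 (p. 3)] -/
theorem mOfS_le (T : Finset (Site 2)) : mOfS D g o T ≤ D.pos 1 := by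
  have := (stretch_zero_facts hd0).2.2.2.2.2
  unfold mOfS; split_ifs <;> omega

omit hd0 in
/-- the split position is `p` or `p + 1`. [cite: KhristoforovSmirnov2021, §1.2 Lemma 2 (p. 3)] -/
theorem mOfS_bounds (T : Finset (Site 2)) : D.dpos (g, o) ≤ mOfS D g o T ∧ mOfS D g o T ≤ D.dpos (g, o) + 1 := by
  unfold mOfS; split_ifs <;> omega

/-- **`z` itself is never bicoloured**: the bond `s(g, o)` is not in `Φ(σ)`. [cite: KhristoforovSmirnov2021, §1.2 Lemma 2 (p. 3)] -/
theorem zbond_not_mem_PhiS (T : Finset (Site 2)) : s(g, o) ∉ PhiS D g o T := by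
  obtain ⟨hd, hg, ho, hgo, hst, hp1⟩ := stretch_zero_facts hd0
  have hpL := D.dpos_lt hd
  unfold PhiS
  rw [mk_mem_phiS_iff_of_mem_not_mem _ T hgo hg ho, frs_of_posIdx_zero hst, Nat.mod_eq_of_lt hpL]
  unfold mOfS
  by_cases hT : g ∈ T
  · rw [if_pos hT]; simp [hT]
  · rw [if_neg hT]; simp [hT]

/-- the split face for blue `g` is the left face of `(g, o)`. [cite: KhristoforovSmirnov2021, §1.2 Lemma 2 (p. 3)] -/
theorem sFaceS_pos_succ : sFaceS D (D.dpos (g, o) + 1) = leftFace g o := by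
  have hd := (stretch_zero_facts hd0).1
  unfold sFaceS
  rw [show D.dpos (g, o) + 1 + (#(triBdryDarts D.verts) - 1) = D.dpos (g, o) + #(triBdryDarts D.verts) by
    have := D.isTriDisc.card_pos; omega]
  unfold bdart
  rw [D.isTriDisc.iter_add_card, D.iter_dpos hd]

/-- the split face for yellow `g`: its successor dart is `(g, o)`, so it contains `g` and `o`. [cite: KhristoforovSmirnov2021, §1.2 Lemma 2 (p. 3)] -/
theorem sFaceS_pos_inc : g ∈ hexFaceVertices (sFaceS D (D.dpos (g, o))) ∧ o ∈ hexFaceVertices (sFaceS D (D.dpos (g, o))) := by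
  have hd := (stretch_zero_facts hd0).1
  unfold sFaceS
  set d := bdart D (D.dpos (g, o) + (#(triBdryDarts D.verts) - 1)) with hdd
  have hsucc : triBdrySucc D.verts d = (g, o) := by
    rw [hdd, succ_bdart_pred, bdart_dpos hd]
  obtain ⟨hu1, hv2, hadj'⟩ := mem_triBdryDarts.1 (bdart_mem (D := D) (D.dpos (g, o) + (#(triBdryDarts D.verts) - 1)))
  rw [← hdd] at hu1 hv2 hadj'
  rw [hexFaceVertices_leftFace hadj']
  simp only [Finset.mem_insert, Finset.mem_singleton]
  unfold triBdrySucc at hsucc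
  split_ifs at hsucc with hw
  · have e1 := congrArg Prod.fst hsucc; have e2 := congrArg Prod.snd hsucc
    simp only at e1 e2
    exact ⟨Or.inr (Or.inr e1.symm), Or.inr (Or.inl e2.symm)⟩
  · have e1 := congrArg Prod.fst hsucc; have e2 := congrArg Prod.snd hsucc
    simp only at e1 e2
    exact ⟨Or.inl e1.symm, Or.inr (Or.inr e2.symm)⟩

/-- the two candidate odd endpoints differ. [cite: KhristoforovSmirnov2021, §1.2 Lemma 2 (p. 3)] -/
theorem sFaceS_succ_ne : sFaceS D (D.dpos (g, o) + 1) ≠ sFaceS D (D.dpos (g, o)) := by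
  have hd := (stretch_zero_facts hd0).1
  rw [sFaceS_pos_succ hd0]
  intro e
  have := eq_of_leftFace_eq (d := (g, o)) hd (bdart_mem _) e
  have hs := succ_bdart_pred (D := D) (D.dpos (g, o))
  rw [← this, bdart_dpos hd] at hs
  exact succ_ne_self hd hs

/-- `sOfS T` is incident to the bond of `z`. [cite: KhristoforovSmirnov2021, §1.2 Lemma 2 (p. 3)] -/
theorem inc_sOfS (T : Finset (Site 2)) : Inc (sOfS D g o T) s(g, o) := by
  have hgo := (stretch_zero_facts hd0).2.2.2.1
  rw [inc_mk_iff]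
  unfold sOfS mOfS
  by_cases hT : g ∈ T
  · rw [if_pos hT, sFaceS_pos_succ hd0, hexFaceVertices_leftFace hgo]; simp
  · rw [if_neg hT]; exact sFaceS_pos_inc hd0

/-- `sOfS T` is a touching face. [cite: KhristoforovSmirnov2021, §1.2 Lemma 2 (p. 3)] -/
theorem sOfS_touching (T : Finset (Site 2)) : sOfS D g o T ∈ triFacesTouching D.verts :=
  mem_triFacesTouching.2 ⟨g, (stretch_zero_facts hd0).2.1, (inc_mk_iff.1 (inc_sOfS hd0 T)).1⟩

/-- `sOfS T` is one of the two faces `x`, `x'` of the `H_G`-edge dual to `z`. [cite: KhristoforovSmirnov2021, §1.2 (pp. 2–3)] -/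
theorem sOfS_mem_pair {x x' : HexVertex} (hadj : hexGraph.Adj x x') (he : faceEdge x x' = {g, o}) (T : Finset (Site 2)) :
    sOfS D g o T ∈ ({x, x'} : Finset HexVertex) := by
  have hg := (stretch_zero_facts hd0).2.1
  rw [Finset.mem_insert, Finset.mem_singleton]
  exact eq_or_eq_of_inc D hadj he hg (sOfS_touching hd0 T) (inc_sOfS hd0 T)

/-- ★ **`Φ(σ) ∈ W_Ω(y₀,…,y₄,z)`**: the loop configuration of a colouring lies in the boundary six-point space at `z` with odd
endpoint `sOfS σ`. [cite: KhristoforovSmirnov2021, §1.2 Lemma 2, proof (arXiv v1 p. 3): «a loop configuration with disorders at u₁, …»] -/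
theorem PhiS_mem (T : Finset (Site 2)) : PhiS D g o T ∈ loopSpace6b D g o (sOfS D g o T) := by
  rw [mem_loopSpace6b]
  constructor
  · intro b hb
    rw [Finset.mem_erase]
    refine ⟨fun e => ?_, phiS_subset _ T hb⟩
    rw [e] at hb; exact zbond_not_mem_PhiS hd0 T hb
  · intro F hF
    unfold PhiS sOfS
    exact odd_xiDeg_phiS_iff (mOfS_le hd0 T) T hF

/-- the side counts of `Φ(σ)` are at most two. [cite: KhristoforovSmirnov2021, §1.2 (pp. 2–3)] -/
theorem xiDeg_PhiS_le_two {x x' : HexVertex} (hadj : hexGraph.Adj x x') (he : faceEdge x x' = {g, o}) (T : Finset (Site 2))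
    (F : HexVertex) : xiDeg (PhiS D g o T) F ≤ 2 := by
  have hg := (stretch_zero_facts hd0).2.1
  obtain ⟨hsub, hpar⟩ := (mem_loopSpace6b (D := D)).1 (PhiS_mem hd0 T)
  refine xiDeg_le_two_of_odd_imp D hadj he hg hsub (fun F' hF' hodd => ?_) F
  rcases (hpar F' hF').1 hodd with ⟨hc, -⟩ | ⟨hs, -⟩
  · exact Or.inl hc
  · have hs' := sOfS_mem_pair hd0 hadj he T
    rw [Finset.mem_insert, Finset.mem_singleton] at hs'
    rw [hs]; exact Or.inr hs'

end Z

/-! ### injectivity and the image (a bijection onto both halves) -/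

/-- Auxiliary. [folklore] -/
private theorem iff_propagate_s {a b a' b' : Prop} (h : (a ↔ ¬b) ↔ (a' ↔ ¬b')) : (a ↔ a') ↔ (b ↔ b') := by
  by_cases ha : a <;> by_cases hb : b <;> by_cases ha' : a' <;> by_cases hb' : b' <;> simp_all

/-- Auxiliary. [folklore] -/
private theorem iff_anchor_s {a a' c : Prop} (h : (a ↔ c) ↔ (a' ↔ c)) : a ↔ a' := by
  by_cases ha : a <;> by_cases ha' : a' <;> by_cases hk : c <;> simp_all

/-- **injectivity for a fixed frame**: two colourings of `G` with the same `phiS m` agree on `G` (flood fill from the base site).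
[cite: KhristoforovSmirnov2021, §1.2 Lemma 2, proof (arXiv v1 p. 3): «This map is a bijection»] -/
theorem phiS_inj {m : ℕ} {T T' : Finset (Site 2)} (hξ : phiS D m T = phiS D m T') : ∀ u ∈ D.verts, (u ∈ T ↔ u ∈ T') := by
  have hstep : ∀ u v : Site 2, u ∈ D.verts → v ∈ D.verts → triGraph.Adj u v →
      ((u ∈ T ↔ u ∈ T') ↔ (v ∈ T ↔ v ∈ T')) := by
    intro u v hu hv hadj
    have h1 := mk_mem_phiS_iff_of_mem_mem m T hadj hu hv
    have h2 := mk_mem_phiS_iff_of_mem_mem m T' hadj hu hv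
    rw [hξ] at h1
    exact iff_propagate_s (h1.symm.trans h2)
  have hbase : (D.base.1 ∈ T ↔ D.base.1 ∈ T') := by
    obtain ⟨hu, hw, hadj⟩ := mem_triBdryDarts.1 D.base_mem
    have h1 := mk_mem_phiS_iff_of_mem_not_mem m T hadj hu hw
    have h2 := mk_mem_phiS_iff_of_mem_not_mem m T' hadj hu hw
    rw [hξ] at h1
    exact iff_anchor_s (h1.symm.trans h2)
  intro u hu
  have hreach := D.connected.preconnected ⟨D.base.1, Finset.mem_coe.2 (mem_triBdryDarts.1 D.base_mem).1⟩ ⟨u, Finset.mem_coe.2 hu⟩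
  obtain ⟨p⟩ := hreach
  suffices h : ∀ (a b : ↥((D.verts : Finset (Site 2)) : Set (Site 2))) (q : (triGraph.induce ((D.verts : Finset (Site 2)) : Set (Site 2))).Walk a b),
      ((a : Site 2) ∈ T ↔ (a : Site 2) ∈ T') → ((b : Site 2) ∈ T ↔ (b : Site 2) ∈ T') from h _ _ p hbase
  intro a b q
  induction q with
  | nil => exact id
  | @cons u' x' b' hadj q' ih =>
    intro ha
    have hadj' : triGraph.Adj (u' : Site 2) (x' : Site 2) := hadj
    exact ih ((hstep u' x' (Finset.mem_coe.1 u'.2) (Finset.mem_coe.1 x'.2) hadj').1 ha)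

/-- **boundary spaces with different odd endpoints are disjoint.** [cite: KhristoforovSmirnov2021, §1.2 (pp. 2–3)] -/
theorem not_mem_loopSpace6b_of_mem {u v : Site 2} {s s' : HexVertex} (hs : s ∈ triFacesTouching D.verts) (hne : s ≠ s')
    {ξ : Finset (Sym2 (Site 2))} (h : ξ ∈ loopSpace6b D u v s) : ξ ∉ loopSpace6b D u v s' := by
  intro h'
  rw [mem_loopSpace6b] at h h'
  have h1 := h.2 s hs
  have h2 := h'.2 s hs
  by_cases hc : ∃ j : Fin 5, IsCornerFace D j s
  · have hodd : Odd (xiDeg ξ s) := h2.2 (Or.inl ⟨hc, hne⟩)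
    rcases h1.1 hodd with ⟨-, hn⟩ | ⟨-, hn⟩
    · exact hn rfl
    · exact hn hc
  · have hodd : Odd (xiDeg ξ s) := h1.2 (Or.inr ⟨rfl, hc⟩)
    rcases h2.1 hodd with ⟨hc', -⟩ | ⟨e, -⟩
    · exact hc hc'
    · exact hne e

section Z2

variable {g o : Site 2} (hd0 : (g, o) ∈ D.stretch 0) {x x' : HexVertex} (hadj : hexGraph.Adj x x') (he : faceEdge x x' = {g, o})
include hd0

/-- colourings differing at `g` have different images (they lie in different halves). [cite: KhristoforovSmirnov2021, §1.2 Lemma 2 (p. 3)] -/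
theorem mem_iff_mem_of_PhiS_eq {T T' : Finset (Site 2)} (h : PhiS D g o T = PhiS D g o T') : (g ∈ T ↔ g ∈ T') := by
  by_contra hne
  have hm : sOfS D g o T ≠ sOfS D g o T' := by
    unfold sOfS mOfS
    have hne' := sFaceS_succ_ne hd0
    by_cases h1 : g ∈ T
    · have h2 : g ∉ T' := fun h2 => hne ⟨fun _ => h2, fun _ => h1⟩
      rw [if_pos h1, if_neg h2]; exact hne'
    · have h2 : g ∈ T' := by by_contra h2; exact hne ⟨fun h => absurd h h1, fun h => absurd h h2⟩
      rw [if_neg h1, if_pos h2]; exact hne'.symm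
  have h1 := PhiS_mem hd0 T
  have h2 := PhiS_mem hd0 T'
  rw [h] at h1
  exact not_mem_loopSpace6b_of_mem (sOfS_touching hd0 T) hm h1 h2

/-- ★ **injectivity of `Φ` on the colourings of `G`.** [cite: KhristoforovSmirnov2021, §1.2 Lemma 2, proof (arXiv v1 p. 3): «This map is a bijection»] -/
theorem PhiS_injOn : Set.InjOn (PhiS D g o) (↑(D.verts.powerset) : Set (Finset (Site 2))) := by
  intro T hT T' hT' h
  have hT1 := Finset.mem_powerset.1 (Finset.mem_coe.1 hT)
  have hT2 := Finset.mem_powerset.1 (Finset.mem_coe.1 hT')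
  have hgg := mem_iff_mem_of_PhiS_eq hd0 h
  have hm : mOfS D g o T = mOfS D g o T' := by
    unfold mOfS
    by_cases h1 : g ∈ T
    · rw [if_pos h1, if_pos (hgg.1 h1)]
    · rw [if_neg h1, if_neg (fun h2 => h1 (hgg.2 h2))]
  have h' : phiS D (mOfS D g o T) T = phiS D (mOfS D g o T) T' := by
    have := h; unfold PhiS at this; rwa [← hm] at this
  ext u
  constructor
  · intro hu; exact ((phiS_inj h') u (hT1 hu)).1 hu
  · intro hu; exact ((phiS_inj h') u (hT2 hu)).2 hu

include hadj he

/-- ★ **surjectivity**: every configuration of the boundary six-point space at `z` (either half) is `Φ` of a colouring of `G`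
(injectivity + the count `#W∂(x) + #W∂(x') = 2 ^ #G`, `Bdry.sixCount_b`). [cite: KhristoforovSmirnov2021, §1.2 (arXiv v1 p. 2): «exactly 2^{#Faces(Ω)} loop configurations with given disorders»; Lemma 2, proof (p. 3)] -/
theorem PhiS_image_eq : (D.verts.powerset).image (PhiS D g o) = loopSpace6b D g o x ∪ loopSpace6b D g o x' := by
  classical
  have hg := (stretch_zero_facts hd0).2.1
  apply Finset.eq_of_subset_of_card_le
  · intro ξ hξ
    obtain ⟨T, -, rfl⟩ := Finset.mem_image.1 hξ
    have hm := PhiS_mem hd0 T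
    have hs := sOfS_mem_pair hd0 hadj he T
    rw [Finset.mem_insert, Finset.mem_singleton] at hs
    rw [Finset.mem_union]
    rcases hs with e | e
    · exact Or.inl (e ▸ hm)
    · exact Or.inr (e ▸ hm)
  · rw [Finset.card_image_of_injOn (PhiS_injOn hd0), Finset.card_powerset]
    calc #(loopSpace6b D g o x ∪ loopSpace6b D g o x') ≤ #(loopSpace6b D g o x) + #(loopSpace6b D g o x') :=
          Finset.card_union_le _ _
      _ = 2 ^ #D.verts := sixCount_b D hadj he hg

/-- every configuration of a half is the image of a colouring with the matching odd endpoint. [cite: KhristoforovSmirnov2021, §1.2 Lemma 2 (p. 3)] -/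
theorem exists_eq_PhiS {s : HexVertex} (hs : s ∈ ({x, x'} : Finset HexVertex)) {ξ : Finset (Sym2 (Site 2))}
    (hξ : ξ ∈ loopSpace6b D g o s) : ∃ T : Finset (Site 2), T ⊆ D.verts ∧ PhiS D g o T = ξ ∧ sOfS D g o T = s := by
  classical
  have hmem : ξ ∈ (D.verts.powerset).image (PhiS D g o) := by
    rw [PhiS_image_eq hd0 hadj he, Finset.mem_union]
    rw [Finset.mem_insert, Finset.mem_singleton] at hs
    rcases hs with rfl | rfl
    · exact Or.inl hξ
    · exact Or.inr hξ
  obtain ⟨T, hT, rfl⟩ := Finset.mem_image.1 hmem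
  refine ⟨T, Finset.mem_powerset.1 hT, rfl, ?_⟩
  by_contra hne
  exact not_mem_loopSpace6b_of_mem (sOfS_touching hd0 T) hne (PhiS_mem hd0 T) hξ

end Z2

end ZMap

section Blocks

variable {D : TriMarkedDomain 5}

/-! ### the six frame blocks, their hexagons, and the corner/split faces -/

/-- **the block index of a position** under the split `m`: `0` = the darts of `A₀` before the split (`∂_{y₀ z}`), `1` = the darts
of `A₀` from the split (`∂_{z y₁}`), `i + 1` = the stretch `A_i` (`i = 1, …, 4`). Even blocks are blue, odd blocks yellow.
[cite: KhristoforovSmirnov2021, §1.2 Lemma 2 (p. 3)] -/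
noncomputable def blk (D : TriMarkedDomain 5) (m n : ℕ) : ℕ :=
  if posIdx D n = 0 then (if n % #(triBdryDarts D.verts) < m then 0 else 1) else (posIdx D n).val + 1

/-- **the hexagons of a block**: the tails of the boundary darts at the positions of the block. [cite: KhristoforovSmirnov2021, §1.2 (arXiv v1 p. 2: the arcs ∂_{zw}Ω)] -/
noncomputable def bsites (D : TriMarkedDomain 5) (m q : ℕ) : Finset (Site 2) :=
  ((Finset.range #(triBdryDarts D.verts)).filter fun n => blk D m n = q).image fun n => (bdart D n).1

/-- the frame colour is the parity of the block. [cite: KhristoforovSmirnov2021, §1.2 Lemma 2 (p. 3)] -/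
theorem frs_eq_blk (m n : ℕ) : frs D m n = decide (blk D m n % 2 = 0) := by
  unfold frs blk
  by_cases h0 : posIdx D n = 0
  · rw [if_pos h0, if_pos h0]
    split_ifs with h <;> simp [h]
  · rw [if_neg h0, if_neg h0]
    have key : ∀ i : Fin 5, i ≠ 0 → decide (i.val % 2 = 1) = decide ((i.val + 1) % 2 = 0) := by decide
    exact key _ h0

/-- the block index only depends on the position modulo the length. [cite: KhristoforovSmirnov2021, §1.2 Lemma 2 (p. 3)] -/
theorem blk_mod (m n : ℕ) : blk D m (n % #(triBdryDarts D.verts)) = blk D m n := by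
  unfold blk; rw [posIdx_mod, Nat.mod_mod]

/-- blocks are `< 6`. [cite: KhristoforovSmirnov2021, §1.2 Lemma 2 (p. 3)] -/
theorem blk_lt_six (m n : ℕ) : blk D m n < 6 := by
  unfold blk
  split_ifs
  · omega
  · omega
  · exact Nat.succ_lt_succ (posIdx D n).isLt

/-- **no change away from the marks and `m`**: consecutive positions in one block. [cite: KhristoforovSmirnov2021, §1.2 Lemma 2 (p. 3)] -/
theorem blk_succ_of_not_change {m n : ℕ} (hmark : ∀ i : Fin 5, (n + 1) % #(triBdryDarts D.verts) ≠ D.pos i)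
    (hz : (n + 1) % #(triBdryDarts D.verts) ≠ m) : blk D m (n + 1) = blk D m n := by
  obtain ⟨hs, -, hlt⟩ := frame_succ_of_not_change (m := m) hmark hz
  have hL := D.isTriDisc.card_pos
  have h0 : (n + 1) % #(triBdryDarts D.verts) ≠ 0 := by rw [← (pos_facts D).1]; exact hmark 0
  unfold blk
  rw [hs]
  by_cases h1 : posIdx D n = 0
  · rw [if_pos h1, if_pos h1]
    by_cases h2 : n % #(triBdryDarts D.verts) < m
    · rw [if_pos h2, if_pos (hlt.1 h2)]
    · rw [if_neg h2, if_neg (fun h => h2 (hlt.2 h))]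
  · rw [if_neg h1, if_neg h1]

/-- the tail of a boundary dart is a hexagon of its block. [cite: KhristoforovSmirnov2021, §1.2 Lemma 2 (p. 3)] -/
theorem fst_mem_bsites (m : ℕ) {d : Site 2 × Site 2} (hd : d ∈ triBdryDarts D.verts) : d.1 ∈ bsites D m (blk D m (D.dpos d)) := by
  unfold bsites
  refine Finset.mem_image.2 ⟨D.dpos d, Finset.mem_filter.2 ⟨Finset.mem_range.2 (D.dpos_lt hd), rfl⟩, ?_⟩
  rw [bdart_dpos hd]

/-- a hexagon of a block is the tail of a dart at a position of the block. [cite: KhristoforovSmirnov2021, §1.2 Lemma 2 (p. 3)] -/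
theorem exists_of_mem_bsites {m q : ℕ} {a : Site 2} (ha : a ∈ bsites D m q) :
    ∃ n, n < #(triBdryDarts D.verts) ∧ blk D m n = q ∧ (bdart D n).1 = a := by
  unfold bsites at ha
  obtain ⟨n, hn, rfl⟩ := Finset.mem_image.1 ha
  rw [Finset.mem_filter, Finset.mem_range] at hn
  exact ⟨n, hn.1, hn.2, rfl⟩

/-- hexagons of a block are sites of `G`. [cite: KhristoforovSmirnov2021, §1.2 Lemma 2 (p. 3)] -/
theorem mem_verts_of_mem_bsites {m q : ℕ} {a : Site 2} (ha : a ∈ bsites D m q) : a ∈ D.verts := by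
  obtain ⟨n, -, -, rfl⟩ := exists_of_mem_bsites ha
  exact (mem_triBdryDarts.1 (bdart_mem n)).1

/-- block `0` at a position: index `0` and before the split. [cite: KhristoforovSmirnov2021, §1.2 Lemma 2 (p. 3)] -/
theorem blk_eq_zero_iff {m n : ℕ} : blk D m n = 0 ↔ posIdx D n = 0 ∧ n % #(triBdryDarts D.verts) < m := by
  unfold blk
  split_ifs with h1 h2
  · simp [h1, h2]
  · simp [h2]
  · simp [h1]

/-- block `1` at a position: index `0` and from the split on. [cite: KhristoforovSmirnov2021, §1.2 Lemma 2 (p. 3)] -/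
theorem blk_eq_one_iff {m n : ℕ} : blk D m n = 1 ↔ posIdx D n = 0 ∧ ¬ n % #(triBdryDarts D.verts) < m := by
  unfold blk
  split_ifs with h1 h2
  · simp [h2]
  · simp [h1, h2]
  · simp only [h1, false_and, iff_false]
    intro h
    have : (posIdx D n).val = 0 := by omega
    exact h1 (Fin.ext this)

/-- block `i + 1` (`i ≠ 0`) at a position: index `i`. [cite: KhristoforovSmirnov2021, §1.2 Lemma 2 (p. 3)] -/
theorem blk_eq_succ_iff {m n : ℕ} {i : Fin 5} (hi : i ≠ 0) : blk D m n = i.val + 1 ↔ posIdx D n = i := by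
  have hi' : i.val ≠ 0 := fun h => hi (Fin.ext (by rw [h]; rfl))
  constructor
  · intro h
    unfold blk at h
    by_cases h1 : posIdx D n = 0
    · rw [if_pos h1] at h
      exfalso
      by_cases h2 : n % #(triBdryDarts D.verts) < m
      · rw [if_pos h2] at h; omega
      · rw [if_neg h2] at h; exact hi' (by omega)
    · rw [if_neg h1] at h
      exact Fin.ext (by omega)
  · intro h
    unfold blk
    rw [if_neg (by rw [h]; exact hi), h]

/-! ### the sub-arcs cut at `z` -/

/-- **the sub-arc `∂_{y₀ z}` of `A₀` as hexagons**: the tails of the boundary darts at positions `0, …, p` (`p` the position of the dart of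
`z`; both `v₀` and the hexagon `H_g` of `z` included). [cite: KhristoforovSmirnov2021, §1.2 (p. 2: the arc ∂_{zw}Ω)] -/
noncomputable def arcP0 (D : TriMarkedDomain 5) (g o : Site 2) : Finset (Site 2) :=
  ((Finset.range (D.dpos (g, o) + 1)).image (bdart D)).image Prod.fst

/-- **the sub-arc `∂_{z y₁}` of `A₀` as hexagons**: the tails of the boundary darts at positions `p, …, pos 1 - 1` (`H_g` and `v₁` included).
[cite: KhristoforovSmirnov2021, §1.2 (p. 2: the arc ∂_{zw}Ω)] -/
noncomputable def arcP1 (D : TriMarkedDomain 5) (g o : Site 2) : Finset (Site 2) :=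
  ((Finset.Ico (D.dpos (g, o)) (D.pos 1)).image (bdart D)).image Prod.fst

/-- a site of `∂_{y₀ z}` is the tail of a dart at a position `≤ p`. [cite: KhristoforovSmirnov2021, §1.2 Lemma 2 (p. 3)] -/
theorem exists_of_mem_arcP0 {g o : Site 2} {x : Site 2} (hx : x ∈ arcP0 D g o) : ∃ n, n ≤ D.dpos (g, o) ∧ (bdart D n).1 = x := by
  unfold arcP0 at hx
  obtain ⟨d, hd, rfl⟩ := Finset.mem_image.1 hx
  obtain ⟨n, hn, rfl⟩ := Finset.mem_image.1 hd
  exact ⟨n, by rw [Finset.mem_range] at hn; omega, rfl⟩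

/-- a site of `∂_{z y₁}` is the tail of a dart at a position in `[p, pos 1)`. [cite: KhristoforovSmirnov2021, §1.2 Lemma 2 (p. 3)] -/
theorem exists_of_mem_arcP1 {g o : Site 2} {x : Site 2} (hx : x ∈ arcP1 D g o) :
    ∃ n, D.dpos (g, o) ≤ n ∧ n < D.pos 1 ∧ (bdart D n).1 = x := by
  unfold arcP1 at hx
  obtain ⟨d, hd, rfl⟩ := Finset.mem_image.1 hx
  obtain ⟨n, hn, rfl⟩ := Finset.mem_image.1 hd
  rw [Finset.mem_Ico] at hn
  exact ⟨n, hn.1, hn.2, rfl⟩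

/-- the tail of the dart at a position `≤ p` lies on `∂_{y₀ z}`. [cite: KhristoforovSmirnov2021, §1.2 Lemma 2 (p. 3)] -/
theorem bdart_fst_mem_arcP0 {g o : Site 2} {n : ℕ} (hn : n ≤ D.dpos (g, o)) : (bdart D n).1 ∈ arcP0 D g o := by
  unfold arcP0
  exact Finset.mem_image.2 ⟨bdart D n, Finset.mem_image.2 ⟨n, Finset.mem_range.2 (by omega), rfl⟩, rfl⟩

/-- the tail of the dart at a position in `[p, pos 1)` lies on `∂_{z y₁}`. [cite: KhristoforovSmirnov2021, §1.2 Lemma 2 (p. 3)] -/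
theorem bdart_fst_mem_arcP1 {g o : Site 2} {n : ℕ} (h1 : D.dpos (g, o) ≤ n) (h2 : n < D.pos 1) : (bdart D n).1 ∈ arcP1 D g o := by
  unfold arcP1
  exact Finset.mem_image.2 ⟨bdart D n, Finset.mem_image.2 ⟨n, Finset.mem_Ico.2 ⟨h1, h2⟩, rfl⟩, rfl⟩

/-- the tail of the dart at a position in `[pos i, nextPos i)` lies on the arc `A_i`. [cite: KhristoforovSmirnov2021, §1.2 Lemma 2 (p. 3)] -/
theorem bdart_fst_mem_arc {i : Fin 5} {n : ℕ} (h1 : D.pos i ≤ n) (h2 : n < D.nextPos i) : (bdart D n).1 ∈ D.arc i :=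
  D.mem_arc_iff.2 ⟨n, h1, h2, rfl⟩

/-- **block `0` lies on `∂_{y₀ z}`** (the split is at most `p + 1`). [cite: KhristoforovSmirnov2021, §1.2 (arXiv v1 p. 2)] -/
theorem bsites_zero_subset {g o : Site 2} {m : ℕ} (hm : m ≤ D.dpos (g, o) + 1) : bsites D m 0 ⊆ arcP0 D g o := by
  intro a ha
  obtain ⟨n, hnL, hb, rfl⟩ := exists_of_mem_bsites ha
  obtain ⟨-, hlt⟩ := blk_eq_zero_iff.1 hb
  rw [Nat.mod_eq_of_lt hnL] at hlt
  exact bdart_fst_mem_arcP0 (by omega)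

/-- **block `1` lies on `∂_{z y₁}`** (the split is at least `p`). [cite: KhristoforovSmirnov2021, §1.2 (arXiv v1 p. 2)] -/
theorem bsites_one_subset {g o : Site 2} {m : ℕ} (hm : D.dpos (g, o) ≤ m) : bsites D m 1 ⊆ arcP1 D g o := by
  intro a ha
  obtain ⟨n, hnL, hb, rfl⟩ := exists_of_mem_bsites ha
  obtain ⟨h0, hlt⟩ := blk_eq_one_iff.1 hb
  have := mod_lt_pos_one_of_posIdx_zero h0
  rw [Nat.mod_eq_of_lt hnL] at hlt this
  exact bdart_fst_mem_arcP1 (by omega) this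

/-- **block `i + 1` lies on the arc `A_i`** (`i ≠ 0`). [cite: BollobasRiordan2006, Ch. 7 §7.2.2 p. 193] -/
theorem bsites_succ_subset (m : ℕ) {i : Fin 5} (hi : i ≠ 0) : bsites D m (i.val + 1) ⊆ D.arc i := by
  intro a ha
  obtain ⟨n, hnL, hb, rfl⟩ := exists_of_mem_bsites ha
  have hp := (blk_eq_succ_iff hi).1 hb
  obtain ⟨h1, h2⟩ := mod_mem_of_posIdx_eq hp
  rw [Nat.mod_eq_of_lt hnL] at h1 h2
  exact bdart_fst_mem_arc h1 h2

end Blocks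

section Chain

variable {D : TriMarkedDomain 5}

/-! ### (S) the side chain: blocks joined through the cells of one colour -/

/-- the sites of `G` of colour `b` under the colouring `T` (`b = true`: the sites of `T`; `b = false`: the others).
[cite: KhristoforovSmirnov2021, §1.1 (arXiv v1 p. 2: «a σ-blue path»)] -/
def cset (D : TriMarkedDomain 5) (T : Finset (Site 2)) (b : Bool) : Set (Site 2) := {x | x ∈ D.verts ∧ (x ∈ T ↔ b = true)}

/-- **direct connection** of two frame blocks: a path of colour-`b` sites of `G` from a hexagon of the block `q` to a hexagon of the
block `q'`. [cite: KhristoforovSmirnov2021, §1.1 (arXiv v1 p. 2: «X ↔ Y»)] -/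
def DConn (D : TriMarkedDomain 5) (m : ℕ) (T : Finset (Site 2)) (b : Bool) (q q' : ℕ) : Prop :=
  ∃ a ∈ bsites D m q, ∃ c ∈ bsites D m q', PathIn triGraph (cset D T b) a c

/-- **blocks joined through colour `b`**: a chain of direct colour-`b` connections through blocks of colour `b` (the outer cells of a
block count as cells of the block's colour). [cite: KhristoforovSmirnov2021, §1.2 Lemma 2 (p. 3)] -/
def SConn (D : TriMarkedDomain 5) (m : ℕ) (T : Finset (Site 2)) (b : Bool) (q₀ q : ℕ) : Prop :=
  Relation.ReflTransGen (fun q q' => decide (q' % 2 = 0) = b ∧ DConn D m T b q q') q₀ q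

/-- **a site of colour `b` joined to the start block `q₀`**: a colour-`b` path from a hexagon of a block joined to `q₀`.
[cite: KhristoforovSmirnov2021, §1.2 Lemma 2 (p. 3)] -/
def BJ (D : TriMarkedDomain 5) (m : ℕ) (T : Finset (Site 2)) (b : Bool) (q₀ : ℕ) (x : Site 2) : Prop :=
  ∃ q, SConn D m T b q₀ q ∧ ∃ a ∈ bsites D m q, PathIn triGraph (cset D T b) a x

/-- **the bond invariant** of a bond `{a, c}` seen along the chain: an endpoint of colour `b` in `G` is joined to the start block, an
outer endpoint read with frame colour `b` belongs to a block joined to the start block. [cite: KhristoforovSmirnov2021, §1.2 Lemma 2 (p. 3)] -/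
def OKs (D : TriMarkedDomain 5) (g o : Site 2) (T : Finset (Site 2)) (b : Bool) (q₀ : ℕ) (a c : Site 2) : Prop :=
  (a ∈ D.verts → (a ∈ T ↔ b = true) → BJ D (mOfS D g o T) T b q₀ a) ∧
  (c ∈ D.verts → (c ∈ T ↔ b = true) → BJ D (mOfS D g o T) T b q₀ c) ∧
  (a ∈ D.verts → c ∉ D.verts → frs D (mOfS D g o T) (D.dpos (a, c)) = b →
    SConn D (mOfS D g o T) T b q₀ (blk D (mOfS D g o T) (D.dpos (a, c)))) ∧
  (c ∈ D.verts → a ∉ D.verts → frs D (mOfS D g o T) (D.dpos (c, a)) = b →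
    SConn D (mOfS D g o T) T b q₀ (blk D (mOfS D g o T) (D.dpos (c, a))))

/-- **the face invariant**: every side of `F` lying in `Φ(σ)` satisfies the bond invariant. [cite: KhristoforovSmirnov2021, §1.2 Lemma 2 (p. 3)] -/
def PF (D : TriMarkedDomain 5) (g o : Site 2) (T : Finset (Site 2)) (b : Bool) (q₀ : ℕ) (F : HexVertex) : Prop :=
  ∀ j : Fin 3, side F j ∈ PhiS D g o T → OKs D g o T b q₀ (faceVertex F (j + 1)) (faceVertex F (j + 2))

/-- `cset T true = G ∩ T`. [cite: KhristoforovSmirnov2021, §1.2 Lemma 2 (p. 3)] -/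
theorem cset_true (T : Finset (Site 2)) : cset D T true = (D.verts : Set (Site 2)) ∩ (↑T : Set (Site 2)) := by
  ext x; simp [cset]

/-- `cset T false = G ∖ T`. [cite: KhristoforovSmirnov2021, §1.2 Lemma 2 (p. 3)] -/
theorem cset_false (T : Finset (Site 2)) : cset D T false = (D.verts : Set (Site 2)) ∩ (↑T : Set (Site 2))ᶜ := by
  ext x; simp [cset]

/-- reading the colour of an inner endpoint of a bicoloured inner bond. [folklore] -/
private theorem col_inner {P Q : Prop} {b : Bool} (h : P ↔ ¬ Q) : (P ↔ b = true) ↔ ¬ (Q ↔ b = true) := by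
  cases b <;> simp <;> tauto

/-- reading the frame colour of the outer endpoint of a bicoloured boundary bond. [folklore] -/
private theorem col_outer {P : Prop} {f b : Bool} (h : P ↔ f = false) : (¬ (P ↔ b = true)) ↔ f = b := by
  cases f <;> cases b <;> simp_all

/-- `OKs` is symmetric. [cite: KhristoforovSmirnov2021, §1.2 Lemma 2 (p. 3)] -/
theorem oks_symm {g o : Site 2} {T : Finset (Site 2)} {b : Bool} {q₀ : ℕ} {a c : Site 2} (h : OKs D g o T b q₀ a c) :
    OKs D g o T b q₀ c a :=
  ⟨h.2.1, h.1, h.2.2.2, h.2.2.1⟩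

/-- a direct connection appends to a chain. [cite: KhristoforovSmirnov2021, §1.2 Lemma 2 (p. 3)] -/
theorem sconn_tail {m : ℕ} {T : Finset (Site 2)} {b : Bool} {q₀ q q' : ℕ} (h : SConn D m T b q₀ q)
    (hcol : decide (q' % 2 = 0) = b) (hd : DConn D m T b q q') : SConn D m T b q₀ q' :=
  Relation.ReflTransGen.tail h ⟨hcol, hd⟩

/-- joinedness passes to a colour-`b` neighbour in `G`. [cite: KhristoforovSmirnov2021, §1.2 Lemma 2 (p. 3)] -/
theorem bj_of_adj {m : ℕ} {T : Finset (Site 2)} {b : Bool} {q₀ : ℕ} {x y : Site 2} (h : BJ D m T b q₀ x) (hxy : triGraph.Adj x y)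
    (hy : y ∈ D.verts) (hyc : (y ∈ T ↔ b = true)) : BJ D m T b q₀ y := by
  obtain ⟨q, hq, a, ha, hP⟩ := h
  exact ⟨q, hq, a, ha, hP.tail hxy ⟨hy, hyc⟩⟩

/-- a colour-`b` hexagon of a joined block is joined. [cite: KhristoforovSmirnov2021, §1.2 Lemma 2 (p. 3)] -/
theorem bj_of_mem_bsites {m : ℕ} {T : Finset (Site 2)} {b : Bool} {q₀ q : ℕ} {a : Site 2} (hq : SConn D m T b q₀ q)
    (ha : a ∈ bsites D m q) (haG : a ∈ D.verts) (hac : (a ∈ T ↔ b = true)) : BJ D m T b q₀ a :=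
  ⟨q, hq, a, ha, PathIn.refl ⟨haG, hac⟩⟩

/-- a joined hexagon of a block of colour `b` joins that block. [cite: KhristoforovSmirnov2021, §1.2 Lemma 2 (p. 3)] -/
theorem sconn_of_bj {m : ℕ} {T : Finset (Site 2)} {b : Bool} {q₀ q' : ℕ} {a : Site 2} (h : BJ D m T b q₀ a) (ha : a ∈ bsites D m q')
    (hcol : decide (q' % 2 = 0) = b) : SConn D m T b q₀ q' := by
  obtain ⟨q, hq, a₀, ha₀, hP⟩ := h
  exact sconn_tail hq hcol ⟨a₀, ha₀, a, ha, hP⟩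

/-- the frame colour of a dart is the colour of its block. [cite: KhristoforovSmirnov2021, §1.2 Lemma 2 (p. 3)] -/
theorem col_blk_of_frs {m n : ℕ} {b : Bool} (h : frs D m n = b) : decide (blk D m n % 2 = 0) = b := by
  rw [← frs_eq_blk]; exact h

/-! ### the boundary darts of a face lie in one block (faces other than corners and the split face) -/

/-- **the boundary darts of a face**: with `x_j ∈ G ∌ x_{j+1}`, every boundary dart with both endpoints in the face `F` is the dart
`(x_j, x_{j+1})` or its successor. [cite: KhristoforovSmirnov2021, §1.2 Lemma 2 (p. 3)] -/
private theorem bdryDart_of_face_eq {F : HexVertex} {j : Fin 3} (hj : faceVertex F j ∈ D.verts) (hj1 : faceVertex F (j + 1) ∉ D.verts)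
    {d : Site 2 × Site 2} (hd : d ∈ triBdryDarts D.verts) (h1 : d.1 ∈ hexFaceVertices F) (h2 : d.2 ∈ hexFaceVertices F) :
    d = (faceVertex F j, faceVertex F (j + 1)) ∨ d = triBdrySucc D.verts (faceVertex F j, faceVertex F (j + 1)) := by
  obtain ⟨hu, hv, hadj⟩ := mem_triBdryDarts.1 hd
  obtain ⟨a, ha⟩ := mem_hexFaceVertices_iff_faceVertex.1 h1
  obtain ⟨b, hb⟩ := mem_hexFaceVertices_iff_faceVertex.1 h2
  rw [succ_faceDart₅ D.verts]
  have hab : a ≠ b := fun e => hadj.ne (by rw [ha, hb, e])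
  rcases fin3_cases_s j a with rfl | rfl | rfl
  · rcases fin3_cases_s a b with rfl | rfl | e
    · exact absurd rfl hab
    · exact Or.inl (Prod.ext ha hb)
    · rw [e] at hb
      have h2' : faceVertex F (a + 2) ∉ D.verts := hb ▸ hv
      rw [if_neg h2']
      exact Or.inr (Prod.ext ha hb)
  · exact absurd (ha ▸ hu) hj1
  · have h2' : faceVertex F (j + 2) ∈ D.verts := ha ▸ hu
    rw [if_pos h2']
    rcases fin3_cases_s j b with e | e | e
    · rw [hb, e] at hv; exact absurd hj hv
    · rw [e] at hb; exact Or.inr (Prod.ext ha hb)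
    · exact absurd e.symm hab

/-- **the boundary darts of a face that is neither a corner nor the split face lie in ONE block.**
[cite: KhristoforovSmirnov2021, §1.2 Lemma 2 (p. 3)] -/
theorem sameBlock_of_face {m : ℕ} (hm : m ≤ D.pos 1) {F : HexVertex} (hF : F ∈ triFacesTouching D.verts) (hFc : F ∉ corners D)
    (hFs : F ≠ sFaceS D m) {d₁ d₂ : Site 2 × Site 2} (hd₁ : d₁ ∈ triBdryDarts D.verts) (hd₂ : d₂ ∈ triBdryDarts D.verts)
    (h₁1 : d₁.1 ∈ hexFaceVertices F) (h₁2 : d₁.2 ∈ hexFaceVertices F) (h₂1 : d₂.1 ∈ hexFaceVertices F) (h₂2 : d₂.2 ∈ hexFaceVertices F) :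
    blk D m (D.dpos d₁) = blk D m (D.dpos d₂) := by
  obtain ⟨h00, h01, h12, h23, h34, h4L⟩ := pos_facts D
  have hmL : m < #(triBdryDarts D.verts) := by omega
  obtain ⟨w, hw⟩ := mem_hexFaceVertices_iff_faceVertex.1 h₁2
  obtain ⟨j, hj, hj1⟩ := exists_inner_outer hF (w := w) (hw ▸ (mem_triBdryDarts.1 hd₁).2.1)
  obtain ⟨hd, hlf, -⟩ := faceDart_facts (D := D) hj hj1
  set d := (faceVertex F j, faceVertex F (j + 1)) with hdd
  set n := D.dpos d with hn
  have hnL : n < #(triBdryDarts D.verts) := D.dpos_lt hd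
  have hmark : ∀ i : Fin 5, (n + 1) % #(triBdryDarts D.verts) ≠ D.pos i := by
    intro i hi
    obtain ⟨k, hk⟩ := (succ_eq_pos_iff_corner hj hj1).1 ⟨i, hi⟩
    exact hFc ((mem_corners D).2 ⟨k, eq_yc D hk⟩)
  have hz : (n + 1) % #(triBdryDarts D.verts) ≠ m := by
    intro h
    exact hFs (hlf.symm.trans ((leftFace_eq_sFaceS_iff hmL hd).2 h))
  have hs := blk_succ_of_not_change (m := m) hmark hz
  have hsucc : D.dpos (triBdrySucc D.verts d) = (n + 1) % #(triBdryDarts D.verts) := D.dpos_succ hd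
  have key : ∀ d' : Site 2 × Site 2, d' = d ∨ d' = triBdrySucc D.verts d → blk D m (D.dpos d') = blk D m n := by
    rintro d' (rfl | rfl)
    · rfl
    · rw [hsucc, blk_mod, hs]
  rw [key d₁ (bdryDart_of_face_eq hj hj1 hd₁ h₁1 h₁2), key d₂ (bdryDart_of_face_eq hj hj1 hd₂ h₂1 h₂2)]

section S

variable {g o : Site 2} (hd0 : (g, o) ∈ D.stretch 0)
include hd0

/-- ★ **STEP of the side chain inside a face** `F` (not a corner, not the split face) crossed by the component through the sides
`{a, b'}` and `{b', c}`: the bond invariant passes from `{a, b'}` to `{b', c}`. [cite: KhristoforovSmirnov2021, §1.2 Lemma 2 (p. 3)] -/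
theorem oks_step (T : Finset (Site 2)) (b : Bool) (q₀ : ℕ) {F : HexVertex} (hF : F ∈ triFacesTouching D.verts)
    (hFc : F ∉ corners D) (hFs : F ≠ sOfS D g o T) {a b' c : Site 2} (haF : a ∈ hexFaceVertices F) (hbF : b' ∈ hexFaceVertices F)
    (hcF : c ∈ hexFaceVertices F) (hab' : a ≠ b') (hbc' : b' ≠ c) (hac' : a ≠ c)
    (hab : s(a, b') ∈ PhiS D g o T) (hbc : s(b', c) ∈ PhiS D g o T) (hok : OKs D g o T b q₀ a b') :
    OKs D g o T b q₀ b' c := by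
  set m := mOfS D g o T with hmdef
  have hm : m ≤ D.pos 1 := mOfS_le hd0 T
  have adj_ab : triGraph.Adj a b' := adj_of_mem_hexFaceVertices haF hbF hab'
  have adj_bc : triGraph.Adj b' c := adj_of_mem_hexFaceVertices hbF hcF hbc'
  have adj_ac : triGraph.Adj a c := adj_of_mem_hexFaceVertices haF hcF hac'
  have hblock : ∀ {d₁ d₂ : Site 2 × Site 2}, d₁ ∈ triBdryDarts D.verts → d₂ ∈ triBdryDarts D.verts →
      d₁.1 ∈ hexFaceVertices F → d₁.2 ∈ hexFaceVertices F → d₂.1 ∈ hexFaceVertices F → d₂.2 ∈ hexFaceVertices F →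
      blk D m (D.dpos d₁) = blk D m (D.dpos d₂) :=
    fun hd₁ hd₂ h11 h12 h21 h22 => sameBlock_of_face hm hF hFc hFs hd₁ hd₂ h11 h12 h21 h22
  have hfrs_of_blk : ∀ {d₁ d₂ : Site 2 × Site 2}, blk D m (D.dpos d₁) = blk D m (D.dpos d₂) →
      frs D m (D.dpos d₁) = frs D m (D.dpos d₂) := fun e => by rw [frs_eq_blk, frs_eq_blk, e]
  obtain ⟨hokA, hokB, hokAo, hokBo⟩ := hok
  unfold PhiS at hab hbc
  rw [← hmdef] at hab hbc
  by_cases hbG : b' ∈ D.verts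
  · by_cases hbcol : (b' ∈ T ↔ b = true)
    · -- b' has colour b
      have hjb : BJ D m T b q₀ b' := hokB hbG hbcol
      refine ⟨hokB, fun hcG hcc => bj_of_adj hjb adj_bc hcG hcc, fun _ hcG hf => ?_, fun _ h => absurd hbG h⟩
      rw [mk_mem_phiS_iff_of_mem_not_mem m T adj_bc hbG hcG] at hbc
      exact absurd hbcol ((col_outer hbc).2 hf)
    · -- b' has the other colour: a has colour b
      refine ⟨fun _ h => absurd h hbcol, fun hcG hcc => ?_, fun _ hcG hf => ?_, fun _ h => absurd hbG h⟩
      · -- c inner of colour b: join it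
        by_cases haG : a ∈ D.verts
        · have hac : (a ∈ T ↔ b = true) := by
            rw [mk_mem_phiS_iff_of_mem_mem m T adj_ab haG hbG] at hab
            exact (col_inner hab).2 hbcol
          exact bj_of_adj (hokA haG hac) adj_ac hcG hcc
        · -- a outer, read with colour b through (b', a); (c, a) lies in the same block
          rw [Sym2.eq_swap, mk_mem_phiS_iff_of_mem_not_mem m T adj_ab.symm hbG haG] at hab
          have hfa : frs D m (D.dpos (b', a)) = b := (col_outer hab).1 hbcol
          have hsc := hokBo hbG haG hfa
          have hdba : (b', a) ∈ triBdryDarts D.verts := mem_triBdryDarts.2 ⟨hbG, haG, adj_ab.symm⟩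
          have hdca : (c, a) ∈ triBdryDarts D.verts := mem_triBdryDarts.2 ⟨hcG, haG, adj_ac.symm⟩
          have e := hblock hdba hdca hbF haF hcF haF
          rw [e] at hsc
          exact bj_of_mem_bsites hsc (fst_mem_bsites m hdca) hcG hcc
      · -- c outer read with colour b through (b', c)
        by_cases haG : a ∈ D.verts
        · have hac : (a ∈ T ↔ b = true) := by
            rw [mk_mem_phiS_iff_of_mem_mem m T adj_ab haG hbG] at hab
            exact (col_inner hab).2 hbcol
          have hdbc : (b', c) ∈ triBdryDarts D.verts := mem_triBdryDarts.2 ⟨hbG, hcG, adj_bc⟩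
          have hdac : (a, c) ∈ triBdryDarts D.verts := mem_triBdryDarts.2 ⟨haG, hcG, adj_ac⟩
          have e := hblock hdbc hdac hbF hcF haF hcF
          rw [e]
          refine sconn_of_bj (hokA haG hac) (fst_mem_bsites m hdac) (col_blk_of_frs ?_)
          rw [← hfrs_of_blk e]; exact hf
        · rw [Sym2.eq_swap, mk_mem_phiS_iff_of_mem_not_mem m T adj_ab.symm hbG haG] at hab
          have hfa : frs D m (D.dpos (b', a)) = b := (col_outer hab).1 hbcol
          have hsc := hokBo hbG haG hfa
          have hdba : (b', a) ∈ triBdryDarts D.verts := mem_triBdryDarts.2 ⟨hbG, haG, adj_ab.symm⟩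
          have hdbc : (b', c) ∈ triBdryDarts D.verts := mem_triBdryDarts.2 ⟨hbG, hcG, adj_bc⟩
          have e := hblock hdba hdbc hbF haF hbF hcF
          rw [← e]; exact hsc
  · -- b' outer: a and c are sites of G reading b' through the same block
    have haG : a ∈ D.verts := mem_of_mk_mem_phiS hab hbG
    have hcG : c ∈ D.verts := mem_of_mk_mem_phiS (by rw [Sym2.eq_swap]; exact hbc) hbG
    have hdab : (a, b') ∈ triBdryDarts D.verts := mem_triBdryDarts.2 ⟨haG, hbG, adj_ab⟩
    have hdcb : (c, b') ∈ triBdryDarts D.verts := mem_triBdryDarts.2 ⟨hcG, hbG, adj_bc.symm⟩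
    have e := hblock hdab hdcb haF hbF hcF hbF
    have ef := hfrs_of_blk e
    rw [mk_mem_phiS_iff_of_mem_not_mem m T adj_ab haG hbG] at hab
    rw [Sym2.eq_swap, mk_mem_phiS_iff_of_mem_not_mem m T adj_bc.symm hcG hbG] at hbc
    refine ⟨fun h => absurd h hbG, fun _ hcc => ?_, fun h => absurd h hbG, fun _ _ hf => ?_⟩
    · have hac : (a ∈ T ↔ b = true) := by rw [hab, ef, ← hbc]; exact hcc
      exact bj_of_adj (hokA haG hac) adj_ac hcG hcc
    · rw [← e]; refine hokAo haG hbG ?_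
      rw [ef]; exact hf

/-! ### the start of the chain: the split face -/

/-- ★ **BASE at the split face**: the face invariant holds at the odd endpoint `sOfS σ`, the start block being the block of colour
`b` at the split (`0 = ∂_{y₀ z}` for blue, `1 = ∂_{z y₁}` for yellow). [cite: KhristoforovSmirnov2021, §1.2 Lemma 2 (p. 3)] -/
theorem pf_sOfS (T : Finset (Site 2)) (b : Bool) : PF D g o T b (if b then 0 else 1) (sOfS D g o T) := by
  classical
  obtain ⟨hd, hg, ho, hgo, hst, hp1⟩ := stretch_zero_facts hd0
  obtain ⟨h00, h01, h12, h23, h34, h4L⟩ := pos_facts D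
  have hL := D.isTriDisc.card_pos
  have hpL := D.dpos_lt hd
  set m := mOfS D g o T with hmdef
  set p := D.dpos (g, o) with hpdef
  set q₀ : ℕ := (if b then 0 else 1) with hq₀
  have hm : m ≤ D.pos 1 := mOfS_le hd0 T
  -- the dart `d` of the split face and its successor
  set d := bdart D (m + (#(triBdryDarts D.verts) - 1)) with hdd
  have hdm : d ∈ triBdryDarts D.verts := bdart_mem _
  obtain ⟨hd1, hd2, hdadj⟩ := mem_triBdryDarts.1 hdm
  have hsucc : triBdrySucc D.verts d = bdart D m := succ_bdart_pred m
  have hsF : sOfS D g o T = leftFace d.1 d.2 := rfl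
  have hverts : hexFaceVertices (sOfS D g o T) = {d.1, d.2, triLeftApex d.1 d.2} := by rw [hsF, hexFaceVertices_leftFace hdadj]
  -- the two cases for the split
  have hcase : (g ∈ T ∧ m = p + 1 ∧ d = (g, o)) ∨ (g ∉ T ∧ m = p ∧ triBdrySucc D.verts d = (g, o)) := by
    by_cases hgT : g ∈ T
    · have hm1 : m = p + 1 := by rw [hmdef]; unfold mOfS; rw [if_pos hgT]
      refine Or.inl ⟨hgT, hm1, ?_⟩
      rw [hdd, hm1, show p + 1 + (#(triBdryDarts D.verts) - 1) = p + #(triBdryDarts D.verts) by omega]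
      unfold bdart; rw [D.isTriDisc.iter_add_card, hpdef, D.iter_dpos hd]
    · have hm0 : m = p := by rw [hmdef]; unfold mOfS; rw [if_neg hgT]
      refine Or.inr ⟨hgT, hm0, ?_⟩
      rw [hsucc, hm0, hpdef, bdart_dpos hd]
  -- positions and blocks of `d` and `succ d`
  have hdpos_d : D.dpos d = (m + (#(triBdryDarts D.verts) - 1)) % #(triBdryDarts D.verts) := by rw [hdd, dpos_bdart]
  have hdpos_s : D.dpos (triBdrySucc D.verts d) = m := by rw [hsucc, dpos_bdart, Nat.mod_eq_of_lt (by omega)]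
  have hblk_d : 0 < m → blk D m (D.dpos d) = 0 := by
    intro h0
    rw [hdpos_d, show m + (#(triBdryDarts D.verts) - 1) = (m - 1) + #(triBdryDarts D.verts) by omega, Nat.add_mod_right,
      Nat.mod_eq_of_lt (by omega)]
    exact blk_eq_zero_iff.2 ⟨posIdx_zero_of_lt (by rw [Nat.mod_eq_of_lt (by omega)]; omega),
      by rw [Nat.mod_eq_of_lt (by omega)]; omega⟩
  have hfrs_d0 : m = 0 → frs D m (D.dpos d) = false := by
    intro h0
    rw [hdpos_d, h0, Nat.zero_add, Nat.mod_eq_of_lt (by omega), frs_of_posIdx_ne_zero (by rw [posIdx_last]; decide), posIdx_last]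
    decide
  have hblk_s : m < D.pos 1 → blk D m (D.dpos (triBdrySucc D.verts d)) = 1 := by
    intro h1
    rw [hdpos_s]
    exact blk_eq_one_iff.2 ⟨posIdx_zero_of_lt (by rw [Nat.mod_eq_of_lt (by omega)]; exact h1),
      by rw [Nat.mod_eq_of_lt (by omega)]; omega⟩
  have hfrs_s1 : m = D.pos 1 → frs D m (D.dpos (triBdrySucc D.verts d)) = true := by
    intro h1
    have : posIdx D m = 1 := posIdx_unique D (by rw [Nat.mod_eq_of_lt (by omega), h1])
      (by rw [Nat.mod_eq_of_lt (by omega), h1]; exact D.pos_lt_nextPos 1)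
    rw [hdpos_s, frs_of_posIdx_ne_zero (by rw [this]; decide), this]; decide
  -- the tails: `d.1` is a hexagon of the block of `d`, `(succ d).1` of the block of `succ d`
  have htail_d : d.1 ∈ bsites D m (blk D m (D.dpos d)) := fst_mem_bsites m hdm
  have htail_s : (triBdrySucc D.verts d).1 ∈ bsites D m (blk D m (D.dpos (triBdrySucc D.verts d))) :=
    fst_mem_bsites m (triBdrySucc_mem hdm)
  -- (1) the inner vertices of colour `b` of the split face are joined to `q₀`
  have hconn : ∀ x ∈ hexFaceVertices (sOfS D g o T), x ∈ D.verts → (x ∈ T ↔ b = true) → BJ D m T b q₀ x := by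
    intro x hx hxG hxc
    rw [hverts, Finset.mem_insert, Finset.mem_insert, Finset.mem_singleton] at hx
    rcases hcase with ⟨hgT, hm1, hdg⟩ | ⟨hgT, hm0, hsg⟩
    · -- g blue, d = (g, o): the inner vertices are g and (possibly) the apex
      have hgJ : b = true → BJ D m T b q₀ g := by
        intro hb
        have h0 : blk D m (D.dpos d) = 0 := hblk_d (by omega)
        have : g ∈ bsites D m 0 := by rw [← h0]; convert htail_d using 2; rw [hdg]
        refine ⟨0, ?_, g, this, PathIn.refl ⟨hg, by simp [hgT, hb]⟩⟩
        rw [hq₀, if_pos hb]; exact Relation.ReflTransGen.refl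
      rcases hx with rfl | rfl | rfl
      · rw [hdg] at hxc ⊢
        cases b
        · exact absurd (hxc.1 hgT) (by decide)
        · exact hgJ rfl
      · exact absurd hxG hd2
      · -- the apex
        rw [hdg] at hxG hxc ⊢
        change triLeftApex g o ∈ D.verts at hxG
        cases b
        · -- yellow apex: it is the tail of `succ d = (apex, o)`, a dart of the block `1`
          have hsg : triBdrySucc D.verts d = (triLeftApex g o, o) := by
            rw [hdg]; unfold triBdrySucc; rw [if_pos hxG]
          have hmlt : m < D.pos 1 := by
            by_contra hge
            have hm1' : m = D.pos 1 := le_antisymm hm (not_lt.1 hge)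
            -- then `succ d = markDart 1` has tail `v₁ = g`
            have e1 : triBdrySucc D.verts d = D.markDart 1 := by
              rw [hsucc, hm1']; rfl
            have e2 : (D.markDart 1).1 = g := by
              have : d = predDart D 1 := by
                rw [hdd, hm1']; rfl
              show D.markSite 1 = g
              rw [← predDart_fst D 1, ← this, hdg]
            have : triLeftApex g o = g := by
              have := congrArg Prod.fst hsg; rw [e1, e2] at this; exact this.symm
            exact (triGraph_adj_triLeftApex_left hgo).ne this.symm
          have h1 : blk D m (D.dpos (triBdrySucc D.verts d)) = 1 := hblk_s hmlt
          have hmem : triLeftApex g o ∈ bsites D m 1 := by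
            rw [← h1]; convert htail_s using 2; rw [hsg]
          exact ⟨1, Relation.ReflTransGen.refl, _, hmem, PathIn.refl ⟨hxG, hxc⟩⟩
        · exact bj_of_adj (hgJ rfl) (triGraph_adj_triLeftApex_left hgo) hxG hxc
    · -- g yellow, succ d = (g, o)
      have hgJ : b = false → BJ D m T b q₀ g := by
        intro hb
        have hmlt : m < D.pos 1 := by omega
        have h1 : blk D m (D.dpos (triBdrySucc D.verts d)) = 1 := hblk_s hmlt
        have : g ∈ bsites D m 1 := by rw [← h1]; convert htail_s using 2; rw [hsg]
        refine ⟨1, ?_, g, this, PathIn.refl ⟨hg, by simp [hgT, hb]⟩⟩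
        rw [hq₀, if_neg (by rw [hb]; decide)]; exact Relation.ReflTransGen.refl
      -- which branch of the successor
      by_cases hapex : triLeftApex d.1 d.2 ∈ D.verts
      · -- `succ d = (apex, d.2)`: the apex is `g`, `d = (g', o)`
        have hsg' : triBdrySucc D.verts d = (triLeftApex d.1 d.2, d.2) := by unfold triBdrySucc; rw [if_pos hapex]
        have hag : triLeftApex d.1 d.2 = g := by have := congrArg Prod.fst (hsg'.symm.trans hsg); exact this
        have hp0 : 0 < m := by
          by_contra hle
          have hm00 : m = 0 := by omega
          -- `d = predDart 0` has tail `v₀ = g`: then the apex `g` equals the tail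
          have hdp : d = predDart D 0 := by
            rw [hdd, hm00, Nat.zero_add]
            show bdart D (#(triBdryDarts D.verts) - 1) = triBdryIter D.verts D.base (D.pos 0 + (D.bdryLen - 1))
            rw [h00, Nat.zero_add]; rfl
          have e1 : d.1 = g := by
            have h1 := congrArg Prod.fst hsg
            rw [hdp, succ_predDart] at h1
            rw [hdp, predDart_fst]; exact h1
          exact (triGraph_adj_triLeftApex_left hdadj).ne (e1.trans hag.symm)
        rcases hx with rfl | rfl | rfl
        · -- the tail `g'` of `d`
          cases b
          · -- yellow `g'`: joined through `g`
            have hadj' : triGraph.Adj g d.1 := by rw [← hag]; exact (triGraph_adj_triLeftApex_left hdadj).symm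
            exact bj_of_adj (hgJ rfl) hadj' hxG hxc
          · have h0 : blk D m (D.dpos d) = 0 := hblk_d hp0
            have : d.1 ∈ bsites D m 0 := by rw [← h0]; exact htail_d
            exact ⟨0, Relation.ReflTransGen.refl, _, this, PathIn.refl ⟨hxG, hxc⟩⟩
        · exact absurd hxG hd2
        · rw [hag] at hxc ⊢
          cases b
          · exact hgJ rfl
          · exact absurd (hxc.2 rfl) hgT
      · -- `succ d = (d.1, apex) = (g, o)`: `d = (g, w)`
        have hsg' : triBdrySucc D.verts d = (d.1, triLeftApex d.1 d.2) := by unfold triBdrySucc; rw [if_neg hapex]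
        have hdg : d.1 = g := by have := congrArg Prod.fst (hsg'.symm.trans hsg); exact this
        rcases hx with rfl | rfl | rfl
        · rw [hdg] at hxc ⊢
          cases b
          · exact hgJ rfl
          · exact absurd (hxc.2 rfl) hgT
        · exact absurd hxG hd2
        · exact absurd hxG hapex
  -- (2) the boundary darts of the split face that are bicoloured and read with colour `b` belong to `q₀`
  have hdarts : ∀ a c : Site 2, a ∈ D.verts → c ∉ D.verts → triGraph.Adj a c → a ∈ hexFaceVertices (sOfS D g o T) →
      c ∈ hexFaceVertices (sOfS D g o T) → s(a, c) ∈ phiS D m T → frs D m (D.dpos (a, c)) = b →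
      SConn D m T b q₀ (blk D m (D.dpos (a, c))) := by
    intro a c haG hcG hac h1 h2 hmem hf
    have hd' : (a, c) ∈ triBdryDarts D.verts := mem_triBdryDarts.2 ⟨haG, hcG, hac⟩
    obtain ⟨j, hj, hj1⟩ := exists_eq_faceVertex_of_adj hdadj
    rw [hsF] at h1 h2
    have hdj : d = (faceVertex (leftFace d.1 d.2) j, faceVertex (leftFace d.1 d.2) (j + 1)) := Prod.ext hj hj1
    rw [mk_mem_phiS_iff_of_mem_not_mem m T hac haG hcG] at hmem
    rcases bdryDart_of_face_eq (D := D) (hj ▸ hd1) (hj1 ▸ hd2) hd' h1 h2 with e | e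
    · -- the dart `d`
      rw [← hdj] at e
      rw [e] at hmem hf ⊢
      by_cases hm0 : m = 0
      · -- frame yellow at position `L - 1`, but then `d = predDart 0 = (g, ·)` with `g` yellow: not bicoloured
        exfalso
        have hff := hfrs_d0 hm0
        rcases hcase with ⟨hgT, hm1, -⟩ | ⟨hgT, hm00, hsg⟩
        · omega
        · have hdp : d = predDart D 0 := by
            rw [hdd, hm0, Nat.zero_add]
            show bdart D (#(triBdryDarts D.verts) - 1) = triBdryIter D.verts D.base (D.pos 0 + (D.bdryLen - 1))
            rw [h00, Nat.zero_add]; rfl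
          have e1 : d.1 = g := by
            have h1' := congrArg Prod.fst hsg
            rw [hdp, succ_predDart] at h1'
            rw [hdp, predDart_fst]; exact h1'
          have ha : a = g := (congrArg Prod.fst e).trans e1
          rw [ha] at hmem
          exact hgT (hmem.2 (by rw [← e]; rw [e]; exact hff))
      · have h0 := hblk_d (by omega)
        rw [h0]
        have hb : b = true := by rw [← hf, frs_eq_blk, h0]; decide
        rw [hq₀, if_pos hb]; exact Relation.ReflTransGen.refl
    · -- the dart `succ d` at position `m`
      rw [← hdj] at e
      rw [e] at hmem hf ⊢
      by_cases hm1 : m = D.pos 1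
      · -- frame blue at position `pos 1`, but then `g = v₁` is blue: not bicoloured
        exfalso
        have hft := hfrs_s1 hm1
        rcases hcase with ⟨hgT, hm1', hdg⟩ | ⟨hgT, hm0, hsg⟩
        · have e1 : (triBdrySucc D.verts d).1 = g := by
            have : triBdrySucc D.verts d = D.markDart 1 := by rw [hsucc, hm1]; rfl
            rw [this]
            have hpd : d = predDart D 1 := by rw [hdd, hm1]; rfl
            show D.markSite 1 = g
            rw [← predDart_fst D 1, ← hpd, hdg]
          have ha : a = g := (congrArg Prod.fst e).trans e1
          rw [ha] at hmem
          have := hmem.1 hgT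
          rw [hft] at this
          exact absurd this (by decide)
        · omega
      · have h1 := hblk_s (by omega)
        rw [h1]
        have hb : b = false := by rw [← hf, frs_eq_blk, h1]; decide
        rw [hq₀, if_neg (by rw [hb]; decide)]; exact Relation.ReflTransGen.refl
  -- conclusion
  intro j hj
  have hv1 := faceVertex_mem (sOfS D g o T) (j + 1)
  have hv2 := faceVertex_mem (sOfS D g o T) (j + 2)
  have hne : faceVertex (sOfS D g o T) (j + 1) ≠ faceVertex (sOfS D g o T) (j + 2) :=
    fun e => fin3_ne_add_one_s (j + 1) (by rw [fin3_add_one_add_one_s]; exact faceVertex_injective _ e)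
  have hadj12 := adj_of_mem_hexFaceVertices hv1 hv2 hne
  have hj' : s(faceVertex (sOfS D g o T) (j + 1), faceVertex (sOfS D g o T) (j + 2)) ∈ phiS D m T := hj
  unfold OKs
  rw [← hmdef]
  refine ⟨?_, ?_, ?_, ?_⟩
  · intro h1 h2; exact hconn _ hv1 h1 h2
  · intro h1 h2; exact hconn _ hv2 h1 h2
  · intro h1 h2 hf; exact hdarts _ _ h1 h2 hadj12 hv1 hv2 hj' hf
  · intro h1 h2 hf
    exact hdarts _ _ h1 h2 hadj12.symm hv2 hv1 (by rw [Sym2.eq_swap]; exact hj') hf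

end S

end Chain

section Corners

variable {D : TriMarkedDomain 5}

/-! ### the blocks at a corner, and the colour change there -/

/-- **the block of colour `b` at the corner `y_a`**: the block of the marked dart of `a` if it has colour `b`, else the block of the
preceding dart. [cite: KhristoforovSmirnov2021, §1.2 Lemma 2 (p. 3)] -/
noncomputable def cornerBlk (D : TriMarkedDomain 5) (m : ℕ) (a : Fin 5) (b : Bool) : ℕ :=
  if frs D m (D.pos a) = b then blk D m (D.pos a) else blk D m (D.pos a + (#(triBdryDarts D.verts) - 1))

/-- position of the preceding dart. [cite: KhristoforovSmirnov2021, §1.2 Lemma 2 (p. 3)] -/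
theorem dpos_predDart' (a : Fin 5) : D.dpos (predDart D a) = (D.pos a + (#(triBdryDarts D.verts) - 1)) % #(triBdryDarts D.verts) := by
  unfold predDart; exact D.dpos_iter _

/-- frame colour of the preceding dart. [cite: KhristoforovSmirnov2021, §1.2 Lemma 2 (p. 3)] -/
theorem frs_predDart (m : ℕ) (a : Fin 5) : frs D m (D.dpos (predDart D a)) = frs D m (D.pos a + (#(triBdryDarts D.verts) - 1)) := by
  rw [dpos_predDart', frs_mod]

/-- block of the preceding dart. [cite: KhristoforovSmirnov2021, §1.2 Lemma 2 (p. 3)] -/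
theorem blk_predDart (m : ℕ) (a : Fin 5) : blk D m (D.dpos (predDart D a)) = blk D m (D.pos a + (#(triBdryDarts D.verts) - 1)) := by
  rw [dpos_predDart', blk_mod]

/-- **the frame changes colour at every corner other than the split.** [cite: KhristoforovSmirnov2021, §1.2 Lemma 2 (p. 3)] -/
theorem frs_change {m : ℕ} (hm : m ≤ D.pos 1) {a : Fin 5} (ha : D.pos a ≠ m) :
    frs D m (D.pos a) ≠ frs D m (D.pos a + (#(triBdryDarts D.verts) - 1)) := by
  have hL := D.isTriDisc.card_pos
  set n := D.pos a + (#(triBdryDarts D.verts) - 1) with hn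
  have h1 : (n + 1) % #(triBdryDarts D.verts) = D.pos a := by
    rw [hn, show D.pos a + (#(triBdryDarts D.verts) - 1) + 1 = D.pos a + #(triBdryDarts D.verts) by omega, Nat.add_mod_right,
      Nat.mod_eq_of_lt (D.pos_lt a)]
  have key := (frs_succ_ne_iff_of_mark hm h1).2 ha
  have e : frs D m (n + 1) = frs D m (D.pos a) := by rw [← frs_mod, h1]
  rw [e] at key
  exact key

/-- the corner block has colour `b`. [cite: KhristoforovSmirnov2021, §1.2 Lemma 2 (p. 3)] -/
theorem col_cornerBlk {m : ℕ} (hm : m ≤ D.pos 1) {a : Fin 5} (ha : D.pos a ≠ m) (b : Bool) :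
    decide (cornerBlk D m a b % 2 = 0) = b := by
  have hch := frs_change hm ha
  unfold cornerBlk
  by_cases h : frs D m (D.pos a) = b
  · rw [if_pos h, ← frs_eq_blk, h]
  · rw [if_neg h, ← frs_eq_blk]
    revert h hch
    cases frs D m (D.pos a) <;> cases frs D m (D.pos a + (#(triBdryDarts D.verts) - 1)) <;> cases b <;> simp

/-- the corner block is the block of the marked dart when that has colour `b`. [cite: KhristoforovSmirnov2021, §1.2 Lemma 2 (p. 3)] -/
theorem cornerBlk_of_mark {m : ℕ} {a : Fin 5} {b : Bool} (h : frs D m (D.dpos (D.markDart a)) = b) :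
    cornerBlk D m a b = blk D m (D.dpos (D.markDart a)) := by
  rw [dpos_markDart D a] at h ⊢
  unfold cornerBlk; rw [if_pos h]

/-- the corner block is the block of the preceding dart when that has colour `b`. [cite: KhristoforovSmirnov2021, §1.2 Lemma 2 (p. 3)] -/
theorem cornerBlk_of_pred {m : ℕ} (hm : m ≤ D.pos 1) {a : Fin 5} (ha : D.pos a ≠ m) {b : Bool}
    (h : frs D m (D.dpos (predDart D a)) = b) : cornerBlk D m a b = blk D m (D.dpos (predDart D a)) := by
  have hch := frs_change hm ha
  rw [frs_predDart] at h
  rw [blk_predDart]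
  unfold cornerBlk
  rw [if_neg (by rw [← h]; exact hch)]

/-- the marked site is a hexagon of the block of its marked dart … [cite: KhristoforovSmirnov2021, §1.2 Lemma 2 (p. 3)] -/
theorem markSite_mem_bsites_mark (m : ℕ) (a : Fin 5) : D.markSite a ∈ bsites D m (blk D m (D.dpos (D.markDart a))) :=
  fst_mem_bsites m (markDart_mem D a)

/-- … and of the block of the preceding dart. [cite: KhristoforovSmirnov2021, §1.2 Lemma 2 (p. 3)] -/
theorem markSite_mem_bsites_pred (m : ℕ) (a : Fin 5) : D.markSite a ∈ bsites D m (blk D m (D.dpos (predDart D a))) := by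
  have := fst_mem_bsites m (predDart_mem D a)
  rwa [predDart_fst] at this

/-- the marked site is a hexagon of the corner block. [cite: KhristoforovSmirnov2021, §1.2 Lemma 2 (p. 3)] -/
theorem markSite_mem_bsites_cornerBlk (m : ℕ) (a : Fin 5) (b : Bool) : D.markSite a ∈ bsites D m (cornerBlk D m a b) := by
  unfold cornerBlk
  split_ifs
  · rw [← dpos_markDart D a]; exact markSite_mem_bsites_mark m a
  · rw [← blk_predDart]; exact markSite_mem_bsites_pred m a

/-- the outer vertices of a corner face are the heads of the two darts at the mark. [cite: KhristoforovSmirnov2021, §1.2 Lemma 2 (p. 3)] -/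
theorem corner_outer_eq {a : Fin 5} {c : Site 2} (hc : c ∈ hexFaceVertices (yc D a)) (hcG : c ∉ D.verts) :
    c = (predDart D a).2 ∨ c = (D.markDart a).2 := by
  obtain ⟨w, hw, hw1, hw2, hor⟩ := isCornerFace_typeII D (yc_spec D a)
  obtain ⟨i, rfl⟩ := mem_hexFaceVertices_iff_faceVertex.1 hc
  rcases fin3_cases_s w i with rfl | rfl | rfl
  · exact absurd (by rw [hw]; exact markSite_mem D a) hcG
  · rcases hor with ⟨e1, -⟩ | ⟨e1, -⟩
    · exact Or.inl e1
    · exact Or.inr e1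
  · rcases hor with ⟨-, e2⟩ | ⟨-, e2⟩
    · exact Or.inr e2
    · exact Or.inl e2

/-- the inner vertices of a corner face are the marked site. [cite: KhristoforovSmirnov2021, §1.2 Lemma 2 (p. 3)] -/
theorem corner_inner_eq {a : Fin 5} {u : Site 2} (hu : u ∈ hexFaceVertices (yc D a)) (huG : u ∈ D.verts) : u = D.markSite a := by
  obtain ⟨w, hw, hw1, hw2, -⟩ := isCornerFace_typeII D (yc_spec D a)
  obtain ⟨i, rfl⟩ := mem_hexFaceVertices_iff_faceVertex.1 hu
  rcases fin3_cases_s w i with rfl | rfl | rfl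
  · exact hw
  · exact absurd huG hw1
  · exact absurd huG hw2

/-- a boundary dart inside a corner face is one of the two darts at the mark. [cite: KhristoforovSmirnov2021, §1.2 Lemma 2 (p. 3)] -/
theorem corner_dart_eq {a : Fin 5} {u c : Site 2} (hu : u ∈ hexFaceVertices (yc D a)) (hc : c ∈ hexFaceVertices (yc D a))
    (huG : u ∈ D.verts) (hcG : c ∉ D.verts) : (u, c) = predDart D a ∨ (u, c) = D.markDart a := by
  have hu' := corner_inner_eq hu huG
  rcases corner_outer_eq hc hcG with e | e
  · exact Or.inl (Prod.ext (by rw [predDart_fst]; exact hu') e)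
  · exact Or.inr (Prod.ext hu' e)

section S

variable {g o : Site 2} (hd0 : (g, o) ∈ D.stretch 0)
include hd0

omit hd0 in
/-- reading the invariant of a side given by its endpoints. [cite: KhristoforovSmirnov2021, §1.2 Lemma 2 (p. 3)] -/
theorem oks_of_pf {T : Finset (Site 2)} {b : Bool} {q₀ : ℕ} {F : HexVertex} (hP : PF D g o T b q₀ F) {j : Fin 3} {u w : Site 2}
    (hj : side F j ∈ PhiS D g o T) (he : side F j = s(u, w)) : OKs D g o T b q₀ u w := by
  have hok := hP j hj
  unfold side at he
  rcases Sym2.eq_iff.1 he with ⟨e1, e2⟩ | ⟨e1, e2⟩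
  · rw [e1, e2] at hok; exact hok
  · rw [e1, e2] at hok; exact oks_symm hok

omit hd0 in
/-- a side of a corner face lying in `Φ(σ)` joins the marked site to one of the two outer heads. [cite: KhristoforovSmirnov2021, §1.2 Lemma 2 (p. 3)] -/
theorem corner_side_eq {T : Finset (Site 2)} {a : Fin 5} {j : Fin 3} (hj : side (yc D a) j ∈ PhiS D g o T) :
    ∃ c : Site 2, c ∈ hexFaceVertices (yc D a) ∧ c ∉ D.verts ∧ side (yc D a) j = s(D.markSite a, c) := by
  obtain ⟨w, hw, hw1, hw2, -⟩ := isCornerFace_typeII D (yc_spec D a)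
  obtain ⟨s2, s1, s0⟩ := sides_from_s (yc D a) w
  rcases fin3_cases_s w j with rfl | rfl | rfl
  · exfalso
    rw [s0] at hj
    obtain ⟨a', b', hab, ha', -⟩ := exists_rep_of_mem_hBonds D (phiS_subset _ T hj)
    rcases Sym2.eq_iff.1 hab with ⟨e1, -⟩ | ⟨-, e2⟩
    · exact hw1 (e1 ▸ ha')
    · exact hw2 (e2 ▸ ha')
  · exact ⟨_, faceVertex_mem _ _, hw2, by rw [s1, Sym2.eq_swap, hw]⟩
  · exact ⟨_, faceVertex_mem _ _, hw1, by rw [s2, hw]⟩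

/-- ★ **BASE at a corner**: the face invariant holds at the corner face `y_a` with start block `cornerBlk a b`, provided the frame
changes colour there. [cite: KhristoforovSmirnov2021, §1.2 Lemma 2 (p. 3)] -/
theorem pf_corner (T : Finset (Site 2)) (b : Bool) {a : Fin 5} (ha : D.pos a ≠ mOfS D g o T) :
    PF D g o T b (cornerBlk D (mOfS D g o T) a b) (yc D a) := by
  set m := mOfS D g o T with hmdef
  have hm : m ≤ D.pos 1 := mOfS_le hd0 T
  have hvG : D.markSite a ∈ D.verts := markSite_mem D a
  intro j hj
  have hv1 := faceVertex_mem (yc D a) (j + 1)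
  have hv2 := faceVertex_mem (yc D a) (j + 2)
  have hne : faceVertex (yc D a) (j + 1) ≠ faceVertex (yc D a) (j + 2) :=
    fun e => fin3_ne_add_one_s (j + 1) (by rw [fin3_add_one_add_one_s]; exact faceVertex_injective _ e)
  -- (1) the marked site, if of colour b, is joined (it is a hexagon of the corner block)
  have hconn : ∀ x ∈ hexFaceVertices (yc D a), x ∈ D.verts → (x ∈ T ↔ b = true) → BJ D m T b (cornerBlk D m a b) x := by
    intro x hx hxG hxc
    rw [corner_inner_eq hx hxG] at hxc ⊢
    exact ⟨_, Relation.ReflTransGen.refl, _, markSite_mem_bsites_cornerBlk m a b, PathIn.refl ⟨hvG, hxc⟩⟩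
  -- (2) the two darts at the mark
  have hdarts : ∀ u c : Site 2, u ∈ D.verts → c ∉ D.verts → u ∈ hexFaceVertices (yc D a) → c ∈ hexFaceVertices (yc D a) →
      frs D m (D.dpos (u, c)) = b → SConn D m T b (cornerBlk D m a b) (blk D m (D.dpos (u, c))) := by
    intro u c huG hcG hu hc hf
    rcases corner_dart_eq hu hc huG hcG with e | e <;> rw [e] at hf ⊢
    · rw [cornerBlk_of_pred hm ha hf]; exact Relation.ReflTransGen.refl
    · rw [cornerBlk_of_mark hf]; exact Relation.ReflTransGen.refl
  unfold OKs
  rw [← hmdef]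
  refine ⟨fun h1 h2 => hconn _ hv1 h1 h2, fun h1 h2 => hconn _ hv2 h1 h2, fun h1 h2 hf => hdarts _ _ h1 h2 hv1 hv2 hf,
    fun h1 h2 hf => hdarts _ _ h1 h2 hv2 hv1 hf⟩

/-- ★ **END at a corner**: if the face invariant reaches a corner `y_a` having a side in `Φ(σ)`, the start block is joined to the corner
block of colour `b`. [cite: KhristoforovSmirnov2021, §1.2 Lemma 2 (p. 3)] -/
theorem sconn_of_pf_corner {T : Finset (Site 2)} {b : Bool} {q₀ : ℕ} {a : Fin 5} (ha : D.pos a ≠ mOfS D g o T)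
    (hP : PF D g o T b q₀ (yc D a)) (hside : ∃ j : Fin 3, side (yc D a) j ∈ PhiS D g o T) :
    SConn D (mOfS D g o T) T b q₀ (cornerBlk D (mOfS D g o T) a b) := by
  set m := mOfS D g o T with hmdef
  have hm : m ≤ D.pos 1 := mOfS_le hd0 T
  have hvG : D.markSite a ∈ D.verts := markSite_mem D a
  obtain ⟨j, hj⟩ := hside
  obtain ⟨c, hc, hcG, hsd⟩ := corner_side_eq (D := D) hj
  have hok := oks_of_pf hP hj hsd
  have hadj : triGraph.Adj (D.markSite a) c := by
    have := adj_of_mk_mem_phiS (D := D) (hsd ▸ hj : s(D.markSite a, c) ∈ PhiS D g o T); exact this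
  have hmem : s(D.markSite a, c) ∈ PhiS D g o T := hsd ▸ hj
  unfold PhiS at hmem
  rw [← hmdef, mk_mem_phiS_iff_of_mem_not_mem m T hadj hvG hcG] at hmem
  have hvY : D.markSite a ∈ hexFaceVertices (yc D a) := by
    obtain ⟨w, hw, -, -, -⟩ := isCornerFace_typeII D (yc_spec D a)
    rw [← hw]; exact faceVertex_mem _ _
  by_cases hvc : (D.markSite a ∈ T ↔ b = true)
  · obtain ⟨q, hq, a₀, ha₀, hP'⟩ := hok.1 hvG hvc
    exact sconn_tail hq (col_cornerBlk hm ha b) ⟨a₀, ha₀, _, markSite_mem_bsites_cornerBlk m a b, hP'⟩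
  · have hf : frs D m (D.dpos (D.markSite a, c)) = b := (col_outer hmem).1 hvc
    have hsc := hok.2.2.1 hvG hcG hf
    rcases corner_dart_eq hvY hc hvG hcG with e | e <;> rw [e] at hf hsc
    · rwa [cornerBlk_of_pred hm ha hf]
    · rwa [cornerBlk_of_mark hf]

variable {x x' : HexVertex} (hxx : hexGraph.Adj x x') (hex : faceEdge x x' = {g, o})
include hxx hex

/-- **the step between faces**: across a side in `Φ(σ)` the face invariant passes to the next face, unless that is the split face.
[cite: KhristoforovSmirnov2021, §1.2 Lemma 2 (p. 3)] -/
theorem pf_step (T : Finset (Site 2)) (b : Bool) (q₀ : ℕ) {F F' : HexVertex} (hP : PF D g o T b q₀ F)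
    (hFF' : (sideGraph (PhiS D g o T)).Adj F F') (hFs : F' ≠ sOfS D g o T) : PF D g o T b q₀ F' := by
  classical
  obtain ⟨j, rfl, hj⟩ := hFF'
  set ξ := PhiS D g o T with hξdef
  have hsub : ξ ⊆ hBonds D := fun e he' => phiS_subset _ T he'
  set k := oppIdx F j with hk
  set F' := oppFace F j with hF'def
  have hshared : side F' k = side F j := side_oppFace_oppIdx F j
  have hjk' : side F' k ∈ ξ := by rw [hshared]; exact hj
  have hokk : OKs D g o T b q₀ (faceVertex F' (k + 1)) (faceVertex F' (k + 2)) := by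
    have := oks_of_pf hP hj (rfl : side F j = s(faceVertex F (j + 1), faceVertex F (j + 2)))
    rw [hF'def, hk, faceVertex_oppFace_succ, faceVertex_oppFace_succ_succ]
    exact oks_symm this
  intro j' hj'
  by_cases hjk : j' = k
  · rw [hjk]; exact hokk
  -- two distinct sides of F' in ξ: F' is even, hence not a corner (being ≠ s)
  have hF't : F' ∈ triFacesTouching D.verts := mem_touching_of_side_mem D (hsub hj')
  have hdeg := xiDeg_PhiS_le_two hd0 hxx hex T F'
  have hge : 2 ≤ xiDeg ξ F' := by
    rw [l1_xiDeg_eq]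
    have hsub2 : ({k, j'} : Finset (Fin 3)) ⊆ ((Finset.univ : Finset (Fin 3)).filter fun i => side F' i ∈ ξ) := by
      intro y hy
      rw [Finset.mem_insert, Finset.mem_singleton] at hy
      rw [Finset.mem_filter]
      rcases hy with rfl | rfl
      · exact ⟨Finset.mem_univ _, hjk'⟩
      · exact ⟨Finset.mem_univ _, hj'⟩
    have hc : #({k, j'} : Finset (Fin 3)) = 2 := Finset.card_pair (Ne.symm hjk)
    calc 2 = #({k, j'} : Finset (Fin 3)) := hc.symm
      _ ≤ _ := Finset.card_le_card hsub2
  have h2 : xiDeg ξ F' = 2 := le_antisymm hdeg hge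
  have heven : ¬ Odd (xiDeg ξ F') := by rw [h2]; decide
  have hFc : F' ∉ corners D := by
    intro hc
    obtain ⟨i, hi⟩ := (mem_corners D).1 hc
    have hpar := ((mem_loopSpace6b (D := D)).1 (PhiS_mem hd0 T)).2 F' hF't
    exact heven (hpar.2 (Or.inl ⟨⟨i, hi ▸ yc_spec D i⟩, hFs⟩))
  obtain ⟨s2, s1, s0⟩ := sides_from_s F' k
  have hx0 := faceVertex_mem F' k
  have hx1 := faceVertex_mem F' (k + 1)
  have hx2 := faceVertex_mem F' (k + 2)
  have n01 : faceVertex F' k ≠ faceVertex F' (k + 1) := fun e => fin3_ne_add_one_s k (faceVertex_injective _ e)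
  have n02 : faceVertex F' k ≠ faceVertex F' (k + 2) := fun e => fin3_ne_add_two_s k (faceVertex_injective _ e)
  have n12 : faceVertex F' (k + 1) ≠ faceVertex F' (k + 2) :=
    fun e => fin3_add_two_ne_add_one_s k (faceVertex_injective _ e).symm
  have hab : s(faceVertex F' (k + 1), faceVertex F' (k + 2)) ∈ ξ := by rw [← s0]; exact hjk'
  rcases fin3_cases_s k j' with e | e | e
  · exact absurd e hjk
  · rw [e] at hj' ⊢
    rw [s1] at hj'
    have step := oks_step hd0 T b q₀ hF't hFc hFs hx1 hx2 hx0 n12 (Ne.symm n02) (Ne.symm n01) hab hj' hokk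
    rw [fin3_add_one_add_one_s, fin3_add_one_add_two_s]
    exact step
  · rw [e] at hj' ⊢
    rw [s2] at hj'
    have hba : s(faceVertex F' (k + 2), faceVertex F' (k + 1)) ∈ ξ := by rw [Sym2.eq_swap]; exact hab
    have hbc : s(faceVertex F' (k + 1), faceVertex F' k) ∈ ξ := by rw [Sym2.eq_swap]; exact hj'
    have step := oks_step hd0 T b q₀ hF't hFc hFs hx2 hx1 hx0 (Ne.symm n12) (Ne.symm n01) (Ne.symm n02) hba hbc
      (oks_symm hokk)
    rw [fin3_add_two_add_one_s, fin3_add_two_add_two_s]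
    exact oks_symm step

/-- the face invariant on the component of the split face. [cite: KhristoforovSmirnov2021, §1.2 Lemma 2 (p. 3)] -/
theorem pf_of_reachable_sOfS (T : Finset (Site 2)) (b : Bool) {F : HexVertex}
    (h : (sideGraph (PhiS D g o T)).Reachable (sOfS D g o T) F) : PF D g o T b (if b then 0 else 1) F := by
  classical
  rw [SimpleGraph.reachable_iff_reflTransGen] at h
  induction h with
  | refl => exact pf_sOfS hd0 T b
  | @tail F₁ F₂ _ h12 ih =>
    by_cases hFs : F₂ = sOfS D g o T
    · rw [hFs]; exact pf_sOfS hd0 T b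
    · exact pf_step hd0 hxx hex T b _ ih h12 hFs

/-- the face invariant on the component of a corner that does not contain the split face. [cite: KhristoforovSmirnov2021, §1.2 Lemma 2 (p. 3)] -/
theorem pf_of_reachable_corner (T : Finset (Site 2)) (b : Bool) {a : Fin 5} (ha : D.pos a ≠ mOfS D g o T)
    (hns : ¬ (sideGraph (PhiS D g o T)).Reachable (yc D a) (sOfS D g o T)) {F : HexVertex}
    (h : (sideGraph (PhiS D g o T)).Reachable (yc D a) F) : PF D g o T b (cornerBlk D (mOfS D g o T) a b) F := by
  classical
  rw [SimpleGraph.reachable_iff_reflTransGen] at h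
  induction h with
  | refl => exact pf_corner hd0 T b ha
  | @tail F₁ F₂ h1 h12 ih =>
    have hFs : F₂ ≠ sOfS D g o T := by
      rintro rfl
      exact hns ((SimpleGraph.reachable_iff_reflTransGen _ _).2 (h1.tail h12))
    exact pf_step hd0 hxx hex T b _ ih h12 hFs

omit hxx hex in
/-- a corner other than the split face has a side in `Φ(σ)` (it is odd). [cite: KhristoforovSmirnov2021, §1.2 Lemma 2 (p. 3)] -/
theorem exists_side_corner (T : Finset (Site 2)) {a : Fin 5} (hne : yc D a ≠ sOfS D g o T) :
    ∃ j : Fin 3, side (yc D a) j ∈ PhiS D g o T := by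
  classical
  have hpar := ((mem_loopSpace6b (D := D)).1 (PhiS_mem hd0 T)).2 (yc D a) (yc_mem_touching D a)
  have hodd : Odd (xiDeg (PhiS D g o T) (yc D a)) := hpar.2 (Or.inl ⟨⟨a, yc_spec D a⟩, hne⟩)
  by_contra hno
  push Not at hno
  rw [l1_xiDeg_eq, Finset.filter_eq_empty_iff.2 (fun j _ => hno j), Finset.card_empty] at hodd
  exact absurd hodd (by decide)

/-- ★ **THE SIDE CHAIN FROM `z`**: if the strand of `Φ(σ)` from the disorder at `z` ends at the corner `y_a`, then the block of colour
`b` at the split is joined through colour `b` to the block of colour `b` at `y_a` (`b = true`: the blue cells on one side of the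
interface; `b = false`: the yellow cells on the other side). [cite: KhristoforovSmirnov2021, §1.2 Lemma 2, proof (arXiv v1 p. 3): «∂_{u₁u₂}Ω ↔ ∂_{u₃u₄}Ω in σ if and only if [u₁u₄|u₂u₃] in ξ(σ)»] -/
theorem sconn_split_corner (T : Finset (Site 2)) (b : Bool) {a : Fin 5} (ha : D.pos a ≠ mOfS D g o T)
    (h : (sideGraph (PhiS D g o T)).Reachable (sOfS D g o T) (yc D a)) (hne : yc D a ≠ sOfS D g o T) :
    SConn D (mOfS D g o T) T b (if b then 0 else 1) (cornerBlk D (mOfS D g o T) a b) :=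
  sconn_of_pf_corner hd0 ha (pf_of_reachable_sOfS hd0 hxx hex T b h) (exists_side_corner hd0 T hne)

/-- ★ **THE SIDE CHAIN BETWEEN TWO CORNERS**: if the corners `y_a`, `y_c` are linked in `Φ(σ)` (their component avoiding the split face),
the blocks of colour `b` at the two corners are joined through colour `b`. [cite: KhristoforovSmirnov2021, §1.2 Lemma 2 (p. 3)] -/
theorem sconn_corner_corner (T : Finset (Site 2)) (b : Bool) {a c : Fin 5} (ha : D.pos a ≠ mOfS D g o T)
    (hc : D.pos c ≠ mOfS D g o T) (hns : ¬ (sideGraph (PhiS D g o T)).Reachable (yc D a) (sOfS D g o T))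
    (h : (sideGraph (PhiS D g o T)).Reachable (yc D a) (yc D c)) (hne : yc D c ≠ sOfS D g o T) :
    SConn D (mOfS D g o T) T b (cornerBlk D (mOfS D g o T) a b) (cornerBlk D (mOfS D g o T) c b) :=
  sconn_of_pf_corner hd0 hc (pf_of_reachable_corner hd0 hxx hex T b ha hns h) (exists_side_corner hd0 T hne)

/-- **the strands from two linked corners avoid the split face** (a component of `Φ(σ)` has at most two odd faces; a corner split
face is isolated). [cite: KhristoforovSmirnov2021, §1.2 (pp. 2–3)] -/
theorem not_reachable_sOfS (T : Finset (Site 2)) {a c : Fin 5} (hac : a ≠ c)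
    (h : (sideGraph (PhiS D g o T)).Reachable (yc D a) (yc D c)) (haS : yc D a ≠ sOfS D g o T) (hcS : yc D c ≠ sOfS D g o T) :
    ¬ (sideGraph (PhiS D g o T)).Reachable (yc D a) (sOfS D g o T) := by
  classical
  intro hr
  have hg := (stretch_zero_facts hd0).2.1
  have hmem := PhiS_mem hd0 T
  have hs := sOfS_mem_pair hd0 hxx hex T
  rw [Finset.mem_insert, Finset.mem_singleton] at hs
  by_cases hsC : ∃ k, IsCornerFace D k (sOfS D g o T)
  · obtain ⟨k, hk⟩ := hsC
    have hiso : ∀ F, (sideGraph (PhiS D g o T)).Reachable (sOfS D g o T) F → F = sOfS D g o T := by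
      rcases hs with e | e
      · rw [e] at hmem hk ⊢
        exact cornerEnd_isolated_of_mem hxx hex hg hk hmem
      · rw [e] at hmem hk ⊢
        exact cornerEnd_isolated_of_mem hxx.symm (by rw [faceEdge_comm]; exact hex) hg hk hmem
    exact haS (hiso _ hr.symm)
  · obtain ⟨hsub, hpar⟩ := (mem_loopSpace6b (D := D)).1 hmem
    have hsubB : PhiS D g o T ⊆ hBonds D := fun e he' => Finset.mem_of_mem_erase (hsub he')
    have hdeg := xiDeg_PhiS_le_two hd0 hxx hex T
    have hoa : Odd (xiDeg (PhiS D g o T) (yc D a)) := (hpar _ (yc_mem_touching D a)).2 (Or.inl ⟨⟨a, yc_spec D a⟩, haS⟩)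
    have hoc : Odd (xiDeg (PhiS D g o T) (yc D c)) := (hpar _ (yc_mem_touching D c)).2 (Or.inl ⟨⟨c, yc_spec D c⟩, hcS⟩)
    have hos : Odd (xiDeg (PhiS D g o T) (sOfS D g o T)) := (hpar _ (sOfS_touching hd0 T)).2 (Or.inr ⟨rfl, hsC⟩)
    obtain ⟨-, huniq⟩ := odd_component D hsubB hdeg (yc_mem_touching D a) hoa
    have := huniq _ _ h hr hoc hos (fun e => hac (yc_injective D e).symm) haS.symm
    exact hcS this

end S

end Corners

section Events

variable {D : TriMarkedDomain 5}

/-! ### crossing events and their exclusivity -/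

/-- **`X ↔ Y` in colour `b`**: a path of colour-`b` sites of `G` from a hexagon of `X` to a hexagon of `Y` (Khristoforov–Smirnov's
`X ↔ Y`). [cite: KhristoforovSmirnov2021, §1.1 (arXiv v1 p. 2: «there is a σ-blue path between two sets X and Y»)] -/
def Cross (D : TriMarkedDomain 5) (T : Finset (Site 2)) (b : Bool) (X Y : Finset (Site 2)) : Prop :=
  ∃ a ∈ X, ∃ c ∈ Y, PathIn triGraph (cset D T b) a c

/-- «at least two of three». [cite: KhristoforovSmirnov2021, §1.2 Lemma 2 (p. 3)] -/
def TwoOf (P Q R : Prop) : Prop := (P ∧ Q) ∨ (Q ∧ R) ∨ (R ∧ P)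

/-- **the connectivity event of the class `(r, M)` at a mid-edge `z` of `A₀`** (blue = open on `∂_{y₀z}, A₁, A₃`, yellow = closed on
`∂_{zy₁}, A₂, A₄`; the five non-crossing partitions of the three blue arcs): `(1,A)` = the three blue arcs joined (at least two of the
three direct crossings), `(1,B)` = `∂_{y₀z} ↔ A₁` open and `A₂ ↔ A₄` closed, `(0,A)` = the three yellow arcs joined, `(0,B)` =
`∂_{zy₁} ↔ A₄` closed and `A₁ ↔ A₃` open, `(3,A)` = `∂_{y₀z} ↔ A₃` open and `∂_{zy₁} ↔ A₂` closed; `False` for the classes that do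
not occur on `A₀`. [cite: KhristoforovSmirnov2021, §1.2 Lemma 2 (pp. 2–3)] -/
def Ev (D : TriMarkedDomain 5) (g o : Site 2) (r : Fin 5) (mb : Bool) (T : Finset (Site 2)) : Prop :=
  if r = 1 ∧ mb = false then
    TwoOf (Cross D T true (arcP0 D g o) (D.arc 1)) (Cross D T true (D.arc 1) (D.arc 3)) (Cross D T true (D.arc 3) (arcP0 D g o))
  else if r = 1 ∧ mb = true then Cross D T true (arcP0 D g o) (D.arc 1) ∧ Cross D T false (D.arc 2) (D.arc 4)
  else if r = 0 ∧ mb = false then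
    TwoOf (Cross D T false (arcP1 D g o) (D.arc 2)) (Cross D T false (D.arc 2) (D.arc 4)) (Cross D T false (D.arc 4) (arcP1 D g o))
  else if r = 0 ∧ mb = true then Cross D T false (arcP1 D g o) (D.arc 4) ∧ Cross D T true (D.arc 1) (D.arc 3)
  else if r = 3 ∧ mb = false then Cross D T true (arcP0 D g o) (D.arc 3) ∧ Cross D T false (arcP1 D g o) (D.arc 2)
  else False

/-- `Cross` is symmetric. [cite: KhristoforovSmirnov2021, §1.2 Lemma 2 (p. 3)] -/
theorem cross_symm {T : Finset (Site 2)} {b : Bool} {X Y : Finset (Site 2)} (h : Cross D T b X Y) : Cross D T b Y X := by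
  obtain ⟨a, ha, c, hc, hP⟩ := h
  exact ⟨c, hc, a, ha, hP.symm⟩

/-- a direct connection of blocks is a crossing between sets containing them. [cite: KhristoforovSmirnov2021, §1.2 Lemma 2 (p. 3)] -/
theorem cross_of_dconn {m : ℕ} {T : Finset (Site 2)} {b : Bool} {q q' : ℕ} {X Y : Finset (Site 2)} (h : DConn D m T b q q')
    (hX : bsites D m q ⊆ X) (hY : bsites D m q' ⊆ Y) : Cross D T b X Y := by
  obtain ⟨a, ha, c, hc, hP⟩ := h
  exact ⟨a, hX ha, c, hY hc, hP⟩

/-- the target block of a direct connection is a genuine block (`< 6`). [cite: KhristoforovSmirnov2021, §1.2 Lemma 2 (p. 3)] -/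
theorem lt_six_of_dconn {m : ℕ} {T : Finset (Site 2)} {b : Bool} {q q' : ℕ} (h : DConn D m T b q q') : q' < 6 := by
  obtain ⟨-, -, c, hc, -⟩ := h
  obtain ⟨n, -, hb, -⟩ := exists_of_mem_bsites hc
  rw [← hb]; exact blk_lt_six m n

/-- parities agree for two blocks of the same colour. [folklore] -/
private theorem mod_two_eq_of_col {x y : ℕ} {b : Bool} (hx : decide (x % 2 = 0) = b) (hy : decide (y % 2 = 0) = b) : x % 2 = y % 2 := by
  revert hx hy
  cases b <;> simp <;> omega

/-- **unwinding a chain of blocks**: with three blocks of each colour, a chain from `q₀` to `q` is trivial, direct, or passes through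
the third block of that colour. [cite: KhristoforovSmirnov2021, §1.2 Lemma 2 (p. 3)] -/
theorem sconn_cases {m : ℕ} {T : Finset (Site 2)} {b : Bool} {q₀ q : ℕ} (h : SConn D m T b q₀ q)
    (hq₀c : decide (q₀ % 2 = 0) = b) (hq₀6 : q₀ < 6) :
    q = q₀ ∨ (q ≠ q₀ ∧ q < 6 ∧ decide (q % 2 = 0) = b ∧ DConn D m T b q₀ q) ∨
      ∃ r, r ≠ q₀ ∧ r ≠ q ∧ q ≠ q₀ ∧ r < 6 ∧ q < 6 ∧ decide (r % 2 = 0) = b ∧ decide (q % 2 = 0) = b ∧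
        DConn D m T b q₀ r ∧ DConn D m T b r q := by
  unfold SConn at h
  induction h with
  | refl => exact Or.inl rfl
  | @tail q q' _ hstep ih =>
    obtain ⟨hq'c, hD⟩ := hstep
    have hq'6 : q' < 6 := lt_six_of_dconn hD
    by_cases h0 : q' = q₀
    · exact Or.inl h0
    rcases ih with rfl | ⟨hne, hq6, hqc, hD0⟩ | ⟨r, hr0, hrq, hq0, hr6, hq6, hrc, hqc, hD1, hD2⟩
    · exact Or.inr (Or.inl ⟨h0, hq'6, hq'c, hD⟩)
    · by_cases h1 : q' = q
      · subst h1; exact Or.inr (Or.inl ⟨hne, hq6, hqc, hD0⟩)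
      · exact Or.inr (Or.inr ⟨q, hne, Ne.symm h1, h0, hq6, hq'6, hqc, hq'c, hD0, hD⟩)
    · have e1 := mod_two_eq_of_col hq₀c hrc
      have e2 := mod_two_eq_of_col hrc hqc
      have e3 := mod_two_eq_of_col hqc hq'c
      have hcases : q' = r ∨ q' = q := by omega
      rcases hcases with rfl | rfl
      · exact Or.inr (Or.inl ⟨hr0, hr6, hrc, hD1⟩)
      · exact Or.inr (Or.inr ⟨r, hr0, hrq, hq0, hr6, hq6, hrc, hqc, hD1, hD2⟩)

/-- the colour of an even block. [folklore] -/
private theorem even_of_col {r : ℕ} (h : decide (r % 2 = 0) = true) : r % 2 = 0 := of_decide_eq_true h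

/-- the colour of an odd block. [folklore] -/
private theorem odd_of_col {r : ℕ} (h : decide (r % 2 = 0) = false) : r % 2 = 1 := by
  have := (decide_eq_false_iff_not).1 h; omega

section NI

variable {g o : Site 2} (hd0 : (g, o) ∈ D.stretch 0)
include hd0

omit hd0 in
/-- **interleaved crossings of opposite colours do not coexist** (the tree's `IsTriDisc.not_interleaved` for positions
`n₁ ≤ n₂ < n₃ < n₄`; equal first positions clash in colour). [cite: BollobasRiordan2006, Ch. 7 Lemma 5 p. 193] -/
theorem not_cross_of_le {T : Finset (Site 2)} {b : Bool} {n₁ n₂ n₃ n₄ : ℕ} (h12 : n₁ ≤ n₂) (h23 : n₂ < n₃) (h34 : n₃ < n₄)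
    (h4 : n₄ < #(triBdryDarts D.verts)) (hP : PathIn triGraph (cset D T b) (bdart D n₁).1 (bdart D n₃).1)
    (hQ : PathIn triGraph (cset D T (!b)) (bdart D n₂).1 (bdart D n₄).1) : False := by
  rcases h12.lt_or_eq with hlt | heq
  · cases b
    · rw [cset_false] at hP
      rw [Bool.not_false, cset_true] at hQ
      have hQ' : PathIn triGraph ((D.verts : Set (Site 2)) ∩ ((↑T : Set (Site 2))ᶜ)ᶜ) (bdart D n₂).1 (bdart D n₄).1 := by
        rw [compl_compl]; exact hQ
      exact D.isTriDisc.not_interleaved _ hlt h23 h34 h4 hP hQ'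
    · rw [cset_true] at hP
      rw [Bool.not_true, cset_false] at hQ
      exact D.isTriDisc.not_interleaved _ hlt h23 h34 h4 hP hQ
  · subst heq
    have h1 := hP.left_mem
    have h2 := hQ.left_mem
    unfold cset at h1 h2
    rw [Set.mem_setOf_eq] at h1 h2
    have := h1.2.symm.trans h2.2
    cases b <;> simp at this

omit hd0 in
/-- positions of a crossing between `∂_{y₀ z}` and an arc `A_i`, `i ≠ 0`. [folklore] -/
private theorem pos_of_cross_P0 {T : Finset (Site 2)} {b : Bool} {i : Fin 5} (h : Cross D T b (arcP0 D g o) (D.arc i)) :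
    ∃ n₁ n₃, n₁ ≤ D.dpos (g, o) ∧ D.pos i ≤ n₃ ∧ n₃ < D.nextPos i ∧ PathIn triGraph (cset D T b) (bdart D n₁).1 (bdart D n₃).1 := by
  obtain ⟨a, ha, c, hc, hP⟩ := h
  obtain ⟨n₁, hn₁, rfl⟩ := exists_of_mem_arcP0 ha
  obtain ⟨n₃, h3a, h3b, rfl⟩ := D.mem_arc_iff.1 hc
  exact ⟨n₁, n₃, hn₁, h3a, h3b, hP⟩

omit hd0 in
/-- positions of a crossing between `∂_{z y₁}` and an arc `A_i`. [folklore] -/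
private theorem pos_of_cross_P1 {T : Finset (Site 2)} {b : Bool} {i : Fin 5} (h : Cross D T b (arcP1 D g o) (D.arc i)) :
    ∃ n₁ n₃, D.dpos (g, o) ≤ n₁ ∧ n₁ < D.pos 1 ∧ D.pos i ≤ n₃ ∧ n₃ < D.nextPos i ∧
      PathIn triGraph (cset D T b) (bdart D n₁).1 (bdart D n₃).1 := by
  obtain ⟨a, ha, c, hc, hP⟩ := h
  obtain ⟨n₁, hn₁, hn₁', rfl⟩ := exists_of_mem_arcP1 ha
  obtain ⟨n₃, h3a, h3b, rfl⟩ := D.mem_arc_iff.1 hc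
  exact ⟨n₁, n₃, hn₁, hn₁', h3a, h3b, hP⟩

omit hd0 in
/-- positions of a crossing between two arcs. [folklore] -/
private theorem pos_of_cross_arc {T : Finset (Site 2)} {b : Bool} {i j : Fin 5} (h : Cross D T b (D.arc i) (D.arc j)) :
    ∃ n₁ n₃, D.pos i ≤ n₁ ∧ n₁ < D.nextPos i ∧ D.pos j ≤ n₃ ∧ n₃ < D.nextPos j ∧
      PathIn triGraph (cset D T b) (bdart D n₁).1 (bdart D n₃).1 := by
  obtain ⟨a, ha, c, hc, hP⟩ := h
  obtain ⟨n₁, h1a, h1b, rfl⟩ := D.mem_arc_iff.1 ha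
  obtain ⟨n₃, h3a, h3b, rfl⟩ := D.mem_arc_iff.1 hc
  exact ⟨n₁, n₃, h1a, h1b, h3a, h3b, hP⟩

omit hd0 in
/-- the `nextPos` values. [folklore] -/
private theorem nextPos_vals : D.nextPos 1 = D.pos 2 ∧ D.nextPos 2 = D.pos 3 ∧ D.nextPos 3 = D.pos 4 ∧ D.nextPos 4 = #(triBdryDarts D.verts) :=
  ⟨nextPos_of_lt D 1 (by decide), nextPos_of_lt D 2 (by decide), nextPos_of_lt D 3 (by decide), nextPos_four D⟩

/-- (i) `∂_{y₀z} ↔ A₁` open and `∂_{zy₁} ↔ A₄` closed do not coexist. [cite: BollobasRiordan2006, Ch. 7 Lemma 5 p. 193] -/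
theorem not_B01_Y41 {T : Finset (Site 2)} (h1 : Cross D T true (arcP0 D g o) (D.arc 1)) (h2 : Cross D T false (arcP1 D g o) (D.arc 4)) :
    False := by
  obtain ⟨-, -, -, -, -, hp1⟩ := stretch_zero_facts hd0
  obtain ⟨h00, h01, h12, h23, h34, h4L⟩ := pos_facts D
  obtain ⟨e1, e2, e3, e4⟩ := nextPos_vals (D := D)
  obtain ⟨n₁, n₃, a1, a3, b3, hP⟩ := pos_of_cross_P0 h1
  obtain ⟨n₂, n₄, a2, b2, a4, b4, hQ⟩ := pos_of_cross_P1 h2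
  rw [e1] at b3; rw [e4] at b4
  exact not_cross_of_le (b := true) (by omega) (by omega) (by omega) b4 hP hQ

/-- (ii) `∂_{y₀z} ↔ A₃` open and `∂_{zy₁} ↔ A₄` closed do not coexist. [cite: BollobasRiordan2006, Ch. 7 Lemma 5 p. 193] -/
theorem not_B03_Y41 {T : Finset (Site 2)} (h1 : Cross D T true (arcP0 D g o) (D.arc 3)) (h2 : Cross D T false (arcP1 D g o) (D.arc 4)) :
    False := by
  obtain ⟨-, -, -, -, -, hp1⟩ := stretch_zero_facts hd0
  obtain ⟨h00, h01, h12, h23, h34, h4L⟩ := pos_facts D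
  obtain ⟨e1, e2, e3, e4⟩ := nextPos_vals (D := D)
  obtain ⟨n₁, n₃, a1, a3, b3, hP⟩ := pos_of_cross_P0 h1
  obtain ⟨n₂, n₄, a2, b2, a4, b4, hQ⟩ := pos_of_cross_P1 h2
  rw [e3] at b3; rw [e4] at b4
  exact not_cross_of_le (b := true) (by omega) (by omega) (by omega) b4 hP hQ

omit hd0 in
/-- (iii) `A₁ ↔ A₃` open and `A₂ ↔ A₄` closed do not coexist. [cite: BollobasRiordan2006, Ch. 7 Lemma 5 p. 193] -/
theorem not_B13_Y24 {T : Finset (Site 2)} (h1 : Cross D T true (D.arc 1) (D.arc 3)) (h2 : Cross D T false (D.arc 2) (D.arc 4)) :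
    False := by
  obtain ⟨h00, h01, h12, h23, h34, h4L⟩ := pos_facts D
  obtain ⟨e1, e2, e3, e4⟩ := nextPos_vals (D := D)
  obtain ⟨n₁, n₃, a1, b1, a3, b3, hP⟩ := pos_of_cross_arc h1
  obtain ⟨n₂, n₄, a2, b2, a4, b4, hQ⟩ := pos_of_cross_arc h2
  rw [e1] at b1; rw [e3] at b3; rw [e2] at b2; rw [e4] at b4
  exact not_cross_of_le (b := true) (by omega) (by omega) (by omega) b4 hP hQ

/-- (iv) `∂_{y₀z} ↔ A₃` open and `A₂ ↔ A₄` closed do not coexist. [cite: BollobasRiordan2006, Ch. 7 Lemma 5 p. 193] -/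
theorem not_B03_Y24 {T : Finset (Site 2)} (h1 : Cross D T true (arcP0 D g o) (D.arc 3)) (h2 : Cross D T false (D.arc 2) (D.arc 4)) :
    False := by
  obtain ⟨-, -, -, -, -, hp1⟩ := stretch_zero_facts hd0
  obtain ⟨h00, h01, h12, h23, h34, h4L⟩ := pos_facts D
  obtain ⟨e1, e2, e3, e4⟩ := nextPos_vals (D := D)
  obtain ⟨n₁, n₃, a1, a3, b3, hP⟩ := pos_of_cross_P0 h1
  obtain ⟨n₂, n₄, a2, b2, a4, b4, hQ⟩ := pos_of_cross_arc h2
  rw [e3] at b3; rw [e2] at b2; rw [e4] at b4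
  exact not_cross_of_le (b := true) (by omega) (by omega) (by omega) b4 hP hQ

/-- (v) `A₁ ↔ A₃` open and `∂_{zy₁} ↔ A₂` closed do not coexist. [cite: BollobasRiordan2006, Ch. 7 Lemma 5 p. 193] -/
theorem not_B13_Y12 {T : Finset (Site 2)} (h1 : Cross D T true (D.arc 1) (D.arc 3)) (h2 : Cross D T false (arcP1 D g o) (D.arc 2)) :
    False := by
  obtain ⟨-, -, -, -, -, hp1⟩ := stretch_zero_facts hd0
  obtain ⟨h00, h01, h12, h23, h34, h4L⟩ := pos_facts D
  obtain ⟨e1, e2, e3, e4⟩ := nextPos_vals (D := D)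
  obtain ⟨n₁, n₃, a1, b1, a3, b3, hP⟩ := pos_of_cross_arc h1
  obtain ⟨n₂, n₄, a2, b2, a4, b4, hQ⟩ := pos_of_cross_P1 h2
  rw [e1] at b1; rw [e3] at b3; rw [e2] at b4
  -- the yellow path comes first: positions n₂ < n₁ < n₄ < n₃
  exact not_cross_of_le (b := false) (n₁ := n₂) (n₂ := n₁) (n₃ := n₄) (n₄ := n₃) (by omega) (by omega) (by omega) (by omega) hQ hP

/-- (vi) `∂_{y₀z} ↔ A₁` open and `∂_{zy₁} ↔ A₂` closed do not coexist. [cite: BollobasRiordan2006, Ch. 7 Lemma 5 p. 193] -/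
theorem not_B01_Y12 {T : Finset (Site 2)} (h1 : Cross D T true (arcP0 D g o) (D.arc 1)) (h2 : Cross D T false (arcP1 D g o) (D.arc 2)) :
    False := by
  obtain ⟨-, -, -, -, -, hp1⟩ := stretch_zero_facts hd0
  obtain ⟨h00, h01, h12, h23, h34, h4L⟩ := pos_facts D
  obtain ⟨e1, e2, e3, e4⟩ := nextPos_vals (D := D)
  obtain ⟨n₁, n₃, a1, a3, b3, hP⟩ := pos_of_cross_P0 h1
  obtain ⟨n₂, n₄, a2, b2, a4, b4, hQ⟩ := pos_of_cross_P1 h2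
  rw [e1] at b3; rw [e2] at b4
  exact not_cross_of_le (b := true) (by omega) (by omega) (by omega) (by omega) hP hQ

/-- ★ **THE FIVE EVENTS ARE PAIRWISE EXCLUSIVE** (each pair contains an interleaved blue/yellow pair of crossings).
[cite: BollobasRiordan2006, Ch. 7 Lemma 5 p. 193] -/
theorem ev_excl {T : Finset (Site 2)} {r r' : Fin 5} {mb mb' : Bool} (h : Ev D g o r mb T) (h' : Ev D g o r' mb' T) :
    r = r' ∧ mb = mb' := by
  -- unpack the two events
  have key : ∀ (r : Fin 5) (mb : Bool), Ev D g o r mb T →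
      (r = 1 ∧ mb = false ∧ TwoOf (Cross D T true (arcP0 D g o) (D.arc 1)) (Cross D T true (D.arc 1) (D.arc 3))
          (Cross D T true (D.arc 3) (arcP0 D g o))) ∨
      (r = 1 ∧ mb = true ∧ Cross D T true (arcP0 D g o) (D.arc 1) ∧ Cross D T false (D.arc 2) (D.arc 4)) ∨
      (r = 0 ∧ mb = false ∧ TwoOf (Cross D T false (arcP1 D g o) (D.arc 2)) (Cross D T false (D.arc 2) (D.arc 4))
          (Cross D T false (D.arc 4) (arcP1 D g o))) ∨
      (r = 0 ∧ mb = true ∧ Cross D T false (arcP1 D g o) (D.arc 4) ∧ Cross D T true (D.arc 1) (D.arc 3)) ∨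
      (r = 3 ∧ mb = false ∧ Cross D T true (arcP0 D g o) (D.arc 3) ∧ Cross D T false (arcP1 D g o) (D.arc 2)) := by
    intro r mb h
    unfold Ev at h
    split_ifs at h with h1 h2 h3 h4 h5
    · exact Or.inl ⟨h1.1, h1.2, h⟩
    · exact Or.inr (Or.inl ⟨h2.1, h2.2, h⟩)
    · exact Or.inr (Or.inr (Or.inl ⟨h3.1, h3.2, h⟩))
    · exact Or.inr (Or.inr (Or.inr (Or.inl ⟨h4.1, h4.2, h⟩)))
    · exact Or.inr (Or.inr (Or.inr (Or.inr ⟨h5.1, h5.2, h⟩)))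
  have B01_Y41 := fun (a : Cross D T true (arcP0 D g o) (D.arc 1)) (c : Cross D T false (arcP1 D g o) (D.arc 4)) =>
    not_B01_Y41 hd0 a c
  have B03_Y41 := fun (a : Cross D T true (arcP0 D g o) (D.arc 3)) (c : Cross D T false (arcP1 D g o) (D.arc 4)) =>
    not_B03_Y41 hd0 a c
  have B13_Y24 := fun (a : Cross D T true (D.arc 1) (D.arc 3)) (c : Cross D T false (D.arc 2) (D.arc 4)) => not_B13_Y24 a c
  have B03_Y24 := fun (a : Cross D T true (arcP0 D g o) (D.arc 3)) (c : Cross D T false (D.arc 2) (D.arc 4)) => not_B03_Y24 hd0 a c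
  have B13_Y12 := fun (a : Cross D T true (D.arc 1) (D.arc 3)) (c : Cross D T false (arcP1 D g o) (D.arc 2)) => not_B13_Y12 hd0 a c
  have B01_Y12 := fun (a : Cross D T true (arcP0 D g o) (D.arc 1)) (c : Cross D T false (arcP1 D g o) (D.arc 2)) => not_B01_Y12 hd0 a c
  unfold TwoOf at key
  rcases key r mb h with ⟨rfl, rfl, hA⟩ | ⟨rfl, rfl, hB1, hB2⟩ | ⟨rfl, rfl, hC⟩ | ⟨rfl, rfl, hD1, hD2⟩ | ⟨rfl, rfl, hE1, hE2⟩ <;>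
    rcases key r' mb' h' with ⟨rfl, rfl, hA'⟩ | ⟨rfl, rfl, hB1', hB2'⟩ | ⟨rfl, rfl, hC'⟩ | ⟨rfl, rfl, hD1', hD2'⟩ | ⟨rfl, rfl, hE1', hE2'⟩
  all_goals first
    | exact ⟨rfl, rfl⟩
    | exfalso
  -- (1A) vs (1B)
  · rcases hA with ⟨-, x⟩ | ⟨x, -⟩ | ⟨x, -⟩
    · exact B13_Y24 x hB2'
    · exact B13_Y24 x hB2'
    · exact B03_Y24 (cross_symm x) hB2'
  -- (1A) vs (0A)
  · rcases hA with ⟨-, x⟩ | ⟨x, -⟩ | ⟨x, y⟩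
    · rcases hC' with ⟨u, -⟩ | ⟨u, -⟩ | ⟨-, u⟩
      · exact B13_Y12 x u
      · exact B13_Y24 x u
      · exact B13_Y12 x u
    · rcases hC' with ⟨u, -⟩ | ⟨u, -⟩ | ⟨-, u⟩
      · exact B13_Y12 x u
      · exact B13_Y24 x u
      · exact B13_Y12 x u
    · rcases hC' with ⟨-, u⟩ | ⟨-, u⟩ | ⟨u, -⟩
      · exact B03_Y24 (cross_symm x) u
      · exact B03_Y41 (cross_symm x) (cross_symm u)
      · exact B01_Y41 y (cross_symm u)
  -- (1A) vs (0B)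
  · rcases hA with ⟨x, -⟩ | ⟨-, x⟩ | ⟨x, -⟩
    · exact B01_Y41 x hD1'
    · exact B03_Y41 (cross_symm x) hD1'
    · exact B03_Y41 (cross_symm x) hD1'
  -- (1A) vs (3A)
  · rcases hA with ⟨-, x⟩ | ⟨x, -⟩ | ⟨-, x⟩
    · exact B13_Y12 x hE2'
    · exact B13_Y12 x hE2'
    · exact B01_Y12 x hE2'
  -- (1B) vs (1A)
  · rcases hA' with ⟨-, x⟩ | ⟨x, -⟩ | ⟨x, -⟩
    · exact B13_Y24 x hB2
    · exact B13_Y24 x hB2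
    · exact B03_Y24 (cross_symm x) hB2
  -- (1B) vs (0A)
  · rcases hC' with ⟨u, -⟩ | ⟨-, u⟩ | ⟨u, -⟩
    · exact B01_Y12 hB1 u
    · exact B01_Y41 hB1 (cross_symm u)
    · exact B01_Y41 hB1 (cross_symm u)
  -- (1B) vs (0B)
  · exact B01_Y41 hB1 hD1'
  -- (1B) vs (3A)
  · exact B01_Y12 hB1 hE2'
  -- (0A) vs (1A)
  · rcases hA' with ⟨-, x⟩ | ⟨x, -⟩ | ⟨x, y⟩
    · rcases hC with ⟨u, -⟩ | ⟨u, -⟩ | ⟨-, u⟩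
      · exact B13_Y12 x u
      · exact B13_Y24 x u
      · exact B13_Y12 x u
    · rcases hC with ⟨u, -⟩ | ⟨u, -⟩ | ⟨-, u⟩
      · exact B13_Y12 x u
      · exact B13_Y24 x u
      · exact B13_Y12 x u
    · rcases hC with ⟨-, u⟩ | ⟨-, u⟩ | ⟨u, -⟩
      · exact B03_Y24 (cross_symm x) u
      · exact B03_Y41 (cross_symm x) (cross_symm u)
      · exact B01_Y41 y (cross_symm u)
  -- (0A) vs (1B)
  · rcases hC with ⟨u, -⟩ | ⟨-, u⟩ | ⟨u, -⟩
    · exact B01_Y12 hB1' u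
    · exact B01_Y41 hB1' (cross_symm u)
    · exact B01_Y41 hB1' (cross_symm u)
  -- (0A) vs (0B)
  · rcases hC with ⟨u, -⟩ | ⟨u, -⟩ | ⟨-, u⟩
    · exact B13_Y12 hD2' u
    · exact B13_Y24 hD2' u
    · exact B13_Y12 hD2' u
  -- (0A) vs (3A)
  · rcases hC with ⟨-, u⟩ | ⟨u, -⟩ | ⟨u, -⟩
    · exact B03_Y24 hE1' u
    · exact B03_Y24 hE1' u
    · exact B03_Y41 hE1' (cross_symm u)
  -- (0B) vs (1A)
  · rcases hA' with ⟨x, -⟩ | ⟨-, x⟩ | ⟨x, -⟩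
    · exact B01_Y41 x hD1
    · exact B03_Y41 (cross_symm x) hD1
    · exact B03_Y41 (cross_symm x) hD1
  -- (0B) vs (1B)
  · exact B01_Y41 hB1' hD1
  -- (0B) vs (0A)
  · rcases hC' with ⟨u, -⟩ | ⟨u, -⟩ | ⟨-, u⟩
    · exact B13_Y12 hD2 u
    · exact B13_Y24 hD2 u
    · exact B13_Y12 hD2 u
  -- (0B) vs (3A)
  · exact B13_Y12 hD2 hE2'
  -- (3A) vs (1A)
  · rcases hA' with ⟨-, x⟩ | ⟨x, -⟩ | ⟨-, x⟩
    · exact B13_Y12 x hE2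
    · exact B13_Y12 x hE2
    · exact B01_Y12 x hE2
  -- (3A) vs (1B)
  · exact B01_Y12 hB1' hE2
  -- (3A) vs (0A)
  · rcases hC' with ⟨-, u⟩ | ⟨u, -⟩ | ⟨u, -⟩
    · exact B03_Y24 hE1 u
    · exact B03_Y24 hE1 u
    · exact B03_Y41 hE1 (cross_symm u)
  -- (3A) vs (0B)
  · exact B13_Y12 hD2' hE2

end NI

end Events

section Dictionary

variable {D : TriMarkedDomain 5}

/-! ### block values at the corners -/

/-- the marked dart of `a ≠ 0` opens the block `a + 1`. [cite: KhristoforovSmirnov2021, §1.2 Lemma 2 (p. 3)] -/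
theorem blk_pos (m : ℕ) {a : Fin 5} (ha : a ≠ 0) : blk D m (D.pos a) = a.val + 1 := by
  have hlt := D.pos_lt a
  exact (blk_eq_succ_iff ha).2 (posIdx_unique D (by rw [Nat.mod_eq_of_lt hlt]) (by rw [Nat.mod_eq_of_lt hlt]; exact D.pos_lt_nextPos a))

/-- the dart before the mark `2` lies in the block `2`. [cite: KhristoforovSmirnov2021, §1.2 Lemma 2 (p. 3)] -/
theorem blk_pos_two_pred (m : ℕ) : blk D m (D.pos 2 + (#(triBdryDarts D.verts) - 1)) = 2 := by
  obtain ⟨h00, h01, h12, h23, h34, h4L⟩ := pos_facts D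
  rw [← blk_mod, show D.pos 2 + (#(triBdryDarts D.verts) - 1) = (D.pos 2 - 1) + #(triBdryDarts D.verts) by omega, Nat.add_mod_right]
  refine (blk_eq_succ_iff (i := 1) (by decide)).2 (posIdx_unique D ?_ ?_)
  · rw [Nat.mod_mod, Nat.mod_eq_of_lt (by omega)]; show D.pos 1 ≤ _; omega
  · rw [Nat.mod_mod, Nat.mod_eq_of_lt (by omega), nextPos_of_lt D 1 (by decide)]; show _ < D.pos 2; omega

/-- the dart before the mark `3` lies in the block `3`. [cite: KhristoforovSmirnov2021, §1.2 Lemma 2 (p. 3)] -/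
theorem blk_pos_three_pred (m : ℕ) : blk D m (D.pos 3 + (#(triBdryDarts D.verts) - 1)) = 3 := by
  obtain ⟨h00, h01, h12, h23, h34, h4L⟩ := pos_facts D
  rw [← blk_mod, show D.pos 3 + (#(triBdryDarts D.verts) - 1) = (D.pos 3 - 1) + #(triBdryDarts D.verts) by omega, Nat.add_mod_right]
  refine (blk_eq_succ_iff (i := 2) (by decide)).2 (posIdx_unique D ?_ ?_)
  · rw [Nat.mod_mod, Nat.mod_eq_of_lt (by omega)]; show D.pos 2 ≤ _; omega
  · rw [Nat.mod_mod, Nat.mod_eq_of_lt (by omega), nextPos_of_lt D 2 (by decide)]; show _ < D.pos 3; omega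

/-- the dart before the mark `4` lies in the block `4`. [cite: KhristoforovSmirnov2021, §1.2 Lemma 2 (p. 3)] -/
theorem blk_pos_four_pred (m : ℕ) : blk D m (D.pos 4 + (#(triBdryDarts D.verts) - 1)) = 4 := by
  obtain ⟨h00, h01, h12, h23, h34, h4L⟩ := pos_facts D
  rw [← blk_mod, show D.pos 4 + (#(triBdryDarts D.verts) - 1) = (D.pos 4 - 1) + #(triBdryDarts D.verts) by omega, Nat.add_mod_right]
  refine (blk_eq_succ_iff (i := 3) (by decide)).2 (posIdx_unique D ?_ ?_)
  · rw [Nat.mod_mod, Nat.mod_eq_of_lt (by omega)]; show D.pos 3 ≤ _; omega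
  · rw [Nat.mod_mod, Nat.mod_eq_of_lt (by omega), nextPos_of_lt D 3 (by decide)]; show _ < D.pos 4; omega

/-- the dart before the mark `1` lies in the block `1` when the split is before it. [cite: KhristoforovSmirnov2021, §1.2 Lemma 2 (p. 3)] -/
theorem blk_pos_one_pred {m : ℕ} (hm : m < D.pos 1) : blk D m (D.pos 1 + (#(triBdryDarts D.verts) - 1)) = 1 := by
  obtain ⟨h00, h01, h12, h23, h34, h4L⟩ := pos_facts D
  rw [← blk_mod, show D.pos 1 + (#(triBdryDarts D.verts) - 1) = (D.pos 1 - 1) + #(triBdryDarts D.verts) by omega, Nat.add_mod_right]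
  refine blk_eq_one_iff.2 ⟨posIdx_zero_of_lt ?_, ?_⟩
  · rw [Nat.mod_mod, Nat.mod_eq_of_lt (by omega)]; omega
  · rw [Nat.mod_mod, Nat.mod_eq_of_lt (by omega)]; omega

/-- the marked dart of `0` opens the block `0` when the split is after it. [cite: KhristoforovSmirnov2021, §1.2 Lemma 2 (p. 3)] -/
theorem blk_pos_zero {m : ℕ} (hm : 0 < m) : blk D m (D.pos 0) = 0 := by
  obtain ⟨h00, h01, -⟩ := pos_facts D
  rw [h00]
  exact blk_eq_zero_iff.2 ⟨posIdx_zero_of_lt (by rw [Nat.zero_mod]; omega), by rw [Nat.zero_mod]; exact hm⟩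

/-- the dart before the mark `0` lies in the block `5`. [cite: KhristoforovSmirnov2021, §1.2 Lemma 2 (p. 3)] -/
theorem blk_pos_zero_pred (m : ℕ) : blk D m (D.pos 0 + (#(triBdryDarts D.verts) - 1)) = 5 := by
  rw [(pos_facts D).1, Nat.zero_add]
  exact (blk_eq_succ_iff (i := 4) (by decide)).2 posIdx_last

/-- the corner blocks at `y₁`. [cite: KhristoforovSmirnov2021, §1.2 Lemma 2 (p. 3)] -/
theorem cornerBlk_one {m : ℕ} (hm : m < D.pos 1) (b : Bool) : cornerBlk D m 1 b = if b then 2 else 1 := by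
  unfold cornerBlk
  rw [frs_eq_blk, blk_pos m (a := 1) (by decide), blk_pos_one_pred hm]
  cases b <;> decide

/-- the corner blocks at `y₂`. [cite: KhristoforovSmirnov2021, §1.2 Lemma 2 (p. 3)] -/
theorem cornerBlk_two (m : ℕ) (b : Bool) : cornerBlk D m 2 b = if b then 2 else 3 := by
  unfold cornerBlk
  rw [frs_eq_blk, blk_pos m (a := 2) (by decide), blk_pos_two_pred m]
  cases b <;> decide

/-- the corner blocks at `y₃`. [cite: KhristoforovSmirnov2021, §1.2 Lemma 2 (p. 3)] -/
theorem cornerBlk_three (m : ℕ) (b : Bool) : cornerBlk D m 3 b = if b then 4 else 3 := by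
  unfold cornerBlk
  rw [frs_eq_blk, blk_pos m (a := 3) (by decide), blk_pos_three_pred m]
  cases b <;> decide

/-- the corner blocks at `y₄`. [cite: KhristoforovSmirnov2021, §1.2 Lemma 2 (p. 3)] -/
theorem cornerBlk_four (m : ℕ) (b : Bool) : cornerBlk D m 4 b = if b then 4 else 5 := by
  unfold cornerBlk
  rw [frs_eq_blk, blk_pos m (a := 4) (by decide), blk_pos_four_pred m]
  cases b <;> decide

/-- the corner blocks at `y₀`. [cite: KhristoforovSmirnov2021, §1.2 Lemma 2 (p. 3)] -/
theorem cornerBlk_zero {m : ℕ} (hm : 0 < m) (b : Bool) : cornerBlk D m 0 b = if b then 0 else 5 := by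
  unfold cornerBlk
  rw [frs_eq_blk, blk_pos_zero hm, blk_pos_zero_pred m]
  cases b <;> decide

/-! ### the split face versus the corners -/

/-- **the corner `y_i` is the split face of the split position `pos i`.** [cite: KhristoforovSmirnov2021, §1.2 (pp. 2–3)] -/
theorem sFaceS_pos_eq_yc (i : Fin 5) : sFaceS D (D.pos i) = yc D i := by
  have hpd : bdart D (D.pos i + (#(triBdryDarts D.verts) - 1)) = predDart D i := rfl
  apply eq_yc
  unfold IsCornerFace sFaceS
  rw [hpd]
  obtain ⟨hu, hv, hadj⟩ := mem_triBdryDarts.1 (predDart_mem D i)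
  rw [hexFaceVertices_leftFace hadj, predDart_fst]
  have key := succ_predDart D i
  unfold triBdrySucc at key
  split_ifs at key with hw
  · exfalso
    have e1 : triLeftApex (predDart D i).1 (predDart D i).2 = D.markSite i := congrArg Prod.fst key
    rw [← predDart_fst D i] at e1
    exact (triGraph_adj_triLeftApex_left hadj).ne e1.symm
  · have e2 : triLeftApex (predDart D i).1 (predDart D i).2 = (D.markDart i).2 := congrArg Prod.snd key
    rw [predDart_fst] at e2
    rw [e2, Finset.pair_comm]

/-- the split face is a corner only when the split position is that mark. [cite: KhristoforovSmirnov2021, §1.2 (pp. 2–3)] -/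
theorem eq_pos_of_sFaceS_eq_yc {m : ℕ} (hm : m < #(triBdryDarts D.verts)) {i : Fin 5} (h : sFaceS D m = yc D i) : m = D.pos i := by
  rw [← sFaceS_pos_eq_yc i] at h
  unfold sFaceS at h
  have e := eq_of_leftFace_eq (bdart_mem _) (bdart_mem _) h
  have h1 := succ_bdart_pred (D := D) m
  rw [e, succ_bdart_pred] at h1
  have := congrArg D.dpos h1
  rw [dpos_bdart, dpos_bdart, Nat.mod_eq_of_lt (D.pos_lt i), Nat.mod_eq_of_lt hm] at this
  exact this.symm

section Dict

variable {g o : Site 2} (hd0 : (g, o) ∈ D.stretch 0) {x x' : HexVertex} (hxx : hexGraph.Adj x x') (hex : faceEdge x x' = {g, o})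
include hd0

/-- the odd endpoint is a corner iff the split position is that mark. [cite: KhristoforovSmirnov2021, §1.2 (pp. 2–3)] -/
theorem sOfS_eq_yc_iff (T : Finset (Site 2)) (i : Fin 5) : sOfS D g o T = yc D i ↔ mOfS D g o T = D.pos i := by
  obtain ⟨h00, h01, h12, h23, h34, h4L⟩ := pos_facts D
  have hm := mOfS_le hd0 T
  constructor
  · intro h; exact eq_pos_of_sFaceS_eq_yc (by omega) h
  · intro h; unfold sOfS; rw [h]; exact sFaceS_pos_eq_yc i

/-- the corners `y₂, y₃, y₄` are never the odd endpoint. [cite: KhristoforovSmirnov2021, §1.2 Lemma 2 (p. 3)] -/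
theorem yc_ne_sOfS (T : Finset (Site 2)) {a : Fin 5} (ha : 2 ≤ a.val) : yc D a ≠ sOfS D g o T := by
  obtain ⟨h00, h01, h12, h23, h34, h4L⟩ := pos_facts D
  have hm := mOfS_le hd0 T
  intro h
  have := (sOfS_eq_yc_iff hd0 T a).1 h.symm
  have h2 : D.pos 2 ≤ D.pos a := D.pos_strictMono.monotone (show (2 : Fin 5) ≤ a from ha)
  omega

/-- `pos a ≠ m` for the marks `2, 3, 4`. [cite: KhristoforovSmirnov2021, §1.2 Lemma 2 (p. 3)] -/
theorem pos_ne_mOfS (T : Finset (Site 2)) {a : Fin 5} (ha : 2 ≤ a.val) : D.pos a ≠ mOfS D g o T := by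
  intro h
  exact yc_ne_sOfS hd0 T ha (((sOfS_eq_yc_iff hd0 T a).2 h.symm).symm)

include hxx hex

/-- **the class index at a corner odd endpoint** is that corner. [cite: KhristoforovSmirnov2021, §1.2 (loop configurations, arXiv v1 pp. 2–4)] -/
theorem eq_of_inClassb_of_sOfS_eq_yc {T : Finset (Site 2)} {r : Fin 5} {mb : Bool}
    (hcl : InClassb D g o (sOfS D g o T) r mb (PhiS D g o T)) {k : Fin 5} (hk : sOfS D g o T = yc D k) : r = k := by
  classical
  by_contra hrk
  have hg := (stretch_zero_facts hd0).2.1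
  have hY : IsCornerFace D k (sOfS D g o T) := hk ▸ yc_spec D k
  have hs := sOfS_mem_pair hd0 hxx hex T
  rw [Finset.mem_insert, Finset.mem_singleton] at hs
  have hmem := PhiS_mem hd0 T
  have hne : ((loopSpace6b D g o (sOfS D g o T)).filter fun ξ => InClassb D g o (sOfS D g o T) r mb ξ).Nonempty :=
    ⟨_, Finset.mem_filter.2 ⟨hmem, hcl⟩⟩
  rcases hs with e | e
  · have h0 := filter_inClassb_corner_eq_empty (D := D) (e ▸ hxx) (e ▸ hex) hg (e ▸ hY) hrk mb
    rw [h0] at hne; exact Finset.not_nonempty_empty hne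
  · have h0 := filter_inClassb_corner_eq_empty (D := D) (e ▸ hxx.symm) (by rw [faceEdge_comm, e]; exact hex) hg (e ▸ hY) hrk mb
    rw [h0] at hne; exact Finset.not_nonempty_empty hne

omit hd0 hxx hex in
/-- **unwinding a side chain into crossings**: a chain from `q₀` to `q ≠ q₀` is a direct crossing, or two crossings through the third
block `r'` of that colour. [cite: KhristoforovSmirnov2021, §1.2 Lemma 2 (p. 3)] -/
theorem cross_of_sconn {T : Finset (Site 2)} {b : Bool} {q₀ q : ℕ} (h : SConn D (mOfS D g o T) T b q₀ q)
    (hq₀c : decide (q₀ % 2 = 0) = b) (hq₀6 : q₀ < 6) (hne : q ≠ q₀) {X Y Z : Finset (Site 2)} (r' : ℕ)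
    (hX : bsites D (mOfS D g o T) q₀ ⊆ X) (hY : bsites D (mOfS D g o T) q ⊆ Y) (hZ : bsites D (mOfS D g o T) r' ⊆ Z)
    (hthird : ∀ r, r ≠ q₀ → r ≠ q → r < 6 → decide (r % 2 = 0) = b → r = r') :
    Cross D T b X Y ∨ (Cross D T b X Z ∧ Cross D T b Z Y) := by
  rcases sconn_cases h hq₀c hq₀6 with e | ⟨-, -, -, hD⟩ | ⟨r, hr0, hrq, -, hr6, -, hrc, -, hD1, hD2⟩
  · exact absurd e hne
  · exact Or.inl (cross_of_dconn hD hX hY)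
  · obtain rfl := hthird r hr0 hrq hr6 hrc
    exact Or.inr ⟨cross_of_dconn hD1 hX hZ, cross_of_dconn hD2 hZ hY⟩

omit hd0 hxx hex in
/-- the six blocks lie on the six arcs. [cite: KhristoforovSmirnov2021, §1.2 Lemma 2 (p. 3)] -/
theorem bsites_subsets (g o : Site 2) (T : Finset (Site 2)) :
    bsites D (mOfS D g o T) 0 ⊆ arcP0 D g o ∧ bsites D (mOfS D g o T) 1 ⊆ arcP1 D g o ∧ bsites D (mOfS D g o T) 2 ⊆ D.arc 1 ∧
      bsites D (mOfS D g o T) 3 ⊆ D.arc 2 ∧ bsites D (mOfS D g o T) 4 ⊆ D.arc 3 ∧ bsites D (mOfS D g o T) 5 ⊆ D.arc 4 :=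
  ⟨bsites_zero_subset (mOfS_bounds (D := D) T).2, bsites_one_subset (mOfS_bounds (D := D) T).1,
    bsites_succ_subset _ (i := 1) (by decide), bsites_succ_subset _ (i := 2) (by decide), bsites_succ_subset _ (i := 3) (by decide),
    bsites_succ_subset _ (i := 4) (by decide)⟩

omit hxx hex in
/-- **the trivial crossing when `z` is the last mid-edge of `A₀` and `g = v₁` is blue.** [cite: KhristoforovSmirnov2021, §2 eq. (4) (arXiv v1 p. 5)] -/
theorem cross_P0_A1_of_sOfS_eq_yc_one {T : Finset (Site 2)} (h : sOfS D g o T = yc D 1) :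
    Cross D T true (arcP0 D g o) (D.arc 1) := by
  obtain ⟨hd, hg, ho, hgo, hst, hp1⟩ := stretch_zero_facts hd0
  have hm := (sOfS_eq_yc_iff hd0 T 1).1 h
  have hgT : g ∈ T := by by_contra hgT; unfold mOfS at hm; rw [if_neg hgT] at hm; omega
  unfold mOfS at hm; rw [if_pos hgT] at hm
  have hL : D.pos 1 < #(triBdryDarts D.verts) := by have := pos_facts D; omega
  have h1 : (D.dpos (g, o) + 1) % #(triBdryDarts D.verts) = D.pos 1 := by rw [hm, Nat.mod_eq_of_lt hL]
  have e : (g, o) = predDart D 1 := by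
    have := iter_eq_predDart D h1
    rwa [D.iter_dpos hd] at this
  have hg1 : g ∈ D.arc 1 := by
    have : g = D.markSite 1 := by rw [← predDart_fst D 1, ← e]
    rw [this]; exact D.markSite_mem_arc 1
  have hg0 : g ∈ arcP0 D g o := by
    have := bdart_fst_mem_arcP0 (D := D) (g := g) (o := o) (n := D.dpos (g, o)) le_rfl
    rwa [bdart_dpos hd] at this
  exact ⟨g, hg0, g, hg1, PathIn.refl ⟨hg, by simp [hgT]⟩⟩

omit hxx hex in
/-- **the trivial crossing when `z` is the first mid-edge of `A₀` and `g = v₀` is yellow.** [cite: KhristoforovSmirnov2021, §2 eq. (4) (arXiv v1 p. 5)] -/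
theorem cross_P1_A4_of_sOfS_eq_yc_zero {T : Finset (Site 2)} (h : sOfS D g o T = yc D 0) :
    Cross D T false (arcP1 D g o) (D.arc 4) := by
  obtain ⟨hd, hg, ho, hgo, hst, hp1⟩ := stretch_zero_facts hd0
  obtain ⟨h00, h01, h12, h23, h34, h4L⟩ := pos_facts D
  have hm := (sOfS_eq_yc_iff hd0 T 0).1 h
  rw [h00] at hm
  have hgT : g ∉ T := by intro hgT; unfold mOfS at hm; rw [if_pos hgT] at hm; omega
  unfold mOfS at hm; rw [if_neg hgT] at hm
  have e : (g, o) = D.markDart 0 := by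
    rw [← bdart_dpos hd, hm]; show bdart D 0 = triBdryIter D.verts D.base (D.pos 0); rw [h00]; rfl
  have hg4 : g ∈ D.arc 4 := by
    have hgm : g = D.markSite 0 := congrArg Prod.fst e
    have : (bdart D (D.pos 0 + (#(triBdryDarts D.verts) - 1))).1 = D.markSite 0 := predDart_fst D 0
    rw [hgm, ← this, h00, Nat.zero_add]
    exact bdart_fst_mem_arc (i := 4) (by omega) (by rw [nextPos_four]; omega)
  have hg0 : g ∈ arcP1 D g o := by
    have := bdart_fst_mem_arcP1 (D := D) (g := g) (o := o) (n := D.dpos (g, o)) le_rfl hp1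
    rwa [bdart_dpos hd] at this
  exact ⟨g, hg0, g, hg4, PathIn.refl ⟨hg, by simp [hgT]⟩⟩

/-! ### the strand from `z` -/

/-- the strand from `z` ends at `y₁`: `∂_{y₀z} ↔ A₁` blue, possibly through `A₃`. [cite: KhristoforovSmirnov2021, §1.2 Lemma 2 (p. 3)] -/
theorem z_one {T : Finset (Site 2)} (h : (sideGraph (PhiS D g o T)).Reachable (sOfS D g o T) (yc D 1)) :
    Cross D T true (arcP0 D g o) (D.arc 1) ∨ (Cross D T true (arcP0 D g o) (D.arc 3) ∧ Cross D T true (D.arc 3) (D.arc 1)) := by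
  obtain ⟨hb0, hb1, hb2, hb3, hb4, hb5⟩ := bsites_subsets (D := D) g o T
  by_cases hs : sOfS D g o T = yc D 1
  · exact Or.inl (cross_P0_A1_of_sOfS_eq_yc_one hd0 hs)
  have hm1 : D.pos 1 ≠ mOfS D g o T := fun e => hs ((sOfS_eq_yc_iff hd0 T 1).2 e.symm)
  have hlt : mOfS D g o T < D.pos 1 := lt_of_le_of_ne (mOfS_le hd0 T) (Ne.symm hm1)
  have hS := sconn_split_corner hd0 hxx hex T true hm1 h (Ne.symm hs)
  have hS' : SConn D (mOfS D g o T) T true 0 2 := by simpa [cornerBlk_one hlt] using hS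
  exact cross_of_sconn hS' (by decide) (by decide) (by decide) 4 hb0 hb2 hb4
    (fun r h1 h2 h3 h4 => by have := of_decide_eq_true h4; omega)

/-- the strand from `z` ends at `y₀`: `∂_{zy₁} ↔ A₄` yellow, possibly through `A₂`. [cite: KhristoforovSmirnov2021, §1.2 Lemma 2 (p. 3)] -/
theorem z_zero {T : Finset (Site 2)} (h : (sideGraph (PhiS D g o T)).Reachable (sOfS D g o T) (yc D 0)) :
    Cross D T false (arcP1 D g o) (D.arc 4) ∨ (Cross D T false (arcP1 D g o) (D.arc 2) ∧ Cross D T false (D.arc 2) (D.arc 4)) := by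
  obtain ⟨hb0, hb1, hb2, hb3, hb4, hb5⟩ := bsites_subsets (D := D) g o T
  by_cases hs : sOfS D g o T = yc D 0
  · exact Or.inl (cross_P1_A4_of_sOfS_eq_yc_zero hd0 hs)
  have hm0 : D.pos 0 ≠ mOfS D g o T := fun e => hs ((sOfS_eq_yc_iff hd0 T 0).2 e.symm)
  have hlt : 0 < mOfS D g o T := by rw [(pos_facts D).1] at hm0; omega
  have hS := sconn_split_corner hd0 hxx hex T false hm0 h (Ne.symm hs)
  have hS' : SConn D (mOfS D g o T) T false 1 5 := by simpa [cornerBlk_zero hlt] using hS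
  exact cross_of_sconn hS' (by decide) (by decide) (by decide) 3 hb1 hb5 hb3
    (fun r h1 h2 h3 h4 => by have := (decide_eq_false_iff_not).1 h4; omega)

/-- the strand from `z` ends at `y₃`, blue side: `∂_{y₀z} ↔ A₃`, possibly through `A₁`. [cite: KhristoforovSmirnov2021, §1.2 Lemma 2 (p. 3)] -/
theorem z_three_true {T : Finset (Site 2)} (h : (sideGraph (PhiS D g o T)).Reachable (sOfS D g o T) (yc D 3)) :
    Cross D T true (arcP0 D g o) (D.arc 3) ∨ (Cross D T true (arcP0 D g o) (D.arc 1) ∧ Cross D T true (D.arc 1) (D.arc 3)) := by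
  obtain ⟨hb0, hb1, hb2, hb3, hb4, hb5⟩ := bsites_subsets (D := D) g o T
  have hS := sconn_split_corner hd0 hxx hex T true (pos_ne_mOfS hd0 T (a := 3) (by decide)) h (yc_ne_sOfS hd0 T (by decide))
  have hS' : SConn D (mOfS D g o T) T true 0 4 := by simpa [cornerBlk_three] using hS
  exact cross_of_sconn hS' (by decide) (by decide) (by decide) 2 hb0 hb4 hb2
    (fun r h1 h2 h3 h4 => by have := of_decide_eq_true h4; omega)

/-- the strand from `z` ends at `y₃`, yellow side: `∂_{zy₁} ↔ A₂`, possibly through `A₄`. [cite: KhristoforovSmirnov2021, §1.2 Lemma 2 (p. 3)] -/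
theorem z_three_false {T : Finset (Site 2)} (h : (sideGraph (PhiS D g o T)).Reachable (sOfS D g o T) (yc D 3)) :
    Cross D T false (arcP1 D g o) (D.arc 2) ∨ (Cross D T false (arcP1 D g o) (D.arc 4) ∧ Cross D T false (D.arc 4) (D.arc 2)) := by
  obtain ⟨hb0, hb1, hb2, hb3, hb4, hb5⟩ := bsites_subsets (D := D) g o T
  have hS := sconn_split_corner hd0 hxx hex T false (pos_ne_mOfS hd0 T (a := 3) (by decide)) h (yc_ne_sOfS hd0 T (by decide))
  have hS' : SConn D (mOfS D g o T) T false 1 3 := by simpa [cornerBlk_three] using hS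
  exact cross_of_sconn hS' (by decide) (by decide) (by decide) 5 hb1 hb3 hb5
    (fun r h1 h2 h3 h4 => by have := (decide_eq_false_iff_not).1 h4; omega)

/-! ### the strands between corners -/

/-- `y₂ ~ y₃`: `A₁ ↔ A₃` blue, possibly through `∂_{y₀z}`. [cite: KhristoforovSmirnov2021, §1.2 Lemma 2 (p. 3)] -/
theorem c_two_three {T : Finset (Site 2)} (h : (sideGraph (PhiS D g o T)).Reachable (yc D 2) (yc D 3)) :
    Cross D T true (D.arc 1) (D.arc 3) ∨ (Cross D T true (D.arc 1) (arcP0 D g o) ∧ Cross D T true (arcP0 D g o) (D.arc 3)) := by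
  obtain ⟨hb0, hb1, hb2, hb3, hb4, hb5⟩ := bsites_subsets (D := D) g o T
  have h2 := yc_ne_sOfS hd0 T (a := 2) (by decide)
  have h3 := yc_ne_sOfS hd0 T (a := 3) (by decide)
  have hns := not_reachable_sOfS hd0 hxx hex T (a := 2) (c := 3) (by decide) h h2 h3
  have hS := sconn_corner_corner hd0 hxx hex T true (pos_ne_mOfS hd0 T (a := 2) (by decide))
    (pos_ne_mOfS hd0 T (a := 3) (by decide)) hns h h3
  have hS' : SConn D (mOfS D g o T) T true 2 4 := by simpa [cornerBlk_two, cornerBlk_three] using hS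
  exact cross_of_sconn hS' (by decide) (by decide) (by decide) 0 hb2 hb4 hb0
    (fun r h1 h2 h3 h4 => by have := of_decide_eq_true h4; omega)

/-- `y₂ ~ y₀` (possible only if `y₀` is not the odd endpoint): `A₂ ↔ A₄` yellow, possibly through `∂_{zy₁}`. [cite: KhristoforovSmirnov2021, §1.2 Lemma 2 (p. 3)] -/
theorem c_two_zero {T : Finset (Site 2)} (h : (sideGraph (PhiS D g o T)).Reachable (yc D 2) (yc D 0)) (h0 : yc D 0 ≠ sOfS D g o T) :
    Cross D T false (D.arc 2) (D.arc 4) ∨ (Cross D T false (D.arc 2) (arcP1 D g o) ∧ Cross D T false (arcP1 D g o) (D.arc 4)) := by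
  obtain ⟨hb0, hb1, hb2, hb3, hb4, hb5⟩ := bsites_subsets (D := D) g o T
  have h2 := yc_ne_sOfS hd0 T (a := 2) (by decide)
  have hm0 : D.pos 0 ≠ mOfS D g o T := fun e => h0 ((sOfS_eq_yc_iff hd0 T 0).2 e.symm).symm
  have hlt : 0 < mOfS D g o T := by rw [(pos_facts D).1] at hm0; omega
  have hns := not_reachable_sOfS hd0 hxx hex T (a := 2) (c := 0) (by decide) h h2 h0
  have hS := sconn_corner_corner hd0 hxx hex T false (pos_ne_mOfS hd0 T (a := 2) (by decide)) hm0 hns h h0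
  have hS' : SConn D (mOfS D g o T) T false 3 5 := by simpa [cornerBlk_two, cornerBlk_zero hlt] using hS
  exact cross_of_sconn hS' (by decide) (by decide) (by decide) 1 hb3 hb5 hb1
    (fun r h1 h2 h3 h4 => by have := (decide_eq_false_iff_not).1 h4; omega)

/-- `y₂ ~ y₁` (possible only if `y₁` is not the odd endpoint): `A₂ ↔ ∂_{zy₁}` yellow, possibly through `A₄`. [cite: KhristoforovSmirnov2021, §1.2 Lemma 2 (p. 3)] -/
theorem c_two_one {T : Finset (Site 2)} (h : (sideGraph (PhiS D g o T)).Reachable (yc D 2) (yc D 1)) (h1 : yc D 1 ≠ sOfS D g o T) :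
    Cross D T false (D.arc 2) (arcP1 D g o) ∨ (Cross D T false (D.arc 2) (D.arc 4) ∧ Cross D T false (D.arc 4) (arcP1 D g o)) := by
  obtain ⟨hb0, hb1, hb2, hb3, hb4, hb5⟩ := bsites_subsets (D := D) g o T
  have h2 := yc_ne_sOfS hd0 T (a := 2) (by decide)
  have hm1 : D.pos 1 ≠ mOfS D g o T := fun e => h1 ((sOfS_eq_yc_iff hd0 T 1).2 e.symm).symm
  have hlt : mOfS D g o T < D.pos 1 := lt_of_le_of_ne (mOfS_le hd0 T) (Ne.symm hm1)
  have hns := not_reachable_sOfS hd0 hxx hex T (a := 2) (c := 1) (by decide) h h2 h1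
  have hS := sconn_corner_corner hd0 hxx hex T false (pos_ne_mOfS hd0 T (a := 2) (by decide)) hm1 hns h h1
  have hS' : SConn D (mOfS D g o T) T false 3 1 := by simpa [cornerBlk_two, cornerBlk_one hlt] using hS
  exact cross_of_sconn hS' (by decide) (by decide) (by decide) 5 hb3 hb1 hb5
    (fun r h1 h2 h3 h4 => by have := (decide_eq_false_iff_not).1 h4; omega)

/-- `y₄ ~ y₁` (possible only if `y₁` is not the odd endpoint): `A₃ ↔ A₁` blue, possibly through `∂_{y₀z}`. [cite: KhristoforovSmirnov2021, §1.2 Lemma 2 (p. 3)] -/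
theorem c_four_one {T : Finset (Site 2)} (h : (sideGraph (PhiS D g o T)).Reachable (yc D 4) (yc D 1)) (h1 : yc D 1 ≠ sOfS D g o T) :
    Cross D T true (D.arc 3) (D.arc 1) ∨ (Cross D T true (D.arc 3) (arcP0 D g o) ∧ Cross D T true (arcP0 D g o) (D.arc 1)) := by
  obtain ⟨hb0, hb1, hb2, hb3, hb4, hb5⟩ := bsites_subsets (D := D) g o T
  have h4 := yc_ne_sOfS hd0 T (a := 4) (by decide)
  have hm1 : D.pos 1 ≠ mOfS D g o T := fun e => h1 ((sOfS_eq_yc_iff hd0 T 1).2 e.symm).symm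
  have hlt : mOfS D g o T < D.pos 1 := lt_of_le_of_ne (mOfS_le hd0 T) (Ne.symm hm1)
  have hns := not_reachable_sOfS hd0 hxx hex T (a := 4) (c := 1) (by decide) h h4 h1
  have hS := sconn_corner_corner hd0 hxx hex T true (pos_ne_mOfS hd0 T (a := 4) (by decide)) hm1 hns h h1
  have hS' : SConn D (mOfS D g o T) T true 4 2 := by simpa [cornerBlk_four, cornerBlk_one hlt] using hS
  exact cross_of_sconn hS' (by decide) (by decide) (by decide) 0 hb4 hb2 hb0
    (fun r h1 h2 h3 h4 => by have := of_decide_eq_true h4; omega)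

/-! ### ★★ the dictionary: class ⟹ event -/

/-- ★★ **KHRISTOFOROV–SMIRNOV'S LEMMA 2 AT SIX DISORDERS, class by class**: the class `(r, M)` of `Φ(σ)` forces the connectivity event of
`(r, M)` in `σ`. [cite: KhristoforovSmirnov2021, §1.2 Lemma 2 (arXiv v1 pp. 2–3): «∂_{u₁u₂}Ω ↔ ∂_{u₃u₄}Ω in σ if and only if [u₁↭u₄, u₂↭u₃] in ξ(σ)»] -/
theorem ev_of_inClassb (T : Finset (Site 2)) {r : Fin 5} {mb : Bool} (hcl : InClassb D g o (sOfS D g o T) r mb (PhiS D g o T)) :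
    Ev D g o r mb T := by
  have hall := classSupport_b hxx hd0 hex (sOfS_mem_pair hd0 hxx hex T) hcl
  obtain ⟨-, ⟨Y, hY, hlink⟩, ⟨Y₁, Y₂, hY₁, hY₂, hlink2⟩⟩ := hcl
  have eY := eq_yc D hY
  have eY₁ := eq_yc D hY₁
  have eY₂ := eq_yc D hY₂
  subst eY eY₁ eY₂
  rw [xiLinked_iff_reachable] at hlink hlink2
  have hs1 : r ≠ 1 → yc D 1 ≠ sOfS D g o T := fun hr e => hr (eq_of_inClassb_of_sOfS_eq_yc hd0 hxx hex
    ⟨PhiS_mem hd0 T, ⟨_, hY, (xiLinked_iff_reachable _ _ _).2 hlink⟩, ⟨_, _, hY₁, hY₂, (xiLinked_iff_reachable _ _ _).2 hlink2⟩⟩ e.symm)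
  have hs0 : r ≠ 0 → yc D 0 ≠ sOfS D g o T := fun hr e => hr (eq_of_inClassb_of_sOfS_eq_yc hd0 hxx hex
    ⟨PhiS_mem hd0 T, ⟨_, hY, (xiLinked_iff_reachable _ _ _).2 hlink⟩, ⟨_, _, hY₁, hY₂, (xiLinked_iff_reachable _ _ _).2 hlink2⟩⟩ e.symm)
  have B01_Y41 := fun (a : Cross D T true (arcP0 D g o) (D.arc 1)) (c : Cross D T false (arcP1 D g o) (D.arc 4)) =>
    not_B01_Y41 hd0 a c
  have B03_Y41 := fun (a : Cross D T true (arcP0 D g o) (D.arc 3)) (c : Cross D T false (arcP1 D g o) (D.arc 4)) =>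
    not_B03_Y41 hd0 a c
  have B13_Y24 := fun (a : Cross D T true (D.arc 1) (D.arc 3)) (c : Cross D T false (D.arc 2) (D.arc 4)) => not_B13_Y24 a c
  have B03_Y24 := fun (a : Cross D T true (arcP0 D g o) (D.arc 3)) (c : Cross D T false (D.arc 2) (D.arc 4)) => not_B03_Y24 hd0 a c
  have B13_Y12 := fun (a : Cross D T true (D.arc 1) (D.arc 3)) (c : Cross D T false (arcP1 D g o) (D.arc 2)) => not_B13_Y12 hd0 a c
  unfold Ev TwoOf
  rcases hall with rfl | rfl | ⟨rfl, rfl⟩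
  · -- r = 0: the strand from z ends at y₀
    have hZ := z_zero hd0 hxx hex hlink
    cases mb
    · -- (0, A): y₁ ~ y₂
      rw [if_neg (by decide), if_neg (by decide), if_pos (by decide)]
      have h21 : (sideGraph (PhiS D g o T)).Reachable (yc D 2) (yc D 1) := by
        convert hlink2.symm using 3 <;> decide
      have hC := c_two_one hd0 hxx hex h21 (hs1 (by decide))
      rcases hZ with z | ⟨z1, z2⟩
      · rcases hC with c | ⟨c1, c2⟩
        · exact Or.inr (Or.inr ⟨cross_symm z, cross_symm c⟩)
        · exact Or.inr (Or.inl ⟨c1, cross_symm z⟩)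
      · exact Or.inl ⟨z1, z2⟩
    · -- (0, B): y₁ ~ y₄
      rw [if_neg (by decide), if_neg (by decide), if_neg (by decide), if_pos (by decide)]
      have h41 : (sideGraph (PhiS D g o T)).Reachable (yc D 4) (yc D 1) := by
        convert hlink2.symm using 3 <;> decide
      have hC := c_four_one hd0 hxx hex h41 (hs1 (by decide))
      have hY41 : Cross D T false (arcP1 D g o) (D.arc 4) := by
        rcases hZ with z | ⟨z1, z2⟩
        · exact z
        · exfalso
          rcases hC with c | ⟨c1, c2⟩
          · exact B13_Y24 (cross_symm c) z2
          · exact B03_Y24 (cross_symm c1) z2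
      refine ⟨hY41, ?_⟩
      rcases hC with c | ⟨c1, c2⟩
      · exact cross_symm c
      · exact absurd hY41 (fun y => B03_Y41 (cross_symm c1) y)
  · -- r = 1: the strand from z ends at y₁
    have hZ := z_one hd0 hxx hex hlink
    cases mb
    · -- (1, A): y₂ ~ y₃
      rw [if_pos (by decide)]
      have h23 : (sideGraph (PhiS D g o T)).Reachable (yc D 2) (yc D 3) := by
        convert hlink2 using 3 <;> decide
      have hC := c_two_three hd0 hxx hex h23
      rcases hZ with z | ⟨z1, z2⟩
      · rcases hC with c | ⟨c1, c2⟩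
        · exact Or.inl ⟨z, c⟩
        · exact Or.inr (Or.inr ⟨cross_symm c2, z⟩)
      · exact Or.inr (Or.inl ⟨cross_symm z2, cross_symm z1⟩)
    · -- (1, B): y₂ ~ y₀
      rw [if_neg (by decide), if_pos (by decide)]
      have h20 : (sideGraph (PhiS D g o T)).Reachable (yc D 2) (yc D 0) := by
        convert hlink2 using 3 <;> decide
      have hC := c_two_zero hd0 hxx hex h20 (hs0 (by decide))
      have hY24 : Cross D T false (D.arc 2) (D.arc 4) := by
        rcases hC with c | ⟨c1, c2⟩
        · exact c
        · exfalso
          rcases hZ with z | ⟨z1, z2⟩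
          · exact B01_Y41 z c2
          · exact B03_Y41 z1 c2
      refine ⟨?_, hY24⟩
      rcases hZ with z | ⟨z1, z2⟩
      · exact z
      · exact absurd hY24 (fun y => B13_Y24 (cross_symm z2) y)
  · -- (3, A): the strand from z ends at y₃; both sides
    rw [if_neg (by decide), if_neg (by decide), if_neg (by decide), if_neg (by decide), if_pos (by decide)]
    have hZb := z_three_true hd0 hxx hex hlink
    have hZy := z_three_false hd0 hxx hex hlink
    have hB03 : Cross D T true (arcP0 D g o) (D.arc 3) := by
      rcases hZb with z | ⟨z1, z2⟩
      · exact z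
      · exfalso
        rcases hZy with y | ⟨y1, y2⟩
        · exact B13_Y12 z2 y
        · exact B13_Y24 z2 (cross_symm y2)
    refine ⟨hB03, ?_⟩
    rcases hZy with y | ⟨y1, y2⟩
    · exact y
    · exact absurd y1 (fun y => B03_Y41 hB03 y)

end Dict

end Dictionary

section Counting

variable {D : TriMarkedDomain 5}
variable {g o : Site 2} (hd0 : (g, o) ∈ D.stretch 0) {x x' : HexVertex} (hxx : hexGraph.Adj x x') (hex : faceEdge x x' = {g, o})
include hd0 hxx hex

/-! ### ★★★ counting: the class counts are the event counts -/

omit hd0 hxx hex in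
open Classical in
/-- a set partitioned by `∃!`-classes: its cardinality is the sum of the class cardinalities. [folklore] -/
private theorem card_eq_sum_card_classes_s {α β : Type*} [Fintype β] (S : Finset α) (P : β → α → Prop)
    (h : ∀ a ∈ S, ∃! b : β, P b a) : #S = ∑ b, #(S.filter fun a => P b a) := by
  simp only [Finset.card_filter]
  rw [Finset.sum_comm]
  rw [Finset.card_eq_sum_ones]
  refine Finset.sum_congr rfl fun a ha => ?_
  obtain ⟨b, hb, huniq⟩ := h a ha
  rw [Finset.sum_ite, Finset.sum_const_zero, add_zero, Finset.sum_const, smul_eq_mul, mul_one]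
  have : (Finset.univ.filter fun b' : β => P b' a) = {b} := by
    ext b'
    simp only [Finset.mem_filter, Finset.mem_univ, true_and, Finset.mem_singleton]
    exact ⟨fun h' => huniq b' h', fun h' => h' ▸ hb⟩
  rw [this, Finset.card_singleton]

open Classical in
/-- **every colouring has exactly one class**, so the class counts sum to `2 ^ #G`. [cite: KhristoforovSmirnov2021, §1.2 Lemma 2 (pp. 2–3)] -/
theorem sum_card_class : ∑ p : Fin 5 × Bool,
    #(D.verts.powerset.filter fun T => InClassb D g o (sOfS D g o T) p.1 p.2 (PhiS D g o T)) = 2 ^ #D.verts := by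
  have hg := (stretch_zero_facts hd0).2.1
  have hcl : ∀ T ∈ D.verts.powerset, ∃! p : Fin 5 × Bool, InClassb D g o (sOfS D g o T) p.1 p.2 (PhiS D g o T) :=
    fun T _ => sixStructure_gen D hxx hex hg (sOfS_mem_pair hd0 hxx hex T) (PhiS_mem hd0 T)
  have h := card_eq_sum_card_classes_s (β := Fin 5 × Bool) D.verts.powerset
    (fun p T => InClassb D g o (sOfS D g o T) p.1 p.2 (PhiS D g o T)) hcl
  rw [Finset.card_powerset] at h
  exact h.symm

open Classical in
/-- class ⟹ event, as an inequality of counts. [cite: KhristoforovSmirnov2021, §1.2 Lemma 2 (pp. 2–3)] -/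
theorem card_class_le_card_ev (p : Fin 5 × Bool) :
    #(D.verts.powerset.filter fun T => InClassb D g o (sOfS D g o T) p.1 p.2 (PhiS D g o T)) ≤
      #(D.verts.powerset.filter fun T => Ev D g o p.1 p.2 T) := by
  refine Finset.card_le_card fun T hT => ?_
  rw [Finset.mem_filter] at hT ⊢
  exact ⟨hT.1, ev_of_inClassb hd0 hxx hex T hT.2⟩

omit hxx hex in
open Classical in
/-- **the events are disjoint**, so their counts sum to at most `2 ^ #G`. [cite: BollobasRiordan2006, Ch. 7 Lemma 5 p. 193] -/
theorem sum_card_ev_le : ∑ p : Fin 5 × Bool, #(D.verts.powerset.filter fun T => Ev D g o p.1 p.2 T) ≤ 2 ^ #D.verts := by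
  rw [← Finset.card_powerset, ← Finset.card_biUnion]
  · exact Finset.card_le_card (Finset.biUnion_subset.2 fun p _ => Finset.filter_subset _ _)
  · intro p _ p' _ hne
    change Disjoint (D.verts.powerset.filter fun T => Ev D g o p.1 p.2 T) (D.verts.powerset.filter fun T => Ev D g o p'.1 p'.2 T)
    rw [Finset.disjoint_filter]
    intro T _ h h'
    obtain ⟨e1, e2⟩ := ev_excl hd0 h h'
    exact hne (Prod.ext e1 e2)

open Classical in
/-- ★★★ **THE CLASS COUNT IS THE EVENT COUNT**: for every class `(r, M)`, the number of colourings whose `Φ` lies in the class equals the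
number of colourings with the connectivity event of the class. [cite: KhristoforovSmirnov2021, §1.2 Lemma 2 (pp. 2–3)] -/
theorem card_class_eq_card_ev (p : Fin 5 × Bool) :
    #(D.verts.powerset.filter fun T => InClassb D g o (sOfS D g o T) p.1 p.2 (PhiS D g o T)) =
      #(D.verts.powerset.filter fun T => Ev D g o p.1 p.2 T) := by
  by_contra hne
  have hlt : #(D.verts.powerset.filter fun T => InClassb D g o (sOfS D g o T) p.1 p.2 (PhiS D g o T)) <
      #(D.verts.powerset.filter fun T => Ev D g o p.1 p.2 T) := lt_of_le_of_ne (card_class_le_card_ev hd0 hxx hex p) hne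
  have hsum : ∑ q : Fin 5 × Bool, #(D.verts.powerset.filter fun T => InClassb D g o (sOfS D g o T) q.1 q.2 (PhiS D g o T)) <
      ∑ q : Fin 5 × Bool, #(D.verts.powerset.filter fun T => Ev D g o q.1 q.2 T) :=
    Finset.sum_lt_sum (fun q _ => card_class_le_card_ev hd0 hxx hex q) ⟨p, Finset.mem_univ _, hlt⟩
  rw [sum_card_class hd0 hxx hex] at hsum
  exact absurd (sum_card_ev_le hd0) (not_le.2 hsum)

open Classical in
/-- the class counts of the two halves together are the count of colourings by class (the bijection `Φ`). [cite: KhristoforovSmirnov2021, §1.2 Lemma 2, proof (arXiv v1 p. 3): «This map is a bijection»] -/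
theorem card_halves_eq_card_class (r : Fin 5) (mb : Bool) :
    #((loopSpace6b D g o x).filter fun ξ => InClassb D g o x r mb ξ) + #((loopSpace6b D g o x').filter fun ξ => InClassb D g o x' r mb ξ) =
      #(D.verts.powerset.filter fun T => InClassb D g o (sOfS D g o T) r mb (PhiS D g o T)) := by
  have key : ∀ s ∈ ({x, x'} : Finset HexVertex),
      #((loopSpace6b D g o s).filter fun ξ => InClassb D g o s r mb ξ) =
        #(D.verts.powerset.filter fun T => sOfS D g o T = s ∧ InClassb D g o (sOfS D g o T) r mb (PhiS D g o T)) := by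
    intro s hs
    symm
    apply Finset.card_bij (fun T _ => PhiS D g o T)
    · intro T hT
      rw [Finset.mem_filter] at hT ⊢
      obtain ⟨-, hsT, hcl⟩ := hT
      rw [hsT] at hcl
      exact ⟨hsT ▸ PhiS_mem hd0 T, hcl⟩
    · intro T hT T' hT' h
      exact PhiS_injOn hd0 (Finset.mem_coe.2 (Finset.mem_filter.1 hT).1) (Finset.mem_coe.2 (Finset.mem_filter.1 hT').1) h
    · intro ξ hξ
      rw [Finset.mem_filter] at hξ
      obtain ⟨T, hTG, hTξ, hTs⟩ := exists_eq_PhiS hd0 hxx hex hs hξ.1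
      refine ⟨T, ?_, hTξ⟩
      rw [Finset.mem_filter, Finset.mem_powerset]
      refine ⟨hTG, hTs, ?_⟩
      rw [hTs, hTξ]; exact hξ.2
  rw [key x (by simp), key x' (by simp), ← Finset.card_union_of_disjoint]
  · congr 1
    ext T
    simp only [Finset.mem_union, Finset.mem_filter]
    constructor
    · rintro (⟨h1, -, h2⟩ | ⟨h1, -, h2⟩) <;> exact ⟨h1, h2⟩
    · rintro ⟨h1, h2⟩
      have hs := sOfS_mem_pair hd0 hxx hex T
      rw [Finset.mem_insert, Finset.mem_singleton] at hs
      rcases hs with e | e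
      · exact Or.inl ⟨h1, e, h2⟩
      · exact Or.inr ⟨h1, e, h2⟩
  · rw [Finset.disjoint_filter]
    intro T _ h1 h2
    exact hxx.ne (h1.1.symm.trans h2.1)

open Classical in
/-- ★★★ **THE PATTERN COUNT IS THE EVENT COUNT**: the number of colourings with `Match_M(r)` and `e` joined to `y_r` (reference `r`, four
colour changes) equals the number of colourings with the six-change connectivity event of `(r, M)`. [cite: KhristoforovSmirnov2021, §1.2 Lemma 2 (pp. 2–3)] -/
theorem card_pattern_eq_card_ev (c : Bool) (r : Fin 5) (mb : Bool) :
    #(D.verts.powerset.filter fun T : Finset (Site 2) =>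
        (if mb then MatchB D (↑T : Set (Site 2)) r c else MatchA D (↑T : Set (Site 2)) r c) ∧
          (Joined D (↑T : Set (Site 2)) r c x ∨ Joined D (↑T : Set (Site 2)) r c x')) =
      #(D.verts.powerset.filter fun T => Ev D g o r mb T) := by
  have hg := (stretch_zero_facts hd0).2.1
  rw [← sixTransport_b D hxx hex hg c r mb, card_halves_eq_card_class hd0 hxx hex r mb]
  exact card_class_eq_card_ev hd0 hxx hex (r, mb)

/-! ### the events as sets of site configurations, and the probabilities -/

/-- the sites of `G` of colour `b` in a site configuration `σ`. [cite: KhristoforovSmirnov2021, §1.1 (arXiv v1 p. 2)] -/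
def csetS (D : TriMarkedDomain 5) (σ : Set (Site 2)) (b : Bool) : Set (Site 2) := {y | y ∈ D.verts ∧ (y ∈ σ ↔ b = true)}

/-- `X ↔ Y` in colour `b` for a site configuration. [cite: KhristoforovSmirnov2021, §1.1 (arXiv v1 p. 2: «X ↔ Y»)] -/
def CrossS (D : TriMarkedDomain 5) (σ : Set (Site 2)) (b : Bool) (X Y : Finset (Site 2)) : Prop :=
  ∃ a ∈ X, ∃ c ∈ Y, PathIn triGraph (csetS D σ b) a c

/-- **the connectivity events of the five classes** as sets of site configurations (`true` = open). [cite: KhristoforovSmirnov2021, §1.2 Lemma 2 (pp. 2–3)] -/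
def EvS (D : TriMarkedDomain 5) (g o : Site 2) (r : Fin 5) (mb : Bool) (σ : Set (Site 2)) : Prop :=
  if r = 1 ∧ mb = false then
    TwoOf (CrossS D σ true (arcP0 D g o) (D.arc 1)) (CrossS D σ true (D.arc 1) (D.arc 3)) (CrossS D σ true (D.arc 3) (arcP0 D g o))
  else if r = 1 ∧ mb = true then CrossS D σ true (arcP0 D g o) (D.arc 1) ∧ CrossS D σ false (D.arc 2) (D.arc 4)
  else if r = 0 ∧ mb = false then
    TwoOf (CrossS D σ false (arcP1 D g o) (D.arc 2)) (CrossS D σ false (D.arc 2) (D.arc 4)) (CrossS D σ false (D.arc 4) (arcP1 D g o))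
  else if r = 0 ∧ mb = true then CrossS D σ false (arcP1 D g o) (D.arc 4) ∧ CrossS D σ true (D.arc 1) (D.arc 3)
  else if r = 3 ∧ mb = false then CrossS D σ true (arcP0 D g o) (D.arc 3) ∧ CrossS D σ false (arcP1 D g o) (D.arc 2)
  else False

omit hd0 hxx hex in
/-- the colour classes of a finite colouring, as a configuration. [cite: KhristoforovSmirnov2021, §1.2 Lemma 2 (p. 3)] -/
theorem csetS_coe (T : Finset (Site 2)) (b : Bool) : csetS D (↑T : Set (Site 2)) b = cset D T b := by
  ext y; simp [csetS, cset]

omit hd0 hxx hex in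
/-- locality: only the states of the sites of `G` matter. [cite: KhristoforovSmirnov2021, §1.2 Lemma 2 (p. 3)] -/
theorem csetS_inter (σ : Set (Site 2)) (b : Bool) : csetS D (σ ∩ (D.verts : Set (Site 2))) b = csetS D σ b := by
  ext y
  simp only [csetS, Set.mem_setOf_eq, Set.mem_inter_iff, Finset.mem_coe]
  constructor
  · rintro ⟨hy, h⟩; exact ⟨hy, by rw [← h]; exact ⟨fun a => ⟨a, hy⟩, fun a => a.1⟩⟩
  · rintro ⟨hy, h⟩; exact ⟨hy, by rw [← h]; exact ⟨fun a => a.1, fun a => ⟨a, hy⟩⟩⟩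

omit hd0 hxx hex in
/-- the finite and the configuration form of the events agree. [cite: KhristoforovSmirnov2021, §1.2 Lemma 2 (p. 3)] -/
theorem evS_coe (r : Fin 5) (mb : Bool) (T : Finset (Site 2)) : EvS D g o r mb (↑T : Set (Site 2)) ↔ Ev D g o r mb T := by
  unfold EvS Ev CrossS Cross
  simp only [csetS_coe]

omit hd0 hxx hex in
/-- locality of the events. [cite: KhristoforovSmirnov2021, §1.2 Lemma 2 (p. 3)] -/
theorem evS_inter (r : Fin 5) (mb : Bool) (σ : Set (Site 2)) : EvS D g o r mb σ ↔ EvS D g o r mb (σ ∩ (D.verts : Set (Site 2))) := by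
  unfold EvS CrossS
  simp only [csetS_inter]

open Classical in
/-- ★★★ **THE SIX-CHANGE DICTIONARY** (Khristoforov–Smirnov's Lemma 2 at six disorders, for the five-point boundary classes on `A₀`):
`H_{r,M}(e) = P_{1/2}[the connectivity event of (r, M)]` at every boundary `H_G`-edge `e = {x, x'}` of `A₀`, every colour `c`, every
class. [cite: KhristoforovSmirnov2021, §1.2 Lemma 2 (pp. 2–3)] -/
theorem patternProb_eq_prob_evS (c : Bool) (r : Fin 5) (mb : Bool) :
    patternProb D r c mb x x' = (triSitePercolation half).real {σ | EvS D g o r mb σ} := by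
  rw [ha_patternProb_eq_card_div, card_pattern_eq_card_ev hd0 hxx hex c r mb,
    triSitePercolation_half_real_setOf_eq_card_div D.verts (P := fun σ => EvS D g o r mb σ) (fun σ => evS_inter r mb σ)]
  congr 2

/-- ★★★ `H_{1,A}(e) = P[the three blue arcs ∂_{y₀z}, A₁, A₃ are joined]` (at least two of the three direct open crossings).
[cite: KhristoforovSmirnov2021, §1.2 Lemma 2 (pp. 2–3)] -/
theorem patternProb_one_A (c : Bool) : patternProb D 1 c false x x' = (triSitePercolation half).real
    {σ | TwoOf (CrossS D σ true (arcP0 D g o) (D.arc 1)) (CrossS D σ true (D.arc 1) (D.arc 3)) (CrossS D σ true (D.arc 3) (arcP0 D g o))} := by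
  rw [patternProb_eq_prob_evS hd0 hxx hex c 1 false]
  congr 1

/-- ★★★ `H_{1,B}(e) = P[∂_{y₀z} ↔ A₁ open ∧ A₂ ↔ A₄ closed]`. [cite: KhristoforovSmirnov2021, §1.2 Lemma 2 (pp. 2–3)] -/
theorem patternProb_one_B (c : Bool) : patternProb D 1 c true x x' = (triSitePercolation half).real
    {σ | CrossS D σ true (arcP0 D g o) (D.arc 1) ∧ CrossS D σ false (D.arc 2) (D.arc 4)} := by
  rw [patternProb_eq_prob_evS hd0 hxx hex c 1 true]
  congr 1

/-- ★★★ `H_{0,A}(e) = P[the three yellow arcs ∂_{zy₁}, A₂, A₄ are joined]` (at least two of the three direct closed crossings).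
[cite: KhristoforovSmirnov2021, §1.2 Lemma 2 (pp. 2–3)] -/
theorem patternProb_zero_A (c : Bool) : patternProb D 0 c false x x' = (triSitePercolation half).real
    {σ | TwoOf (CrossS D σ false (arcP1 D g o) (D.arc 2)) (CrossS D σ false (D.arc 2) (D.arc 4)) (CrossS D σ false (D.arc 4) (arcP1 D g o))} := by
  rw [patternProb_eq_prob_evS hd0 hxx hex c 0 false]
  congr 1

/-- ★★★ `H_{0,B}(e) = P[∂_{zy₁} ↔ A₄ closed ∧ A₁ ↔ A₃ open]`. [cite: KhristoforovSmirnov2021, §1.2 Lemma 2 (pp. 2–3)] -/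
theorem patternProb_zero_B (c : Bool) : patternProb D 0 c true x x' = (triSitePercolation half).real
    {σ | CrossS D σ false (arcP1 D g o) (D.arc 4) ∧ CrossS D σ true (D.arc 1) (D.arc 3)} := by
  rw [patternProb_eq_prob_evS hd0 hxx hex c 0 true]
  congr 1

/-- ★★★ `H_{3,A}(e) = P[∂_{y₀z} ↔ A₃ open ∧ ∂_{zy₁} ↔ A₂ closed]`. [cite: KhristoforovSmirnov2021, §1.2 Lemma 2 (pp. 2–3)] -/
theorem patternProb_three_A (c : Bool) : patternProb D 3 c false x x' = (triSitePercolation half).real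
    {σ | CrossS D σ true (arcP0 D g o) (D.arc 3) ∧ CrossS D σ false (arcP1 D g o) (D.arc 2)} := by
  rw [patternProb_eq_prob_evS hd0 hxx hex c 3 false]
  congr 1

end Counting


section Partition

variable {D : TriMarkedDomain 5}
variable {g o : Site 2} (hd0 : (g, o) ∈ D.stretch 0) {x x' : HexVertex} (hxx : hexGraph.Adj x x') (hex : faceEdge x x' = {g, o})
include hd0 hxx hex

open Classical in
/-- ★ **THE FIVE EVENTS PARTITION THE COLOURINGS**: for a boundary mid-edge `z` of `A₀` of a five-marked domain, every colouring of `G`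
satisfies EXACTLY ONE of the five connectivity events (the non-crossing partition of the three blue arcs `∂_{y₀z}, A₁, A₃` it induces) —
a purely percolation-side statement, obtained here from the loop-side class structure by counting. [cite: BollobasRiordan2006, Ch. 7 Lemma 5 p. 193] -/
theorem existsUnique_ev {T : Finset (Site 2)} (hT : T ⊆ D.verts) : ∃! p : Fin 5 × Bool, Ev D g o p.1 p.2 T := by
  -- the event filters are disjoint, their cardinalities sum to `2 ^ #G`: so they cover the colourings of `G`
  set S := D.verts.powerset with hS
  have hdisj : ∀ p ∈ (Finset.univ : Finset (Fin 5 × Bool)), ∀ p' ∈ (Finset.univ : Finset (Fin 5 × Bool)), p ≠ p' →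
      Disjoint (S.filter fun T => Ev D g o p.1 p.2 T) (S.filter fun T => Ev D g o p'.1 p'.2 T) := by
    intro p _ p' _ hne
    rw [Finset.disjoint_filter]
    intro T _ h h'
    obtain ⟨e1, e2⟩ := ev_excl hd0 h h'
    exact hne (Prod.ext e1 e2)
  have hcard : #((Finset.univ : Finset (Fin 5 × Bool)).biUnion fun p => S.filter fun T => Ev D g o p.1 p.2 T) = #S := by
    rw [Finset.card_biUnion hdisj]
    have h1 : ∑ p : Fin 5 × Bool, #(S.filter fun T => Ev D g o p.1 p.2 T) =
        ∑ p : Fin 5 × Bool, #(S.filter fun T => InClassb D g o (sOfS D g o T) p.1 p.2 (PhiS D g o T)) :=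
      Finset.sum_congr rfl fun p _ => (card_class_eq_card_ev hd0 hxx hex p).symm
    rw [h1, sum_card_class hd0 hxx hex, hS, Finset.card_powerset]
  have hsub : ((Finset.univ : Finset (Fin 5 × Bool)).biUnion fun p => S.filter fun T => Ev D g o p.1 p.2 T) ⊆ S :=
    Finset.biUnion_subset.2 fun p _ => Finset.filter_subset _ _
  have heq := Finset.eq_of_subset_of_card_le hsub hcard.ge
  have hTS : T ∈ S := by rw [hS, Finset.mem_powerset]; exact hT
  rw [← heq, Finset.mem_biUnion] at hTS
  obtain ⟨p, -, hp⟩ := hTS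
  rw [Finset.mem_filter] at hp
  refine ⟨p, hp.2, fun p' hp' => ?_⟩
  obtain ⟨e1, e2⟩ := ev_excl hd0 hp' hp.2
  exact Prod.ext e1 e2

end Partition

/-! ## Every arc: the six-change dictionary transported by the cyclic symmetry of the marks (`TriMarkedDomain.rotate`) -/

section Rot

variable {D : TriMarkedDomain 5}

/-! ### the five-point objects under rotation -/

/-- the two sites of a hexagonal edge between adjacent faces are adjacent in `𝕋`. [cite: KhristoforovSmirnov2021, §1.2 (pp. 2–3)] -/
theorem adj_of_faceEdge {F F' : HexVertex} {u v : Site 2} (hadj : hexGraph.Adj F F') (he : faceEdge F F' = {u, v}) :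
    triGraph.Adj u v := by
  have hI : hexFaceVertices F ∩ hexFaceVertices F' = {u, v} := he
  have hux : u ∈ hexFaceVertices F := Finset.mem_of_mem_inter_left (s₂ := hexFaceVertices F') (by rw [hI]; simp)
  have hvx : v ∈ hexFaceVertices F := Finset.mem_of_mem_inter_left (s₂ := hexFaceVertices F') (by rw [hI]; simp)
  have huv : u ≠ v := by
    intro e
    have : #(faceEdge F F') = 2 := ((hexGraph_adj_iff F F').1 hadj).2
    rw [he, e] at this
    simp at this
  exact adj_of_mem_hexFaceVertices hux hvx huv

/-- the five-point corner faces are the generic ones. [cite: BollobasRiordan2006, Ch. 7 §7.2.2 pp. 191–193] -/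
theorem isCornerFace_iff_ml (D : TriMarkedDomain 5) (i : Fin 5) (F : HexVertex) :
    IsCornerFace D i F ↔ MarkedLoops.IsCornerFace D i F := Iff.rfl

/-- **the corner faces shift by one under rotation.** [cite: BollobasRiordan2006, Ch. 7 §7.2.2 pp. 191–193] -/
theorem rotate_isCornerFace5 (D : TriMarkedDomain 5) (i : Fin 5) (F : HexVertex) :
    IsCornerFace D.rotate i F ↔ IsCornerFace D (i + 1) F := by
  rw [isCornerFace_iff_ml, isCornerFace_iff_ml]
  exact TriMarkedDomain.rotate_isCornerFace D i F

/-- **the stretch index shifts by one under rotation** (boundary darts). [cite: BollobasRiordan2006, Ch. 7 §7.2.2 pp. 191–193] -/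
theorem rotate_stretchIdx (D : TriMarkedDomain 5) {d : Site 2 × Site 2} (hd : d ∈ triBdryDarts D.verts) :
    stretchIdx D.rotate d = stretchIdx D d - 1 := by
  have hd' : d ∈ triBdryDarts D.rotate.verts := hd
  set i := stretchIdx D d with hi
  have hmem : d ∈ D.stretch i := by
    rw [hi, stretchIdx_eq_posIdx D hd]; exact mem_stretch_posIdx D hd
  have hmem' : d ∈ D.rotate.stretch (i - 1) := by
    rw [TriMarkedDomain.rotate_stretch, sub_add_cancel]; exact hmem
  rw [stretchIdx_eq_posIdx D.rotate hd']
  exact (posIdx_dpos_of_mem_stretch D.rotate hmem').2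

/-- the reference colouring shifts with the marks. [cite: KhristoforovSmirnov2021, §1.2 (pp. 2–3)] -/
theorem arcColour_sub_one (r : Fin 5) (c : Bool) (i : Fin 5) : arcColour r c (i - 1) = arcColour (r + 1) c i := by
  revert r c i; decide

/-- **bicoloured bonds under rotation** (adjacent sites): reference `r` of the rotated domain = reference `r + 1` of `D`.
[cite: KhristoforovSmirnov2021, §1.2 (pp. 2–3)] -/
theorem rotate_bicol (D : TriMarkedDomain 5) (σ : SiteConfig (Site 2)) (r : Fin 5) (c : Bool) {u v : Site 2} (huv : triGraph.Adj u v) :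
    Bicol D.rotate σ r c u v ↔ Bicol D σ (r + 1) c u v := by
  have h1 : ∀ {a b : Site 2}, triGraph.Adj a b → a ∈ D.verts → b ∉ D.verts →
      arcColour r c (stretchIdx D.rotate (a, b)) = arcColour (r + 1) c (stretchIdx D (a, b)) := by
    intro a b hab ha hb
    rw [rotate_stretchIdx D (mem_triBdryDarts.2 ⟨ha, hb, hab⟩), arcColour_sub_one]
  unfold Bicol
  constructor
  · rintro (h | ⟨hu, hv, h⟩ | ⟨hv, hu, h⟩)
    · exact Or.inl h
    · exact Or.inr (Or.inl ⟨hu, hv, by rwa [← h1 huv hu hv]⟩)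
    · exact Or.inr (Or.inr ⟨hv, hu, by rwa [← h1 huv.symm hv hu]⟩)
  · rintro (h | ⟨hu, hv, h⟩ | ⟨hv, hu, h⟩)
    · exact Or.inl h
    · exact Or.inr (Or.inl ⟨hu, hv, by rwa [h1 huv hu hv]⟩)
    · exact Or.inr (Or.inr ⟨hv, hu, by rwa [h1 huv.symm hv hu]⟩)

/-- interface steps under rotation. [cite: KhristoforovSmirnov2021, §1.2 (pp. 2–3)] -/
theorem rotate_iStep (D : TriMarkedDomain 5) (σ : SiteConfig (Site 2)) (r : Fin 5) (c : Bool) (F F' : HexVertex) :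
    IStep D.rotate σ r c F F' ↔ IStep D σ (r + 1) c F F' := by
  unfold IStep
  constructor
  · rintro ⟨hadj, u, v, he, hb⟩
    exact ⟨hadj, u, v, he, (rotate_bicol D σ r c (adj_of_faceEdge hadj he)).1 hb⟩
  · rintro ⟨hadj, u, v, he, hb⟩
    exact ⟨hadj, u, v, he, (rotate_bicol D σ r c (adj_of_faceEdge hadj he)).2 hb⟩

/-- the interface-step relation under rotation, as an equality of relations. [cite: KhristoforovSmirnov2021, §1.2 (pp. 2–3)] -/
theorem rotate_iStep_eq (D : TriMarkedDomain 5) (σ : SiteConfig (Site 2)) (r : Fin 5) (c : Bool) :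
    IStep D.rotate σ r c = IStep D σ (r + 1) c := by
  funext F F'; exact propext (rotate_iStep D σ r c F F')

/-- Auxiliary. [folklore] -/
private theorem fin5_two_one : ∀ r : Fin 5, r + 2 + 1 = r + 1 + 2 := by decide

/-- Auxiliary. [folklore] -/
private theorem fin5_four_one : ∀ r : Fin 5, r + 4 + 1 = r + 1 + 4 := by decide

/-- the interface part under rotation. [cite: KhristoforovSmirnov2021, §1.2 (pp. 2–3)] -/
theorem rotate_inInterface (D : TriMarkedDomain 5) (σ : SiteConfig (Site 2)) (r : Fin 5) (c : Bool) (F : HexVertex) :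
    InInterface D.rotate σ r c F ↔ InInterface D σ (r + 1) c F := by
  unfold InInterface
  rw [rotate_iStep_eq]
  constructor
  · rintro ⟨j, hj, Y, hY, hR⟩
    refine ⟨j + 1, fun e => hj (add_right_cancel e), Y, (rotate_isCornerFace5 D j Y).1 hY, hR⟩
  · rintro ⟨j, hj, Y, hY, hR⟩
    refine ⟨j - 1, fun e => hj ?_, Y, (rotate_isCornerFace5 D (j - 1) Y).2 (by rw [sub_add_cancel]; exact hY), hR⟩
    rw [← e, sub_add_cancel]

/-- the interface part under rotation, as an equality of predicates. [cite: KhristoforovSmirnov2021, §1.2 (pp. 2–3)] -/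
theorem rotate_inInterface_eq (D : TriMarkedDomain 5) (σ : SiteConfig (Site 2)) (r : Fin 5) (c : Bool) :
    InInterface D.rotate σ r c = InInterface D σ (r + 1) c := by
  funext F; exact propext (rotate_inInterface D σ r c F)

/-- «joined to the reference corner» under rotation. [cite: KhristoforovSmirnov2021, §1.2 (pp. 2–3)] -/
theorem rotate_joined (D : TriMarkedDomain 5) (σ : SiteConfig (Site 2)) (r : Fin 5) (c : Bool) (x : HexVertex) :
    Joined D.rotate σ r c x ↔ Joined D σ (r + 1) c x := by
  unfold Joined
  rw [rotate_inInterface_eq]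
  have hH : HStep D.rotate = HStep D := rfl
  rw [hH]
  constructor
  · rintro ⟨h1, Y, hY, h2, hR⟩
    exact ⟨h1, Y, (rotate_isCornerFace5 D r Y).1 hY, h2, hR⟩
  · rintro ⟨h1, Y, hY, h2, hR⟩
    exact ⟨h1, Y, (rotate_isCornerFace5 D r Y).2 hY, h2, hR⟩

/-- matching `A` under rotation. [cite: KhristoforovSmirnov2021, §1.2 (pp. 2–3)] -/
theorem rotate_matchA (D : TriMarkedDomain 5) (σ : SiteConfig (Site 2)) (r : Fin 5) (c : Bool) :
    MatchA D.rotate σ r c ↔ MatchA D σ (r + 1) c := by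
  unfold MatchA
  rw [rotate_iStep_eq]
  have e : r + 2 + 1 = r + 1 + 2 := fin5_two_one r
  constructor
  · rintro ⟨Y₁, Y₂, h1, h2, hR⟩
    refine ⟨Y₁, Y₂, (rotate_isCornerFace5 D (r + 1) Y₁).1 h1, ?_, hR⟩
    rw [← e]; exact (rotate_isCornerFace5 D (r + 2) Y₂).1 h2
  · rintro ⟨Y₁, Y₂, h1, h2, hR⟩
    refine ⟨Y₁, Y₂, (rotate_isCornerFace5 D (r + 1) Y₁).2 h1, (rotate_isCornerFace5 D (r + 2) Y₂).2 ?_, hR⟩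
    rw [e]; exact h2

/-- matching `B` under rotation. [cite: KhristoforovSmirnov2021, §1.2 (pp. 2–3)] -/
theorem rotate_matchB (D : TriMarkedDomain 5) (σ : SiteConfig (Site 2)) (r : Fin 5) (c : Bool) :
    MatchB D.rotate σ r c ↔ MatchB D σ (r + 1) c := by
  unfold MatchB
  rw [rotate_iStep_eq]
  have e : r + 4 + 1 = r + 1 + 4 := fin5_four_one r
  constructor
  · rintro ⟨Y₁, Y₂, h1, h2, hR⟩
    refine ⟨Y₁, Y₂, (rotate_isCornerFace5 D (r + 1) Y₁).1 h1, ?_, hR⟩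
    rw [← e]; exact (rotate_isCornerFace5 D (r + 4) Y₂).1 h2
  · rintro ⟨Y₁, Y₂, h1, h2, hR⟩
    refine ⟨Y₁, Y₂, (rotate_isCornerFace5 D (r + 1) Y₁).2 h1, (rotate_isCornerFace5 D (r + 4) Y₂).2 ?_, hR⟩
    rw [e]; exact h2

/-- ★ **the five-point pattern probabilities under rotation**: `H_{r,M}` of the rotated domain is `H_{r+1,M}` of `D`.
[cite: KhristoforovSmirnov2021, §2 Definition 3 (arXiv v1 p. 4: u₁, u₂, u₃ in counterclockwise order)] -/
theorem rotate_patternProb (D : TriMarkedDomain 5) (r : Fin 5) (c m : Bool) (x x' : HexVertex) :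
    patternProb D.rotate r c m x x' = patternProb D (r + 1) c m x x' := by
  unfold patternProb
  congr 1
  ext σ
  simp only [Set.mem_setOf_eq, rotate_joined]
  cases m
  · simp only [Bool.false_eq_true, if_false, rotate_matchA]
  · simp only [if_true, rotate_matchB]

/-! ### the sub-arcs cut at `z`, rotation-invariant form -/

open Classical in
/-- **the sub-arc `∂_{y_a z}` of `A_a`**: the tails of the darts `succ^t (markDart a)` up to the first `t` reaching the dart of `z`.
[cite: KhristoforovSmirnov2021, §1.2 (p. 2: the arc ∂_{zw}Ω)] -/
noncomputable def arcToA (D : TriMarkedDomain 5) (a : Fin 5) (g o : Site 2) : Finset (Site 2) :=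
  ((Finset.range #(triBdryDarts D.verts)).filter fun t =>
      ∀ s < t, triBdryIter D.verts (D.markDart a) s ≠ (g, o)).image fun t => (triBdryIter D.verts (D.markDart a) t).1

open Classical in
/-- **the sub-arc `∂_{z y_{a+1}}` of `A_a`**: the tails of the darts `succ^t (g, o)` as long as they stay in the stretch `A_a`.
[cite: KhristoforovSmirnov2021, §1.2 (p. 2: the arc ∂_{zw}Ω)] -/
noncomputable def arcFromA (D : TriMarkedDomain 5) (a : Fin 5) (g o : Site 2) : Finset (Site 2) :=
  ((Finset.range #(triBdryDarts D.verts)).filter fun t =>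
      ∀ s ≤ t, triBdryIter D.verts (g, o) s ∈ D.stretch a).image fun t => (triBdryIter D.verts (g, o) t).1

/-- `arcToA` under rotation. [cite: KhristoforovSmirnov2021, §1.2 (arXiv v1 p. 2)] -/
theorem rotate_arcToA (D : TriMarkedDomain 5) (a : Fin 5) (g o : Site 2) : arcToA D.rotate a g o = arcToA D (a + 1) g o := by
  unfold arcToA
  rw [TriMarkedDomain.rotate_markDart]
  rfl

/-- `arcFromA` under rotation. [cite: KhristoforovSmirnov2021, §1.2 (arXiv v1 p. 2)] -/
theorem rotate_arcFromA (D : TriMarkedDomain 5) (a : Fin 5) (g o : Site 2) : arcFromA D.rotate a g o = arcFromA D (a + 1) g o := by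
  classical
  unfold arcFromA
  simp only [TriMarkedDomain.rotate_stretch, TriMarkedDomain.rotate_verts]

/-- membership of `bdart n` in the stretch `A₀`: the position is `< pos 1`. [cite: KhristoforovSmirnov2021, §1.2 (arXiv v1 p. 2)] -/
theorem bdart_mem_stretch_zero_iff (n : ℕ) : bdart D n ∈ D.stretch 0 ↔ n % #(triBdryDarts D.verts) < D.pos 1 := by
  obtain ⟨h00, h01, h12, h23, h34, h4L⟩ := pos_facts D
  unfold stretch
  rw [h00, nextPos_of_lt D 0 (by decide)]
  change bdart D n ∈ (Finset.Ico 0 (D.pos 1)).image (fun m => triBdryIter D.verts D.base m) ↔ _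
  simp only [Finset.mem_image, Finset.mem_Ico]
  constructor
  · rintro ⟨m, ⟨-, hm⟩, h⟩
    have := D.isTriDisc.iter_eq_iter_iff.1 h
    rw [Nat.mod_eq_of_lt (by omega)] at this
    rw [← this]; exact hm
  · intro h
    exact ⟨n % #(triBdryDarts D.verts), ⟨Nat.zero_le _, h⟩, D.isTriDisc.iter_mod n⟩

/-- **on `A₀`: `arcToA D 0 = ∂_{y₀ z}`.** [cite: KhristoforovSmirnov2021, §1.2 (arXiv v1 p. 2)] -/
theorem arcToA_zero {g o : Site 2} (hd : (g, o) ∈ triBdryDarts D.verts) : arcToA D 0 g o = arcP0 D g o := by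
  classical
  have hL := D.isTriDisc.card_pos
  have hpL := D.dpos_lt hd
  have hm0 : D.markDart 0 = D.base := by
    show triBdryIter D.verts D.base (D.pos 0) = D.base; rw [(pos_facts D).1]; rfl
  have key : ∀ s, s < #(triBdryDarts D.verts) → (bdart D s = (g, o) ↔ s = D.dpos (g, o)) := by
    intro s hs
    constructor
    · intro h; have := D.dpos_eq_of_iter_eq hs h; exact this.symm
    · intro h; rw [h, bdart_dpos hd]
  unfold arcToA arcP0
  rw [hm0]
  ext x
  simp only [Finset.mem_image, Finset.mem_filter, Finset.mem_range]
  constructor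
  · rintro ⟨t, ⟨ht, hall⟩, rfl⟩
    have htle : t ≤ D.dpos (g, o) := by
      by_contra hlt
      exact hall (D.dpos (g, o)) (by omega) (bdart_dpos hd)
    exact ⟨bdart D t, ⟨t, by omega, rfl⟩, rfl⟩
  · rintro ⟨d, ⟨t, ht, rfl⟩, rfl⟩
    refine ⟨t, ⟨by omega, fun s hs h => ?_⟩, rfl⟩
    have := (key s (by omega)).1 h
    omega

/-- **on `A₀`: `arcFromA D 0 = ∂_{z y₁}`.** [cite: KhristoforovSmirnov2021, §1.2 (arXiv v1 p. 2)] -/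
theorem arcFromA_zero {g o : Site 2} (hd0 : (g, o) ∈ D.stretch 0) : arcFromA D 0 g o = arcP1 D g o := by
  classical
  obtain ⟨hd, -, -, -, -, hp1⟩ := stretch_zero_facts hd0
  obtain ⟨h00, h01, h12, h23, h34, h4L⟩ := pos_facts D
  have hL := D.isTriDisc.card_pos
  have hpL := D.dpos_lt hd
  set p := D.dpos (g, o) with hp
  have hiter : ∀ s, triBdryIter D.verts (g, o) s = bdart D (p + s) := by
    intro s; rw [← bdart_dpos hd, ← hp]; unfold bdart; rw [triBdryIter_add]
  have key : ∀ t, t < #(triBdryDarts D.verts) →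
      ((∀ s ≤ t, triBdryIter D.verts (g, o) s ∈ D.stretch 0) ↔ p + t < D.pos 1) := by
    intro t ht
    constructor
    · intro h
      by_contra hge
      have hs0 : D.pos 1 - p ≤ t := by omega
      have := h (D.pos 1 - p) hs0
      rw [hiter, bdart_mem_stretch_zero_iff, show p + (D.pos 1 - p) = D.pos 1 by omega, Nat.mod_eq_of_lt (by omega)] at this
      exact lt_irrefl _ this
    · intro h s hs
      rw [hiter, bdart_mem_stretch_zero_iff, Nat.mod_eq_of_lt (by omega)]
      omega
  unfold arcFromA arcP1
  ext x
  simp only [Finset.mem_image, Finset.mem_filter, Finset.mem_range, Finset.mem_Ico]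
  constructor
  · rintro ⟨t, ⟨ht, hall⟩, rfl⟩
    have hlt := (key t ht).1 hall
    exact ⟨bdart D (p + t), ⟨p + t, ⟨by omega, hlt⟩, rfl⟩, by rw [hiter]⟩
  · rintro ⟨d, ⟨n, ⟨hn1, hn2⟩, rfl⟩, rfl⟩
    refine ⟨n - p, ⟨by omega, (key (n - p) (by omega)).2 (by omega)⟩, ?_⟩
    rw [hiter, show p + (n - p) = n by omega]

/-! ### iterated rotation, packaged -/

/-- **the rotation package**: `D'` is `D` with its marks shifted by `a` — same sites; stretches, pattern probabilities and the sub-arcs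
shift by `a`. [cite: BollobasRiordan2006, Ch. 7 §7.2.2 pp. 191–193] -/
def RotPkg (D D' : TriMarkedDomain 5) (a : Fin 5) : Prop :=
  D'.verts = D.verts ∧ (∀ j, D'.stretch j = D.stretch (a + j)) ∧ (∀ r c m x x', patternProb D' r c m x x' = patternProb D (a + r) c m x x') ∧
    (∀ j g o, arcToA D' j g o = arcToA D (a + j) g o) ∧ (∀ j g o, arcFromA D' j g o = arcFromA D (a + j) g o)

/-- no rotation. [cite: BollobasRiordan2006, Ch. 7 §7.2.2 pp. 191–193] -/
theorem rotPkg_zero (D : TriMarkedDomain 5) : RotPkg D D 0 :=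
  ⟨rfl, fun j => by rw [zero_add], fun r c m x x' => by rw [zero_add], fun j g o => by rw [zero_add], fun j g o => by rw [zero_add]⟩

/-- one more rotation. [cite: BollobasRiordan2006, Ch. 7 §7.2.2 pp. 191–193] -/
theorem rotPkg_step {D D' : TriMarkedDomain 5} {a : Fin 5} (h : RotPkg D D' a) (b : Fin 5) (hb : b = a + 1) : RotPkg D D'.rotate b := by
  obtain ⟨hv, hst, hpat, hto, hfrom⟩ := h
  have harith : ∀ j : Fin 5, b + j = a + (j + 1) := fun j => by rw [hb, add_assoc, add_comm 1 j]
  refine ⟨hv, fun j => ?_, fun r c m x x' => ?_, fun j g o => ?_, fun j g o => ?_⟩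
  · rw [TriMarkedDomain.rotate_stretch, hst, harith]
  · rw [rotate_patternProb, hpat, harith]
  · rw [rotate_arcToA, hto, harith]
  · rw [rotate_arcFromA, hfrom, harith]

/-- every shift of the marks is realised by an iterated rotation. [cite: BollobasRiordan2006, Ch. 7 §7.2.2 pp. 191–193] -/
theorem exists_rotPkg (D : TriMarkedDomain 5) (a : Fin 5) : ∃ D' : TriMarkedDomain 5, RotPkg D D' a := by
  have h0 := rotPkg_zero D
  have h1 := rotPkg_step h0 1 (by decide)
  have h2 := rotPkg_step h1 2 (by decide)
  have h3 := rotPkg_step h2 3 (by decide)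
  have h4 := rotPkg_step h3 4 (by decide)
  fin_cases a
  · exact ⟨_, h0⟩
  · exact ⟨_, h1⟩
  · exact ⟨_, h2⟩
  · exact ⟨_, h3⟩
  · exact ⟨_, h4⟩

/-- the usable form of the package for the arc `A_a`. [cite: BollobasRiordan2006, Ch. 7 §7.2.2 pp. 191–193] -/
theorem rotN_package (D : TriMarkedDomain 5) (a : Fin 5) : ∃ D' : TriMarkedDomain 5,
    D'.verts = D.verts ∧ D'.stretch 0 = D.stretch a ∧ (∀ j, D'.arc j = D.arc (a + j)) ∧
      (∀ r c m x x', patternProb D' r c m x x' = patternProb D (a + r) c m x x') ∧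
      (∀ g o, arcToA D' 0 g o = arcToA D a g o) ∧ (∀ g o, arcFromA D' 0 g o = arcFromA D a g o) ∧ CrossS D' = CrossS D := by
  obtain ⟨D', hv, hst, hpat, hto, hfrom⟩ := exists_rotPkg D a
  refine ⟨D', hv, by rw [hst, add_zero], fun j => ?_, hpat, fun g o => by rw [hto, add_zero], fun g o => by rw [hfrom, add_zero], ?_⟩
  · unfold TriMarkedDomain.arc; rw [hst]
  · funext σ b X Y
    unfold CrossS csetS
    rw [hv]

section AllArcs

variable {g o : Site 2} {a : Fin 5} (hd : (g, o) ∈ D.stretch a) {x x' : HexVertex} (hxx : hexGraph.Adj x x') (hex : faceEdge x x' = {g, o})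
include hd hxx hex

/-- ★★★ **SIX-CHANGE DICTIONARY, EVERY ARC — `H_{a+1,A}`**: at a boundary edge of `A_a`, `H_{a+1,A}(e) = P[at least two of
{∂_{y_a z} ↔ A_{a+1}, A_{a+1} ↔ A_{a+3}, A_{a+3} ↔ ∂_{y_a z}} open]`. [cite: KhristoforovSmirnov2021, §1.2 Lemma 2 (pp. 2–3)] -/
theorem patternProb_succ_A (c : Bool) : patternProb D (a + 1) c false x x' = (triSitePercolation half).real
    {σ | TwoOf (CrossS D σ true (arcToA D a g o) (D.arc (a + 1))) (CrossS D σ true (D.arc (a + 1)) (D.arc (a + 3)))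
      (CrossS D σ true (D.arc (a + 3)) (arcToA D a g o))} := by
  obtain ⟨D', hv, hst, harc, hpat, hto, -, hcr⟩ := rotN_package D a
  have hd' : (g, o) ∈ D'.stretch 0 := by rw [hst]; exact hd
  have hdm' : (g, o) ∈ triBdryDarts D'.verts := (stretch_zero_facts hd').1
  have h := patternProb_one_A hd' hxx hex c
  rw [hpat, ← arcToA_zero hdm', hto, harc, harc, hcr] at h
  exact h

/-- ★★★ **EVERY ARC — `H_{a+1,B}`**: `H_{a+1,B}(e) = P[∂_{y_a z} ↔ A_{a+1} open ∧ A_{a+2} ↔ A_{a+4} closed]`.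
[cite: KhristoforovSmirnov2021, §1.2 Lemma 2 (pp. 2–3)] -/
theorem patternProb_succ_B (c : Bool) : patternProb D (a + 1) c true x x' = (triSitePercolation half).real
    {σ | CrossS D σ true (arcToA D a g o) (D.arc (a + 1)) ∧ CrossS D σ false (D.arc (a + 2)) (D.arc (a + 4))} := by
  obtain ⟨D', hv, hst, harc, hpat, hto, -, hcr⟩ := rotN_package D a
  have hd' : (g, o) ∈ D'.stretch 0 := by rw [hst]; exact hd
  have hdm' : (g, o) ∈ triBdryDarts D'.verts := (stretch_zero_facts hd').1
  have h := patternProb_one_B hd' hxx hex c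
  rw [hpat, ← arcToA_zero hdm', hto, harc, harc, harc, hcr] at h
  exact h

/-- ★★★ **EVERY ARC — `H_{a,A}`**: `H_{a,A}(e) = P[at least two of {∂_{z y_{a+1}} ↔ A_{a+2}, A_{a+2} ↔ A_{a+4}, A_{a+4} ↔ ∂_{z y_{a+1}}} closed]`.
[cite: KhristoforovSmirnov2021, §1.2 Lemma 2 (pp. 2–3)] -/
theorem patternProb_self_A (c : Bool) : patternProb D a c false x x' = (triSitePercolation half).real
    {σ | TwoOf (CrossS D σ false (arcFromA D a g o) (D.arc (a + 2))) (CrossS D σ false (D.arc (a + 2)) (D.arc (a + 4)))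
      (CrossS D σ false (D.arc (a + 4)) (arcFromA D a g o))} := by
  obtain ⟨D', hv, hst, harc, hpat, -, hfrom, hcr⟩ := rotN_package D a
  have hd' : (g, o) ∈ D'.stretch 0 := by rw [hst]; exact hd
  have h := patternProb_zero_A hd' hxx hex c
  rw [hpat, ← arcFromA_zero hd', hfrom, harc, harc, hcr, add_zero] at h
  exact h

/-- ★★★ **EVERY ARC — `H_{a,B}`**: `H_{a,B}(e) = P[∂_{z y_{a+1}} ↔ A_{a+4} closed ∧ A_{a+1} ↔ A_{a+3} open]`.
[cite: KhristoforovSmirnov2021, §1.2 Lemma 2 (pp. 2–3)] -/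
theorem patternProb_self_B (c : Bool) : patternProb D a c true x x' = (triSitePercolation half).real
    {σ | CrossS D σ false (arcFromA D a g o) (D.arc (a + 4)) ∧ CrossS D σ true (D.arc (a + 1)) (D.arc (a + 3))} := by
  obtain ⟨D', hv, hst, harc, hpat, -, hfrom, hcr⟩ := rotN_package D a
  have hd' : (g, o) ∈ D'.stretch 0 := by rw [hst]; exact hd
  have h := patternProb_zero_B hd' hxx hex c
  rw [hpat, ← arcFromA_zero hd', hfrom, harc, harc, harc, hcr, add_zero] at h
  exact h

/-- ★★★ **EVERY ARC — `H_{a+3,A}`**: `H_{a+3,A}(e) = P[∂_{y_a z} ↔ A_{a+3} open ∧ ∂_{z y_{a+1}} ↔ A_{a+2} closed]`.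
[cite: KhristoforovSmirnov2021, §1.2 Lemma 2 (pp. 2–3)] -/
theorem patternProb_add_three_A (c : Bool) : patternProb D (a + 3) c false x x' = (triSitePercolation half).real
    {σ | CrossS D σ true (arcToA D a g o) (D.arc (a + 3)) ∧ CrossS D σ false (arcFromA D a g o) (D.arc (a + 2))} := by
  obtain ⟨D', hv, hst, harc, hpat, hto, hfrom, hcr⟩ := rotN_package D a
  have hd' : (g, o) ∈ D'.stretch 0 := by rw [hst]; exact hd
  have hdm' : (g, o) ∈ triBdryDarts D'.verts := (stretch_zero_facts hd').1
  have h := patternProb_three_A hd' hxx hex c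
  rw [hpat, ← arcToA_zero hdm', ← arcFromA_zero hd', hto, hfrom, harc, harc, hcr] at h
  exact h

end AllArcs

end Rot

section BoundaryData

variable {D : TriMarkedDomain 5}
variable {g o : Site 2} {a : Fin 5} (hd : (g, o) ∈ D.stretch a) {x x' : HexVertex} (hxx : hexGraph.Adj x x') (hex : faceEdge x x' = {g, o})
include hd hxx hex

/-- the edge `{x, x'}` is a boundary edge of the arc `A_a` in the sense of `Bdry.IsBoundaryEdge`. [cite: BollobasRiordan2006, Ch. 7 §7.2.2 pp. 191–195] -/
theorem isBoundaryEdge_of_stretch : IsBoundaryEdge D a x x' := ⟨hxx, (g, o), hd, hex⟩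

/-! ### ★★★ the boundary data of the sparse five-point observables as crossing probabilities (the discrete Riemann–Hilbert data) -/

/-- **on `A_a`: `F_{a+2}(e) = −τ · P[∂_{y_a z} ↔ A_{a+1} open ∧ A_{a+2} ↔ A_{a+4} closed]`** (one ray). [cite: KhristoforovSmirnov2021, §2 eq. (4) (arXiv v1 p. 5)] -/
theorem sparseObs_arc_add_two_eq_prob (c : Bool) : sparseObs D (a + 2) c x x' =
    -(tau * ((triSitePercolation half).real
      {σ | CrossS D σ true (arcToA D a g o) (D.arc (a + 1)) ∧ CrossS D σ false (D.arc (a + 2)) (D.arc (a + 4))} : ℂ)) := by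
  rw [sparseObs_arc_add_two (isBoundaryEdge_of_stretch hd hxx hex) c, patternProb_succ_B hd hxx hex c]

/-- **on `A_a`: `F_{a+3}(e) = P[∂_{y_a z} ↔ A_{a+3} open ∧ ∂_{z y_{a+1}} ↔ A_{a+2} closed]`** (real). [cite: KhristoforovSmirnov2021, §2 eq. (4) (arXiv v1 p. 5)] -/
theorem sparseObs_arc_add_three_eq_prob (c : Bool) : sparseObs D (a + 3) c x x' =
    ((triSitePercolation half).real
      {σ | CrossS D σ true (arcToA D a g o) (D.arc (a + 3)) ∧ CrossS D σ false (arcFromA D a g o) (D.arc (a + 2))} : ℂ) := by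
  rw [sparseObs_arc_add_three (isBoundaryEdge_of_stretch hd hxx hex) c, patternProb_add_three_A hd hxx hex c]

/-- **on `A_a`: `F_{a+4}(e) = −τ² · P[∂_{z y_{a+1}} ↔ A_{a+4} closed ∧ A_{a+1} ↔ A_{a+3} open]`** (one ray). [cite: KhristoforovSmirnov2021, §2 eq. (4) (arXiv v1 p. 5)] -/
theorem sparseObs_arc_add_four_eq_prob (c : Bool) : sparseObs D (a + 4) c x x' =
    -(tau ^ 2 * ((triSitePercolation half).real
      {σ | CrossS D σ false (arcFromA D a g o) (D.arc (a + 4)) ∧ CrossS D σ true (D.arc (a + 1)) (D.arc (a + 3))} : ℂ)) := by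
  rw [sparseObs_arc_add_four (isBoundaryEdge_of_stretch hd hxx hex) c, patternProb_self_B hd hxx hex c]

/-- **on `A_a`: `F_a(e) = P[three yellow arcs joined] − τ² · P[∂_{y_a z} ↔ A_{a+1} open ∧ A_{a+2} ↔ A_{a+4} closed]`** (two classes).
[cite: KhristoforovSmirnov2021, §2 eq. (4) (arXiv v1 p. 5)] -/
theorem sparseObs_arc_self_eq_prob (c : Bool) : sparseObs D a c x x' =
    ((triSitePercolation half).real
      {σ | TwoOf (CrossS D σ false (arcFromA D a g o) (D.arc (a + 2))) (CrossS D σ false (D.arc (a + 2)) (D.arc (a + 4)))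
        (CrossS D σ false (D.arc (a + 4)) (arcFromA D a g o))} : ℂ) -
      tau ^ 2 * ((triSitePercolation half).real
        {σ | CrossS D σ true (arcToA D a g o) (D.arc (a + 1)) ∧ CrossS D σ false (D.arc (a + 2)) (D.arc (a + 4))} : ℂ) := by
  rw [sparseObs_arc_self (isBoundaryEdge_of_stretch hd hxx hex) c, patternProb_self_A hd hxx hex c, patternProb_succ_B hd hxx hex c]

/-- **on `A_a`: `F_{a+1}(e) = P[three blue arcs joined] − τ · P[∂_{z y_{a+1}} ↔ A_{a+4} closed ∧ A_{a+1} ↔ A_{a+3} open]`** (two classes).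
[cite: KhristoforovSmirnov2021, §2 eq. (4) (arXiv v1 p. 5)] -/
theorem sparseObs_arc_add_one_eq_prob (c : Bool) : sparseObs D (a + 1) c x x' =
    ((triSitePercolation half).real
      {σ | TwoOf (CrossS D σ true (arcToA D a g o) (D.arc (a + 1))) (CrossS D σ true (D.arc (a + 1)) (D.arc (a + 3)))
        (CrossS D σ true (D.arc (a + 3)) (arcToA D a g o))} : ℂ) -
      tau * ((triSitePercolation half).real
        {σ | CrossS D σ false (arcFromA D a g o) (D.arc (a + 4)) ∧ CrossS D σ true (D.arc (a + 1)) (D.arc (a + 3))} : ℂ) := by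
  rw [sparseObs_arc_add_one (isBoundaryEdge_of_stretch hd hxx hex) c, patternProb_succ_A hd hxx hex c, patternProb_self_B hd hxx hex c]

end BoundaryData

end Six

end Literature.Probability.Percolation.FivePoint
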